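import Literature.AlgebraicGeometry.Shioda1982.KoblitzOgusRelationsTwentyFourPrime
import Literature.AlgebraicGeometry.Shioda1982.HodgeQuadruplesTwelvePrime
import HarnessLib

/-!
# The pair-free Hodge `4`-multisets of level `24p` (`p ≥ 17` prime) in Chinese-remainder coordinates

Topic `Literature/AlgebraicGeometry/Shioda1982`; the level `m = 24p` of Shioda 1982, Lemma 1 / Prop. 4 (Q′) and Aoki–Shioda 1983,
Theorem (𝔅²ₘ) (ii), one storey above the tree's `HodgeQuadruplesTwelvePrime` (`m = 12p`): the first level of the series
`2p, 4p, 6p, 2ʲp, 12p, 24p` divisible by `24`, where Meyer–Neutsch's Tabelle 1 has its largest row below `N = 30` (`N = 24`: the `8`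
unit orbits of `(1, 6, 19, 22)`, `(1, 8, 17, 22)`, `(1, 8, 19, 20)`, `(1, 11, 17, 19)`, `(1, 12, 16, 19)`, `(1, 12, 17, 18)`,
`(1, 13, 16, 18)`, `(2, 9, 16, 21)`, of sizes `8, 8, 4, 2, 4, 4, 4, 4` — Shioda's `Δ(24) = 38`). THEOREM (no named fact, no `sorry`):
**`classify_hodgeMultiset_twentyFourPrime`** — a pair-free Hodge `4`-multiset `s` over `ℤ/24p`, `p ≥ 17` prime (`IsHodgeMultiset s`,
Shioda's semigroup condition), is `{x, x + 12p, −2x, 12p}`, `{x, x + 12p, 2x + 12p, −4x}` or `{x, x + 8p, x + 16p, −3x}` for some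
residue `x` (Shioda's `αᵢ, βᵢ` with `m′ = 12p` and `γⱼ` with `m″ = 8p`), or `x·r` with `x = t·p`, `t ∈ {1, 5, 7, 11, 13, 17, 19, 23}`,
and `r` one of the `8` representatives above or one of the doubles `(2, 8, 18, 20)`, `(2, 12, 16, 18)` of the two exceptional
quadruples `(1, 4, 9, 10)`, `(1, 6, 8, 9)` of level `12` (together: the `46` multiples by `p` of the pair-free Hodge quadruples of
level `24` outside the three standard families) [cite: Shioda1982PicardFermat, §4 Lemma 1 p. 728, Prop. 4 (Q′) p. 729, table p. 727
(m = 12, 24)]; [cite: AokiShioda1983, §2 Theorem (𝔅²ₘ) (ii) a)–c)]; [cite: MeyerNeutsch1981Fermatquadrupel, Tabelle 1 p. 54 (N = 12, 24)].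
Also public: the transfer `isHodgeMultiset_transfer_twentyFourPrime` (level `24p → 12p`).

## The proof (ours — character relations in Chinese-remainder coordinates plus the transfer to level `12p`; NOT the printed argument)

(1) RELATIONS. `KoblitzOgusRelationsTwentyFourPrime` proves, from Koblitz–Ogus in the tree's form `KoblitzOgus.hodge_eq_combination`
[cite: Deligne1982HodgeCycles, Rem. 7.16 (a)], five families of linear relations for the odd part `o(q) = #_q − #_{−q}` of the
multiplicity function of a Hodge multiset of level `24p` in the coordinates `ℤ/24p ≅ ℤ/24 × ℤ/p` (`crtPt24`): the functionals of
the odd characters `ψ = χ₃χ₋₈` and `χ₈` vanish (`relPsi_twentyFourPrime`, `relChi8_twentyFourPrime`), and the `Γ`-functionals of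
`χ₋₈`, `χ₄`, `χ₃` — the unit part corrected by the classes of the even residues `3e`, resp. `2e, 6e′`, resp. `2e, 4e′, 8e″` — are
constant on `ℤ/p ∖ 0` (`gammaChiM8_twentyFourPrime`, `gammaChi4_twentyFourPrime`, `gammaChi3_twentyFourPrime`); elementary shadows
of the relations of the odd characters in Aoki's criterion [cite: Aoki1983, Prop. 2.2]. Here they are repackaged as `RelsOdd` /
`RelsEven` on the multiset of coordinates and evaluated on explicit multisets through the character tables mod `24` (`cPsi_cons`, …;
`decide`d table lemmas). Four consequences are used: `two_odd_core` (an odd two-element configuration `{x, y}` with `x` off the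
fibre `pℤ/24p` satisfying `ψ`, `χ₈`, `Γ(χ₋₈)` has `y = x + 12p` — the instances `ψ(c)`, `χ₈(c/3)`, `Γ₋₈(c/3) = Γ₋₈(c)`),
`delta_not_rels` (`{v, v + 4p, v − 4p, −3v}` violates `ψ`/`χ₈`), `halfpair_odd` (`{u₁, 12p − u₁, u₃, 12p − u₃}`, all odd,
violates them) and `even_pair` (`Γ(χ₄)` at `12a, 4a` vs `2a` and `Γ(χ₃)` at `12a, 6a, 3a` vs `2a` force the even members
`pt(f, 24a), pt(f′, −24a)` next to two odd members in `pℤ/24p` into `f, f′ ∈ {0, 12}`). Only `n·a ≠ 0` in `ℤ/p` for `a ≠ 0` and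
`13`-smooth `n` is used (`smooth_mul_ne_zero`), whence `p ≥ 17`.
(2) TRANSFER. For a unit `u` of `ℤ/24p` also `u(1 + 12p)` is one; adding the two norm equations shows that `T(s)` = (odd members
mod `12p`) + 2·((even members)/2 mod `12p`) is a Hodge multiset of level `12p` (`isHodgeMultiset_transfer_twentyFourPrime`, verbatim
the argument of `isHodgeMultiset_transfer_twelvePrime`), to which the tree's `classify_hodgeMultiset_twelvePrime` applies.
(3) CASES by the number of odd members (even, since `Σ = 0`). All members in `pℤ/24p`: the norm equations at the units `pt(u, 1)`
make `s/p` a pair-free Hodge quadruple of level `24`, and those (`68` multisets, `table24`: types α, β, γ and the `8 + 2` exceptional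
orbits) are enumerated by the kernel (`lev24_slice_1, …, lev24_slice_12`: `decide` over the pairs `(k₂, k₃) ∈ (ℤ/24)²` next to a
member `k₁` of least representative, `≤ 12`; `table24_forms`) — `fibre_zero`. No odd member: `T(s) = 2σ` with `σ` a pair-free Hodge
quadruple of level `12p`; double back (`case_all_even`; the exceptional `σ` give the rows `(2, 8, 18, 20)`, `(2, 12, 16, 18)`). Two
odd members `x, y`: if one is off `pℤ`, then `y = x + 12p` and `{x̄, ẑ, ŵ, 6p}` is a Hodge quadruple of level `12p` — a pair in it
means `s = α_x`, otherwise it is the level-`12p` `α_y` with `y ∈ {x̄, x̄ + 6p}` and `s = β_x` (`case_two_odd`; `6p ∉ β_y` is seen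
modulo `4`, and `γ_y` and the exceptional quadruples lie in `pℤ/12p ∌ x̄`); both in `pℤ` is impossible (`case_two_odd_fibre`: the
unit `pt(1, −1)` would give `y = −x`). Four odd members: `s̄ = s mod 12p` has odd members, so it is `γ_y` if pair-free, and the four
lifts of `γ_y` with `Σ = 0` are `γ_u` or a `δ`-quadruple (excluded); if `s̄` has a pair, `halfpair_odd` (`case_all_odd`).
Numerical companions (cell `pub-hfermat`, outside Lean): `code/lit/picard/rel24p.py` (the five families annihilate every `D_{M,z}`,
`M ∣ 24p`, `p = 5, …, 23`), `code/lit/picard/scope24p.py` (brute force at `m = 24p`, `p ≤ 17`: at `p = 17` the indecomposable Hodge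
quadruples are `α` (`202`) ∪ `β` (`200`; two in common) ∪ `γ` (`134`) ∪ the `46` multiples of level-`24` quadruples, while
`p = 11, 13` are genuinely exceptional), `code/lit/picard/core24p.py` (which instances of the relations the four consequences need).

HONEST FRAMING (cell `pub-hfermat`): explicit algebraic cycles for specific Hodge classes on Fermat/Delsarte varieties; residual open
instances listed; no claim on general Hodge. (This file reproduces a printed structure theorem; the proof route is this formalisation's.)
-/

namespace Literature.AlgebraicGeometry.Shioda1982

open Finset Multiset
open Literature.AlgebraicGeometry.HodgeTheory Literature.AlgebraicGeometry.HodgeTheory.FermatCharacter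

section TwentyFourPrimeClassification

variable {p : ℕ}

set_option linter.unusedSimpArgs false -- uniform simp sets across the case analyses (as in `HodgeQuadruplesTwelvePrime`)

/-! ### `ℤ/24p ≅ ℤ/24 × ℤ/p`: Chinese-remainder coordinates (as in `KoblitzOgusRelationsTwentyFourPrime`) -/

-- BEGIN DUP (verbatim from KoblitzOgusRelationsTwentyFourPrime.lean; private there, hence repeated)
/-- The Chinese-remainder isomorphism `ℤ/24p ≃+* ℤ/24 × ℤ/p`. [folklore] -/
private def crt (h : Nat.Coprime 24 p) : ZMod (24 * p) ≃+* ZMod 24 × ZMod p := ZMod.chineseRemainder h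

/-- The residue with coordinates `(e, b)`. [folklore] -/
private def pt (h : Nat.Coprime 24 p) (e : ZMod 24) (b : ZMod p) : ZMod (24 * p) := (crt h).symm (e, b)

/-- First coordinate = residue mod `24`. [folklore] -/
private theorem crt_fst (h : Nat.Coprime 24 p) [NeZero (24 * p)] (w : ZMod (24 * p)) :
    (crt h w).1 = (w.val : ZMod 24) := by
  conv_lhs => rw [← ZMod.natCast_zmod_val w]
  rw [map_natCast, Prod.fst_natCast]

/-- Second coordinate = residue mod `p`. [folklore] -/
private theorem crt_snd (h : Nat.Coprime 24 p) [NeZero (24 * p)] (w : ZMod (24 * p)) :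
    (crt h w).2 = (w.val : ZMod p) := by
  conv_lhs => rw [← ZMod.natCast_zmod_val w]
  rw [map_natCast, Prod.snd_natCast]

/-- `crt (pt e b) = (e, b)`. [folklore] -/
private theorem crt_pt (h : Nat.Coprime 24 p) (e : ZMod 24) (b : ZMod p) : crt h (pt h e b) = (e, b) :=
  (crt h).apply_symm_apply (e, b)

/-- `pt (crt w) = w`. [folklore] -/
private theorem pt_crt (h : Nat.Coprime 24 p) (w : ZMod (24 * p)) : pt h (crt h w).1 (crt h w).2 = w :=
  (crt h).symm_apply_apply w

/-- `pt` is injective. [folklore] -/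
private theorem pt_inj (h : Nat.Coprime 24 p) {e e' : ZMod 24} {b b' : ZMod p} :
    pt h e b = pt h e' b' ↔ e = e' ∧ b = b' := by
  rw [pt, pt, (crt h).symm.injective.eq_iff, Prod.mk.injEq]

/-- `pt` and negation. [folklore] -/
private theorem neg_pt (h : Nat.Coprime 24 p) (e : ZMod 24) (b : ZMod p) : -pt h e b = pt h (-e) (-b) := by
  rw [pt, pt, ← (crt h).symm.map_neg, Prod.neg_mk]

/-- `pt` and natural multiples. [folklore] -/
private theorem natCast_mul_pt (h : Nat.Coprime 24 p) (k : ℕ) (e : ZMod 24) (b : ZMod p) :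
    (k : ZMod (24 * p)) * pt h e b = pt h (k * e) (k * b) := by
  rw [pt, pt, ← nsmul_eq_mul, ← _root_.map_nsmul, Prod.smul_mk, nsmul_eq_mul, nsmul_eq_mul]
-- END DUP

/-- `(24, p) = 1` for a prime `p ≥ 5`. [folklore] -/
private theorem coprime_twentyFour (hp : p.Prime) (h5 : 5 ≤ p) : Nat.Coprime 24 p := by
  have h2 : Nat.Coprime 2 p := (Nat.coprime_primes Nat.prime_two hp).2 (by omega)
  have h3 : Nat.Coprime 3 p := (Nat.coprime_primes Nat.prime_three hp).2 (by omega)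
  have h8 : Nat.Coprime 8 p := Nat.Coprime.mul_left (Nat.Coprime.mul_left h2 h2) h2
  exact Nat.Coprime.mul_left h8 h3

/-- `pt` is additive. [folklore] -/
private theorem pt_add (h : Nat.Coprime 24 p) (e e' : ZMod 24) (b b' : ZMod p) :
    pt h e b + pt h e' b' = pt h (e + e') (b + b') := by
  rw [pt, pt, pt, ← (crt h).symm.map_add, Prod.mk_add_mk]

/-- `pt` is multiplicative. [folklore] -/
private theorem pt_mul (h : Nat.Coprime 24 p) (e e' : ZMod 24) (b b' : ZMod p) :
    pt h e b * pt h e' b' = pt h (e * e') (b * b') := by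
  rw [pt, pt, pt, ← (crt h).symm.map_mul, Prod.mk_mul_mk]

/-- `pt` and subtraction. [folklore] -/
private theorem pt_sub (h : Nat.Coprime 24 p) (e e' : ZMod 24) (b b' : ZMod p) :
    pt h e b - pt h e' b' = pt h (e - e') (b - b') := by
  rw [sub_eq_add_neg, neg_pt, pt_add, ← sub_eq_add_neg, ← sub_eq_add_neg]

/-- `⟨pt e b⟩ mod 24` is `⟨e⟩`. [folklore] -/
private theorem val_pt_mod_twentyFour (h : Nat.Coprime 24 p) [NeZero (24 * p)] (e : ZMod 24) (b : ZMod p) :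
    (pt h e b).val % 24 = e.val := by
  have := crt_fst h (pt h e b)
  rw [crt_pt] at this
  have h2 := congrArg ZMod.val this
  rw [ZMod.val_natCast] at h2
  exact h2.symm

/-- `⟨pt e b⟩ mod 2` is `⟨e⟩ mod 2`. [folklore] -/
private theorem val_pt_mod_two (h : Nat.Coprime 24 p) [NeZero (24 * p)] (e : ZMod 24) (b : ZMod p) :
    (pt h e b).val % 2 = e.val % 2 := by
  rw [← Nat.mod_mod_of_dvd _ (by norm_num : 2 ∣ 24), val_pt_mod_twentyFour]

/-- The prime `p` as a residue mod `24`. -/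
local notation "π" => ((p : ℕ) : ZMod 24)

/-- `crt p = (p mod 24, 0)`. [folklore] -/
private theorem crt_P (h : Nat.Coprime 24 p) [NeZero (24 * p)] : crt h (p : ZMod (24 * p)) = (π, 0) := by
  rw [Prod.ext_iff, crt_fst, crt_snd, ZMod.val_natCast]
  have hp24 : p % (24 * p) = p := Nat.mod_eq_of_lt (by have := NeZero.ne (24 * p); omega)
  rw [hp24]
  exact ⟨rfl, ZMod.natCast_self p⟩

/-- `p = pt (p mod 24) 0`. [folklore] -/
private theorem P_eq_pt (h : Nat.Coprime 24 p) [NeZero (24 * p)] : (p : ZMod (24 * p)) = pt h π 0 := by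
  rw [← pt_crt h (p : ZMod (24 * p)), crt_P]

/-- `p mod 24` is a unit residue for a prime `p ≥ 5`. [folklore] -/
private theorem pi_eq (hp : p.Prime) (h5 : 5 ≤ p) :
    π = 1 ∨ π = 5 ∨ π = 7 ∨ π = 11 ∨ π = 13 ∨ π = 17 ∨ π = 19 ∨ π = 23 := by
  have h2 : ¬ 2 ∣ p := fun h ↦ by
    have := (Nat.prime_dvd_prime_iff_eq Nat.prime_two hp).1 h; omega
  have h3 : ¬ 3 ∣ p := fun h ↦ by
    have := (Nat.prime_dvd_prime_iff_eq Nat.prime_three hp).1 h; omega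
  have h24 : p % 24 = 1 ∨ p % 24 = 5 ∨ p % 24 = 7 ∨ p % 24 = 11 ∨ p % 24 = 13 ∨ p % 24 = 17 ∨ p % 24 = 19 ∨
      p % 24 = 23 := by omega
  rw [← ZMod.natCast_mod p 24]
  rcases h24 with e | e | e | e | e | e | e | e <;> rw [e]
  · exact Or.inl rfl
  · exact Or.inr (Or.inl rfl)
  · exact Or.inr (Or.inr (Or.inl rfl))
  · exact Or.inr (Or.inr (Or.inr (Or.inl rfl)))
  · exact Or.inr (Or.inr (Or.inr (Or.inr (Or.inl rfl))))
  · exact Or.inr (Or.inr (Or.inr (Or.inr (Or.inr (Or.inl rfl)))))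
  · exact Or.inr (Or.inr (Or.inr (Or.inr (Or.inr (Or.inr (Or.inl rfl))))))
  · exact Or.inr (Or.inr (Or.inr (Or.inr (Or.inr (Or.inr (Or.inr rfl))))))

/-- `π² = 1`, `12π = 12` in `ℤ/24`; `4π ∈ {4, 20}`. [folklore] -/
private theorem pi_facts (hp : p.Prime) (h5 : 5 ≤ p) :
    π * π = 1 ∧ (12 : ZMod 24) * π = 12 ∧ ((4 : ZMod 24) * π = 4 ∨ (4 : ZMod 24) * π = 20) := by
  rcases pi_eq hp h5 with h | h | h | h | h | h | h | h <;> rw [h] <;> decide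

/-- `k·p = pt (kπ) 0`. [folklore] -/
private theorem natCast_mul_P (h : Nat.Coprime 24 p) [NeZero (24 * p)] (k : ℕ) :
    ((k * p : ℕ) : ZMod (24 * p)) = pt h (k * π) 0 := by
  rw [Nat.cast_mul, P_eq_pt h, natCast_mul_pt, mul_zero]

/-- `12p = pt 12 0`. [folklore] -/
private theorem twelveP_eq_pt (h : Nat.Coprime 24 p) [NeZero (24 * p)] (hp : p.Prime) (h5 : 5 ≤ p) :
    ((12 * p : ℕ) : ZMod (24 * p)) = pt h 12 0 := by
  rw [natCast_mul_P h, Nat.cast_ofNat, (pi_facts hp h5).2.1]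

/-- `pt 1 1 = 1`. [folklore] -/
private theorem pt_one (h : Nat.Coprime 24 p) : pt h 1 1 = 1 := by
  show (crt h).symm (1, 1) = 1
  exact _root_.map_one (crt h).symm

/-- `pt 0 0 = 0`. [folklore] -/
private theorem pt_zero (h : Nat.Coprime 24 p) : pt h 0 0 = 0 := by
  show (crt h).symm (0, 0) = 0
  exact _root_.map_zero (crt h).symm

/-- `pt u 1` is a unit for `u² = 1`. [folklore] -/
private theorem isUnit_pt (h : Nat.Coprime 24 p) {u : ZMod 24} (hu : u * u = 1) : IsUnit (pt h u 1) :=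
  IsUnit.of_mul_eq_one (pt h u 1) (by rw [pt_mul, hu, mul_one, pt_one])

/-- The parity of the first coordinate is the parity of the residue. [folklore] -/
private theorem fst_val_mod_two (h : Nat.Coprime 24 p) [NeZero (24 * p)] (w : ZMod (24 * p)) :
    (crt h w).1.val % 2 = w.val % 2 := by
  rw [crt_fst, ZMod.val_natCast, Nat.mod_mod_of_dvd _ (by norm_num : 2 ∣ 24)]

/-! ### Small multiples in `ℤ/p`, `p ≥ 17` -/

/-- A natural number all of whose prime factors are `≤ 13` is non-zero in `ℤ/p`, `p ≥ 17` prime. [folklore] -/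
private theorem natCast_ne_zero_smooth (hp : p.Prime) (h17 : 17 ≤ p) {n : ℕ}
    (hn : n ∣ 2 ^ 7 * 3 ^ 3 * 5 ^ 2 * 7 * 11 * 13) : (n : ZMod p) ≠ 0 := by
  intro h0
  rw [ZMod.natCast_eq_zero_iff] at h0
  have hpn := dvd_trans h0 hn
  have hP := (Nat.Prime.prime hp)
  rcases hP.dvd_or_dvd hpn with h1 | h1
  · rcases hP.dvd_or_dvd h1 with h2 | h2
    · rcases hP.dvd_or_dvd h2 with h3 | h3
      · rcases hP.dvd_or_dvd h3 with h4 | h4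
        · rcases hP.dvd_or_dvd h4 with h5 | h5
          · have := Nat.le_of_dvd (by norm_num) (Nat.Prime.dvd_of_dvd_pow hp h5); omega
          · have := Nat.le_of_dvd (by norm_num) (Nat.Prime.dvd_of_dvd_pow hp h5); omega
        · have := Nat.le_of_dvd (by norm_num) (Nat.Prime.dvd_of_dvd_pow hp h4); omega
      · have := Nat.le_of_dvd (by norm_num) h3; omega
    · have := Nat.le_of_dvd (by norm_num) h2; omega
  · have := Nat.le_of_dvd (by norm_num) h1; omega

/-- `n·a ≠ 0` for `a ≠ 0` and `n` with prime factors `≤ 13`. [folklore] -/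
private theorem smooth_mul_ne_zero (hp : p.Prime) (h17 : 17 ≤ p) {a : ZMod p} (ha : a ≠ 0) {n : ℕ}
    (hn : n ∣ 2 ^ 7 * 3 ^ 3 * 5 ^ 2 * 7 * 11 * 13) : (n : ZMod p) * a ≠ 0 := by
  haveI := Fact.mk hp
  exact mul_ne_zero (natCast_ne_zero_smooth hp h17 hn) ha

/-! ### The odd part in coordinates; character tables mod `24` -/

/-- The odd part of the multiplicity function of `T : Multiset (ℤ/24 × ℤ/p)`: `o(q) = #_q T − #_{−q} T`. [folklore] -/
private def oc (T : Multiset (ZMod 24 × ZMod p)) (q : ZMod 24 × ZMod p) : ℤ := (count q T : ℤ) - count (-q) T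

/-- `oddCt` at a coordinate point is the odd part of `s.map crt`. [folklore] -/
private theorem oddCt_crtPt24 (h : Nat.Coprime 24 p) (s : Multiset (ZMod (24 * p))) (e : ZMod 24) (c : ZMod p) :
    oddCt s (crtPt24 h e c) = oc (s.map (crt h)) (e, c) := by
  classical
  have hc : ∀ q : ZMod 24 × ZMod p, count q (s.map (crt h)) = count ((crt h).symm q) s := fun q ↦ by
    rw [← Multiset.count_map_eq_count' _ _ (crt h).symm.injective, Multiset.map_map]
    simp only [Function.comp_def, RingEquiv.symm_apply_apply, Multiset.map_id']
  simp only [oddCt, oc, hc]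
  show (count ((crt h).symm (e, c)) s : ℤ) - count (-(crt h).symm (e, c)) s =
    count ((crt h).symm (e, c)) s - count ((crt h).symm (-(e, c))) s
  rw [map_neg]


/-- The odd character mod `4`, on `ℤ/24` (`0` on even residues). [folklore] -/
private def chi4 (f : ZMod 24) : ℤ := if f.val % 4 = 1 then 1 else if f.val % 4 = 3 then -1 else 0

/-- The odd character mod `3`, on `ℤ/24` (`0` on multiples of `3`). [folklore] -/
private def chi3 (f : ZMod 24) : ℤ := if f.val % 3 = 1 then 1 else if f.val % 3 = 2 then -1 else 0

/-- The even character `χ₈ = (2/·)` mod `8`, on `ℤ/24` (`0` on even residues). [folklore] -/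
private def chi8 (f : ZMod 24) : ℤ :=
  if f.val % 8 = 1 ∨ f.val % 8 = 7 then 1 else if f.val % 8 = 3 ∨ f.val % 8 = 5 then -1 else 0

/-- The odd character `χ₋₈ = (−2/·)` mod `8`, on `ℤ/24` (`0` on even residues). [folklore] -/
private def chim8 (f : ZMod 24) : ℤ :=
  if f.val % 8 = 1 ∨ f.val % 8 = 3 then 1 else if f.val % 8 = 5 ∨ f.val % 8 = 7 then -1 else 0

/-- `ψ = χ₃χ₋₈` (supported on the units: `+1` on `1, 5, 19, 23`, `−1` on `7, 11, 13, 17`). [folklore] -/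
private def tPsi (f : ZMod 24) : ℤ := chi3 f * chim8 f

/-- `χ₈` restricted to the units. [folklore] -/
private def tU8 (f : ZMod 24) : ℤ := chi8 f * (chi3 f * chi3 f)

/-- `χ₈(f/3) = −χ₈(f)` on the odd multiples `f` of `3` (`3 ↦ 1`, `9 ↦ −1`, `15 ↦ −1`, `21 ↦ 1`). [folklore] -/
private def tT8 (f : ZMod 24) : ℤ := -chi8 f * (1 - chi3 f * chi3 f)

/-- `χ₋₈` restricted to the units. [folklore] -/
private def tUm8 (f : ZMod 24) : ℤ := chim8 f * (chi3 f * chi3 f)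

/-- `χ₋₈(f/3) = χ₋₈(f)` on the odd multiples of `3` (`3, 9 ↦ 1`, `15, 21 ↦ −1`). [folklore] -/
private def tTm8 (f : ZMod 24) : ℤ := chim8 f * (1 - chi3 f * chi3 f)

/-- `χ₄` restricted to the units. [folklore] -/
private def tU4 (f : ZMod 24) : ℤ := chi4 f * (chi3 f * chi3 f)

/-- `χ₄(f/2)` on `f ∈ {2, 10, 14, 22}` (`2, 10 ↦ 1`, `14, 22 ↦ −1`). [folklore] -/
private def tE4 (f : ZMod 24) : ℤ := (if f.val % 8 = 2 then 1 else if f.val % 8 = 6 then -1 else 0) * (chi3 f * chi3 f)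

/-- `χ₄(f/3) = −χ₄(f)` on the odd multiples of `3` (`3, 15 ↦ 1`, `9, 21 ↦ −1`). [folklore] -/
private def tT4 (f : ZMod 24) : ℤ := -chi4 f * (1 - chi3 f * chi3 f)

/-- `χ₄(f/6)` on `f ∈ {6, 18}` (`6 ↦ 1`, `18 ↦ −1`). [folklore] -/
private def tS4 (f : ZMod 24) : ℤ := if f.val = 6 then 1 else if f.val = 18 then -1 else 0

/-- `χ₃` restricted to the units. [folklore] -/
private def tU3 (f : ZMod 24) : ℤ := chi3 f * (chi4 f * chi4 f)

/-- `χ₃(f/2) = −χ₃(f)` on `f ∈ {2, 10, 14, 22}` (`2, 14 ↦ 1`, `10, 22 ↦ −1`). [folklore] -/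
private def tE3 (f : ZMod 24) : ℤ := -chi3 f * (if f.val % 4 = 2 then 1 else 0)

/-- `χ₃(f/4) = χ₃(f)` on `f ∈ {4, 20}` (`4 ↦ 1`, `20 ↦ −1`). [folklore] -/
private def tQ3 (f : ZMod 24) : ℤ := chi3 f * (if f.val % 8 = 4 then 1 else 0)

/-- `χ₃(f/8) = −χ₃(f)` on `f ∈ {8, 16}` (`8 ↦ 1`, `16 ↦ −1`). [folklore] -/
private def tO3 (f : ZMod 24) : ℤ := -chi3 f * (if f.val % 8 = 0 then 1 else 0)


variable (T : Multiset (ZMod 24 × ZMod p))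

/-- The `tPsi`-weighted odd part over the residues `[1, 5, 7, 11, 13, 17, 19, 23]` of the fibre `b`. [folklore] -/
private def cPsi (b : ZMod p) : ℤ :=
    oc T (1, b) + oc T (5, b) - oc T (7, b) - oc T (11, b) - oc T (13, b) - oc T (17, b) + oc T (19, b)
      + oc T (23, b)

/-- The `tU8`-weighted odd part over the residues `[1, 5, 7, 11, 13, 17, 19, 23]` of the fibre `b`. [folklore] -/
private def cU8 (b : ZMod p) : ℤ :=
    oc T (1, b) - oc T (5, b) + oc T (7, b) - oc T (11, b) - oc T (13, b) + oc T (17, b) - oc T (19, b)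
      + oc T (23, b)

/-- The `tT8`-weighted odd part over the residues `[3, 9, 15, 21]` of the fibre `b`. [folklore] -/
private def cT8 (b : ZMod p) : ℤ :=
    oc T (3, b) - oc T (9, b) - oc T (15, b) + oc T (21, b)

/-- The `tUm8`-weighted odd part over the residues `[1, 5, 7, 11, 13, 17, 19, 23]` of the fibre `b`. [folklore] -/
private def cUm8 (b : ZMod p) : ℤ :=
    oc T (1, b) - oc T (5, b) - oc T (7, b) + oc T (11, b) - oc T (13, b) + oc T (17, b) + oc T (19, b)
      - oc T (23, b)

/-- The `tTm8`-weighted odd part over the residues `[3, 9, 15, 21]` of the fibre `b`. [folklore] -/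
private def cTm8 (b : ZMod p) : ℤ :=
    oc T (3, b) + oc T (9, b) - oc T (15, b) - oc T (21, b)

/-- The `tU4`-weighted odd part over the residues `[1, 5, 7, 11, 13, 17, 19, 23]` of the fibre `b`. [folklore] -/
private def cU4 (b : ZMod p) : ℤ :=
    oc T (1, b) + oc T (5, b) - oc T (7, b) - oc T (11, b) + oc T (13, b) + oc T (17, b) - oc T (19, b)
      - oc T (23, b)

/-- The `tE4`-weighted odd part over the residues `[2, 10, 14, 22]` of the fibre `b`. [folklore] -/
private def cE4 (b : ZMod p) : ℤ :=
    oc T (2, b) + oc T (10, b) - oc T (14, b) - oc T (22, b)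

/-- The `tT4`-weighted odd part over the residues `[3, 9, 15, 21]` of the fibre `b`. [folklore] -/
private def cT4 (b : ZMod p) : ℤ :=
    oc T (3, b) - oc T (9, b) + oc T (15, b) - oc T (21, b)

/-- The `tS4`-weighted odd part over the residues `[6, 18]` of the fibre `b`. [folklore] -/
private def cS4 (b : ZMod p) : ℤ :=
    oc T (6, b) - oc T (18, b)

/-- The `tU3`-weighted odd part over the residues `[1, 5, 7, 11, 13, 17, 19, 23]` of the fibre `b`. [folklore] -/
private def cU3 (b : ZMod p) : ℤ :=
    oc T (1, b) - oc T (5, b) + oc T (7, b) - oc T (11, b) + oc T (13, b) - oc T (17, b) + oc T (19, b)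
      - oc T (23, b)

/-- The `tE3`-weighted odd part over the residues `[2, 10, 14, 22]` of the fibre `b`. [folklore] -/
private def cE3 (b : ZMod p) : ℤ :=
    oc T (2, b) - oc T (10, b) + oc T (14, b) - oc T (22, b)

/-- The `tQ3`-weighted odd part over the residues `[4, 20]` of the fibre `b`. [folklore] -/
private def cQ3 (b : ZMod p) : ℤ :=
    oc T (4, b) - oc T (20, b)

/-- The `tO3`-weighted odd part over the residues `[8, 16]` of the fibre `b`. [folklore] -/
private def cO3 (b : ZMod p) : ℤ :=
    oc T (8, b) - oc T (16, b)

/-- `U_{χ₈}(d) + U_{χ₈}(3d) + 2T_{χ₈}(3d)` in coordinates. [folklore] -/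
private def cChi8 (d : ZMod p) : ℤ := cU8 T d + cU8 T (3 * d) + 2 * cT8 T (3 * d)

/-- `Γ_{−8}(b) = U_{χ₋₈}(b) − U_{χ₋₈}(3b) + 2T_{χ₋₈}(3b)` in coordinates. [folklore] -/
private def cGamM8 (b : ZMod p) : ℤ := cUm8 T b - cUm8 T (3 * b) + 2 * cTm8 T (3 * b)

/-- `Γ₄(b) = U₄(b) + U₄(3b) + 2E₄(2b) + 2E₄(6b) + 2T₄(3b) + 4S₄(6b)` in coordinates. [folklore] -/
private def cGam4 (b : ZMod p) : ℤ :=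
  cU4 T b + cU4 T (3 * b) + 2 * cE4 T (2 * b) + 2 * cE4 T (6 * b) + 2 * cT4 T (3 * b) + 4 * cS4 T (6 * b)

/-- `Γ₃(b) = U₃(b) + U₃(2b) + 2E₃(2b) + 2E₃(4b) + 4Q₃(4b) + 4Q₃(8b) + 4O₃(8b)` in coordinates. [folklore] -/
private def cGam3 (b : ZMod p) : ℤ :=
  cU3 T b + cU3 T (2 * b) + 2 * cE3 T (2 * b) + 2 * cE3 T (4 * b) + 4 * cQ3 T (4 * b) + 4 * cQ3 T (8 * b) +
    4 * cO3 T (8 * b)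

/-- The relations of the characters `ψ`, `χ₈`, `χ₋₈`: they see only the odd members. [folklore] -/
private structure RelsOdd (T : Multiset (ZMod 24 × ZMod p)) : Prop where
  psi : ∀ b : ZMod p, b ≠ 0 → cPsi T b = 0
  chi8 : ∀ d : ZMod p, d ≠ 0 → cChi8 T d = 0
  gm8 : ∀ b b' : ZMod p, b ≠ 0 → b' ≠ 0 → cGamM8 T b = cGamM8 T b'

/-- The relations of the characters `χ₄`, `χ₃` (they also see the even members `2e, 6e′` resp. `2e, 4e′, 8e″`). [folklore] -/
private structure RelsEven (T : Multiset (ZMod 24 × ZMod p)) : Prop where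
  g4 : ∀ b b' : ZMod p, b ≠ 0 → b' ≠ 0 → cGam4 T b = cGam4 T b'
  g3 : ∀ b b' : ZMod p, b ≠ 0 → b' ≠ 0 → cGam3 T b = cGam3 T b'

variable {T}

/-- **The relations `ψ`, `χ₈`, `χ₋₈` for the coordinates of a Hodge multiset of level `24p`** (from
`KoblitzOgusRelationsTwentyFourPrime`). [cite: Deligne1982HodgeCycles, Rem. 7.16 (a)] [cite: Aoki1983, Prop. 2.2] -/
private theorem relsOdd_of_isHodgeMultiset (h : Nat.Coprime 24 p) [NeZero (24 * p)] (hp : p.Prime) (h5 : 5 ≤ p)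
    {s : Multiset (ZMod (24 * p))} (hs : IsHodgeMultiset s) : RelsOdd (s.map (crt h)) := by
  refine ⟨fun b hb ↦ ?_, fun d hd ↦ ?_, fun b b' hb hb' ↦ ?_⟩
  · have key := relPsi_twentyFourPrime hp h5 h hs hb
    simp only [oddCt_crtPt24] at key
    simp only [cPsi]
    linear_combination key
  · have key := relChi8_twentyFourPrime hp h5 h hs hd
    simp only [oddCt_crtPt24] at key
    simp only [cChi8, cU8, cT8]
    linear_combination key
  · have key := gammaChiM8_twentyFourPrime hp h5 h hs hb hb'
    simp only [gammaM8Sum, oddCt_crtPt24] at key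
    simp only [cGamM8, cUm8, cTm8]
    linear_combination key

/-- **The relations `χ₄`, `χ₃` for the coordinates of a Hodge multiset of level `24p`** (from
`KoblitzOgusRelationsTwentyFourPrime`). [cite: Deligne1982HodgeCycles, Rem. 7.16 (a)] [cite: Aoki1983, Prop. 2.2] -/
private theorem relsEven_of_isHodgeMultiset (h : Nat.Coprime 24 p) [NeZero (24 * p)] (hp : p.Prime) (h5 : 5 ≤ p)
    {s : Multiset (ZMod (24 * p))} (hs : IsHodgeMultiset s) : RelsEven (s.map (crt h)) := by
  refine ⟨fun b b' hb hb' ↦ ?_, fun b b' hb hb' ↦ ?_⟩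
  · have key := gammaChi4_twentyFourPrime hp h5 h hs hb hb'
    simp only [gamma4Sum, oddCt_crtPt24] at key
    simp only [cGam4, cU4, cE4, cT4, cS4]
    linear_combination key
  · have key := gammaChi3_twentyFourPrime hp h5 h hs hb hb'
    simp only [gamma3Sum, oddCt_crtPt24] at key
    simp only [cGam3, cU3, cE3, cQ3, cO3]
    linear_combination key

/-! ### Evaluating the functionals on explicit multisets: member contributions -/

/-- `o` of the empty multiset. [folklore] -/
private theorem oc_zero (q : ZMod 24 × ZMod p) : oc (0 : Multiset (ZMod 24 × ZMod p)) q = 0 := by simp [oc]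

/-- `o` of `a ::ₘ T`. [folklore] -/
private theorem oc_cons (a : ZMod 24 × ZMod p) (T : Multiset (ZMod 24 × ZMod p)) (q : ZMod 24 × ZMod p) :
    oc (a ::ₘ T) q = oc T q + ((if q = a then 1 else 0) - (if -q = a then 1 else 0)) := by
  simp only [oc, Multiset.count_cons, Nat.cast_add, Nat.cast_ite, Nat.cast_one, Nat.cast_zero]
  ring

/-- The contribution of a member `(f, d)` to `cPsi(b)`. [folklore] -/
private theorem cPsi_cons (f : ZMod 24) (d : ZMod p) (T : Multiset (ZMod 24 × ZMod p)) (b : ZMod p) :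
    cPsi ((f, d) ::ₘ T) b = cPsi T b + tPsi f * ((if b = d then 1 else 0) - (if -b = d then 1 else 0)) := by
  simp only [cPsi, oc_cons, Prod.mk.injEq, Prod.neg_mk]
  fin_cases f <;> simp +decide [tPsi, chi4, chi3, chi8, chim8] <;> split_ifs <;> omega

/-- `cPsi` of the empty multiset. [folklore] -/
private theorem cPsi_zero (b : ZMod p) : cPsi (0 : Multiset (ZMod 24 × ZMod p)) b = 0 := by
  simp [cPsi, oc_zero]

/-- `cPsi` of a singleton. [folklore] -/
private theorem cPsi_singleton (f : ZMod 24) (d : ZMod p) (b : ZMod p) :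
    cPsi ({(f, d)} : Multiset (ZMod 24 × ZMod p)) b = tPsi f * ((if b = d then 1 else 0) - (if -b = d then 1 else 0)) := by
  rw [← Multiset.cons_zero, cPsi_cons, cPsi_zero, zero_add]

/-- The contribution of a member `(f, d)` to `cU8(b)`. [folklore] -/
private theorem cU8_cons (f : ZMod 24) (d : ZMod p) (T : Multiset (ZMod 24 × ZMod p)) (b : ZMod p) :
    cU8 ((f, d) ::ₘ T) b = cU8 T b + tU8 f * ((if b = d then 1 else 0) - (if -b = d then 1 else 0)) := by
  simp only [cU8, oc_cons, Prod.mk.injEq, Prod.neg_mk]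
  fin_cases f <;> simp +decide [tU8, chi4, chi3, chi8, chim8] <;> split_ifs <;> omega

/-- `cU8` of the empty multiset. [folklore] -/
private theorem cU8_zero (b : ZMod p) : cU8 (0 : Multiset (ZMod 24 × ZMod p)) b = 0 := by
  simp [cU8, oc_zero]

/-- `cU8` of a singleton. [folklore] -/
private theorem cU8_singleton (f : ZMod 24) (d : ZMod p) (b : ZMod p) :
    cU8 ({(f, d)} : Multiset (ZMod 24 × ZMod p)) b = tU8 f * ((if b = d then 1 else 0) - (if -b = d then 1 else 0)) := by
  rw [← Multiset.cons_zero, cU8_cons, cU8_zero, zero_add]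

/-- The contribution of a member `(f, d)` to `cT8(b)`. [folklore] -/
private theorem cT8_cons (f : ZMod 24) (d : ZMod p) (T : Multiset (ZMod 24 × ZMod p)) (b : ZMod p) :
    cT8 ((f, d) ::ₘ T) b = cT8 T b + tT8 f * ((if b = d then 1 else 0) - (if -b = d then 1 else 0)) := by
  simp only [cT8, oc_cons, Prod.mk.injEq, Prod.neg_mk]
  fin_cases f <;> simp +decide [tT8, chi4, chi3, chi8, chim8] <;> split_ifs <;> omega

/-- `cT8` of the empty multiset. [folklore] -/
private theorem cT8_zero (b : ZMod p) : cT8 (0 : Multiset (ZMod 24 × ZMod p)) b = 0 := by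
  simp [cT8, oc_zero]

/-- `cT8` of a singleton. [folklore] -/
private theorem cT8_singleton (f : ZMod 24) (d : ZMod p) (b : ZMod p) :
    cT8 ({(f, d)} : Multiset (ZMod 24 × ZMod p)) b = tT8 f * ((if b = d then 1 else 0) - (if -b = d then 1 else 0)) := by
  rw [← Multiset.cons_zero, cT8_cons, cT8_zero, zero_add]

/-- The contribution of a member `(f, d)` to `cUm8(b)`. [folklore] -/
private theorem cUm8_cons (f : ZMod 24) (d : ZMod p) (T : Multiset (ZMod 24 × ZMod p)) (b : ZMod p) :
    cUm8 ((f, d) ::ₘ T) b = cUm8 T b + tUm8 f * ((if b = d then 1 else 0) + (if -b = d then 1 else 0)) := by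
  simp only [cUm8, oc_cons, Prod.mk.injEq, Prod.neg_mk]
  fin_cases f <;> simp +decide [tUm8, chi4, chi3, chi8, chim8] <;> split_ifs <;> omega

/-- `cUm8` of the empty multiset. [folklore] -/
private theorem cUm8_zero (b : ZMod p) : cUm8 (0 : Multiset (ZMod 24 × ZMod p)) b = 0 := by
  simp [cUm8, oc_zero]

/-- `cUm8` of a singleton. [folklore] -/
private theorem cUm8_singleton (f : ZMod 24) (d : ZMod p) (b : ZMod p) :
    cUm8 ({(f, d)} : Multiset (ZMod 24 × ZMod p)) b = tUm8 f * ((if b = d then 1 else 0) + (if -b = d then 1 else 0)) := by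
  rw [← Multiset.cons_zero, cUm8_cons, cUm8_zero, zero_add]

/-- The contribution of a member `(f, d)` to `cTm8(b)`. [folklore] -/
private theorem cTm8_cons (f : ZMod 24) (d : ZMod p) (T : Multiset (ZMod 24 × ZMod p)) (b : ZMod p) :
    cTm8 ((f, d) ::ₘ T) b = cTm8 T b + tTm8 f * ((if b = d then 1 else 0) + (if -b = d then 1 else 0)) := by
  simp only [cTm8, oc_cons, Prod.mk.injEq, Prod.neg_mk]
  fin_cases f <;> simp +decide [tTm8, chi4, chi3, chi8, chim8] <;> split_ifs <;> omega

/-- `cTm8` of the empty multiset. [folklore] -/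
private theorem cTm8_zero (b : ZMod p) : cTm8 (0 : Multiset (ZMod 24 × ZMod p)) b = 0 := by
  simp [cTm8, oc_zero]

/-- `cTm8` of a singleton. [folklore] -/
private theorem cTm8_singleton (f : ZMod 24) (d : ZMod p) (b : ZMod p) :
    cTm8 ({(f, d)} : Multiset (ZMod 24 × ZMod p)) b = tTm8 f * ((if b = d then 1 else 0) + (if -b = d then 1 else 0)) := by
  rw [← Multiset.cons_zero, cTm8_cons, cTm8_zero, zero_add]

/-- The contribution of a member `(f, d)` to `cU4(b)`. [folklore] -/
private theorem cU4_cons (f : ZMod 24) (d : ZMod p) (T : Multiset (ZMod 24 × ZMod p)) (b : ZMod p) :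
    cU4 ((f, d) ::ₘ T) b = cU4 T b + tU4 f * ((if b = d then 1 else 0) + (if -b = d then 1 else 0)) := by
  simp only [cU4, oc_cons, Prod.mk.injEq, Prod.neg_mk]
  fin_cases f <;> simp +decide [tU4, chi4, chi3, chi8, chim8] <;> split_ifs <;> omega

/-- `cU4` of the empty multiset. [folklore] -/
private theorem cU4_zero (b : ZMod p) : cU4 (0 : Multiset (ZMod 24 × ZMod p)) b = 0 := by
  simp [cU4, oc_zero]

/-- `cU4` of a singleton. [folklore] -/
private theorem cU4_singleton (f : ZMod 24) (d : ZMod p) (b : ZMod p) :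
    cU4 ({(f, d)} : Multiset (ZMod 24 × ZMod p)) b = tU4 f * ((if b = d then 1 else 0) + (if -b = d then 1 else 0)) := by
  rw [← Multiset.cons_zero, cU4_cons, cU4_zero, zero_add]

/-- The contribution of a member `(f, d)` to `cE4(b)`. [folklore] -/
private theorem cE4_cons (f : ZMod 24) (d : ZMod p) (T : Multiset (ZMod 24 × ZMod p)) (b : ZMod p) :
    cE4 ((f, d) ::ₘ T) b = cE4 T b + tE4 f * ((if b = d then 1 else 0) + (if -b = d then 1 else 0)) := by
  simp only [cE4, oc_cons, Prod.mk.injEq, Prod.neg_mk]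
  fin_cases f <;> simp +decide [tE4, chi4, chi3, chi8, chim8] <;> split_ifs <;> omega

/-- `cE4` of the empty multiset. [folklore] -/
private theorem cE4_zero (b : ZMod p) : cE4 (0 : Multiset (ZMod 24 × ZMod p)) b = 0 := by
  simp [cE4, oc_zero]

/-- `cE4` of a singleton. [folklore] -/
private theorem cE4_singleton (f : ZMod 24) (d : ZMod p) (b : ZMod p) :
    cE4 ({(f, d)} : Multiset (ZMod 24 × ZMod p)) b = tE4 f * ((if b = d then 1 else 0) + (if -b = d then 1 else 0)) := by
  rw [← Multiset.cons_zero, cE4_cons, cE4_zero, zero_add]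

/-- The contribution of a member `(f, d)` to `cT4(b)`. [folklore] -/
private theorem cT4_cons (f : ZMod 24) (d : ZMod p) (T : Multiset (ZMod 24 × ZMod p)) (b : ZMod p) :
    cT4 ((f, d) ::ₘ T) b = cT4 T b + tT4 f * ((if b = d then 1 else 0) + (if -b = d then 1 else 0)) := by
  simp only [cT4, oc_cons, Prod.mk.injEq, Prod.neg_mk]
  fin_cases f <;> simp +decide [tT4, chi4, chi3, chi8, chim8] <;> split_ifs <;> omega

/-- `cT4` of the empty multiset. [folklore] -/
private theorem cT4_zero (b : ZMod p) : cT4 (0 : Multiset (ZMod 24 × ZMod p)) b = 0 := by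
  simp [cT4, oc_zero]

/-- `cT4` of a singleton. [folklore] -/
private theorem cT4_singleton (f : ZMod 24) (d : ZMod p) (b : ZMod p) :
    cT4 ({(f, d)} : Multiset (ZMod 24 × ZMod p)) b = tT4 f * ((if b = d then 1 else 0) + (if -b = d then 1 else 0)) := by
  rw [← Multiset.cons_zero, cT4_cons, cT4_zero, zero_add]

/-- The contribution of a member `(f, d)` to `cS4(b)`. [folklore] -/
private theorem cS4_cons (f : ZMod 24) (d : ZMod p) (T : Multiset (ZMod 24 × ZMod p)) (b : ZMod p) :
    cS4 ((f, d) ::ₘ T) b = cS4 T b + tS4 f * ((if b = d then 1 else 0) + (if -b = d then 1 else 0)) := by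
  simp only [cS4, oc_cons, Prod.mk.injEq, Prod.neg_mk]
  fin_cases f <;> simp +decide [tS4, chi4, chi3, chi8, chim8] <;> split_ifs <;> omega

/-- `cS4` of the empty multiset. [folklore] -/
private theorem cS4_zero (b : ZMod p) : cS4 (0 : Multiset (ZMod 24 × ZMod p)) b = 0 := by
  simp [cS4, oc_zero]

/-- `cS4` of a singleton. [folklore] -/
private theorem cS4_singleton (f : ZMod 24) (d : ZMod p) (b : ZMod p) :
    cS4 ({(f, d)} : Multiset (ZMod 24 × ZMod p)) b = tS4 f * ((if b = d then 1 else 0) + (if -b = d then 1 else 0)) := by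
  rw [← Multiset.cons_zero, cS4_cons, cS4_zero, zero_add]

/-- The contribution of a member `(f, d)` to `cU3(b)`. [folklore] -/
private theorem cU3_cons (f : ZMod 24) (d : ZMod p) (T : Multiset (ZMod 24 × ZMod p)) (b : ZMod p) :
    cU3 ((f, d) ::ₘ T) b = cU3 T b + tU3 f * ((if b = d then 1 else 0) + (if -b = d then 1 else 0)) := by
  simp only [cU3, oc_cons, Prod.mk.injEq, Prod.neg_mk]
  fin_cases f <;> simp +decide [tU3, chi4, chi3, chi8, chim8] <;> split_ifs <;> omega

/-- `cU3` of the empty multiset. [folklore] -/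
private theorem cU3_zero (b : ZMod p) : cU3 (0 : Multiset (ZMod 24 × ZMod p)) b = 0 := by
  simp [cU3, oc_zero]

/-- `cU3` of a singleton. [folklore] -/
private theorem cU3_singleton (f : ZMod 24) (d : ZMod p) (b : ZMod p) :
    cU3 ({(f, d)} : Multiset (ZMod 24 × ZMod p)) b = tU3 f * ((if b = d then 1 else 0) + (if -b = d then 1 else 0)) := by
  rw [← Multiset.cons_zero, cU3_cons, cU3_zero, zero_add]

/-- The contribution of a member `(f, d)` to `cE3(b)`. [folklore] -/
private theorem cE3_cons (f : ZMod 24) (d : ZMod p) (T : Multiset (ZMod 24 × ZMod p)) (b : ZMod p) :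
    cE3 ((f, d) ::ₘ T) b = cE3 T b + tE3 f * ((if b = d then 1 else 0) + (if -b = d then 1 else 0)) := by
  simp only [cE3, oc_cons, Prod.mk.injEq, Prod.neg_mk]
  fin_cases f <;> simp +decide [tE3, chi4, chi3, chi8, chim8] <;> split_ifs <;> omega

/-- `cE3` of the empty multiset. [folklore] -/
private theorem cE3_zero (b : ZMod p) : cE3 (0 : Multiset (ZMod 24 × ZMod p)) b = 0 := by
  simp [cE3, oc_zero]

/-- `cE3` of a singleton. [folklore] -/
private theorem cE3_singleton (f : ZMod 24) (d : ZMod p) (b : ZMod p) :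
    cE3 ({(f, d)} : Multiset (ZMod 24 × ZMod p)) b = tE3 f * ((if b = d then 1 else 0) + (if -b = d then 1 else 0)) := by
  rw [← Multiset.cons_zero, cE3_cons, cE3_zero, zero_add]

/-- The contribution of a member `(f, d)` to `cQ3(b)`. [folklore] -/
private theorem cQ3_cons (f : ZMod 24) (d : ZMod p) (T : Multiset (ZMod 24 × ZMod p)) (b : ZMod p) :
    cQ3 ((f, d) ::ₘ T) b = cQ3 T b + tQ3 f * ((if b = d then 1 else 0) + (if -b = d then 1 else 0)) := by
  simp only [cQ3, oc_cons, Prod.mk.injEq, Prod.neg_mk]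
  fin_cases f <;> simp +decide [tQ3, chi4, chi3, chi8, chim8] <;> split_ifs <;> omega

/-- `cQ3` of the empty multiset. [folklore] -/
private theorem cQ3_zero (b : ZMod p) : cQ3 (0 : Multiset (ZMod 24 × ZMod p)) b = 0 := by
  simp [cQ3, oc_zero]

/-- `cQ3` of a singleton. [folklore] -/
private theorem cQ3_singleton (f : ZMod 24) (d : ZMod p) (b : ZMod p) :
    cQ3 ({(f, d)} : Multiset (ZMod 24 × ZMod p)) b = tQ3 f * ((if b = d then 1 else 0) + (if -b = d then 1 else 0)) := by
  rw [← Multiset.cons_zero, cQ3_cons, cQ3_zero, zero_add]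

/-- The contribution of a member `(f, d)` to `cO3(b)`. [folklore] -/
private theorem cO3_cons (f : ZMod 24) (d : ZMod p) (T : Multiset (ZMod 24 × ZMod p)) (b : ZMod p) :
    cO3 ((f, d) ::ₘ T) b = cO3 T b + tO3 f * ((if b = d then 1 else 0) + (if -b = d then 1 else 0)) := by
  simp only [cO3, oc_cons, Prod.mk.injEq, Prod.neg_mk]
  fin_cases f <;> simp +decide [tO3, chi4, chi3, chi8, chim8] <;> split_ifs <;> omega

/-- `cO3` of the empty multiset. [folklore] -/
private theorem cO3_zero (b : ZMod p) : cO3 (0 : Multiset (ZMod 24 × ZMod p)) b = 0 := by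
  simp [cO3, oc_zero]

/-- `cO3` of a singleton. [folklore] -/
private theorem cO3_singleton (f : ZMod 24) (d : ZMod p) (b : ZMod p) :
    cO3 ({(f, d)} : Multiset (ZMod 24 × ZMod p)) b = tO3 f * ((if b = d then 1 else 0) + (if -b = d then 1 else 0)) := by
  rw [← Multiset.cons_zero, cO3_cons, cO3_zero, zero_add]

/-! ### Finite facts about the character tables mod `24` -/

/-- A bracket difference `[A] − [B]` is `−1`, `0` or `1`. [folklore] -/
private theorem bracket_sub_cases (A B : Prop) [Decidable A] [Decidable B] :
    ((if A then (1 : ℤ) else 0) - (if B then 1 else 0)) = -1 ∨ ((if A then (1 : ℤ) else 0) - (if B then 1 else 0)) = 0 ∨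
      ((if A then (1 : ℤ) else 0) - (if B then 1 else 0)) = 1 := by
  by_cases hA : A <;> by_cases hB : B <;> simp [hA, hB]

/-- Reflected brackets, even type: `[b = −d] − [−b = −d] = −([b = d] − [−b = d])`. [folklore] -/
private theorem brkE (b d : ZMod p) :
    ((if b = -d then (1 : ℤ) else 0) - (if -b = -d then 1 else 0)) = -((if b = d then 1 else 0) - (if -b = d then 1 else 0)) := by
  have e1 : (b = -d) = (-b = d) := propext ⟨fun h ↦ by rw [h, neg_neg], fun h ↦ by rw [← h, neg_neg]⟩
  have e2 : (-b = -d) = (b = d) := propext neg_inj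
  simp only [e1, e2]; ring

/-- Reflected brackets, odd type: `[b = −d] + [−b = −d] = [b = d] + [−b = d]`. [folklore] -/
private theorem brkO (b d : ZMod p) :
    ((if b = -d then (1 : ℤ) else 0) + (if -b = -d then 1 else 0)) = ((if b = d then 1 else 0) + (if -b = d then 1 else 0)) := by
  have e1 : (b = -d) = (-b = d) := propext ⟨fun h ↦ by rw [h, neg_neg], fun h ↦ by rw [← h, neg_neg]⟩
  have e2 : (-b = -d) = (b = d) := propext neg_inj
  simp only [e1, e2]; ring

/-- Table (generic fibre): for odd `e` with `ψ(e) = 0` and any `e′`, `χ₈ᵘ(e′)β + χ₈ᵘ(e) + 2χ₈ᵗ(e) ≠ 0` for `β ∈ {−1, 0, 1}`.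
[folklore] -/
private theorem tab_gen {e e' : ZMod 24} (he : e.val % 2 = 1) (h0 : tPsi e = 0) :
    tU8 e' * (-1) + tU8 e + 2 * tT8 e ≠ 0 ∧ tU8 e' * 0 + tU8 e + 2 * tT8 e ≠ 0 ∧ tU8 e' * 1 + tU8 e + 2 * tT8 e ≠ 0 := by
  revert e e' he h0; decide

/-- Table (same fibre): the relations `ψ`, `χ₈`, `χ₋₈` for two odd members `(e, c), (e′, c)` force `e′ = e + 12`. [folklore] -/
private theorem tab_shift {e e' : ZMod 24} (he : e.val % 2 = 1) (he' : e'.val % 2 = 1) (h1 : tPsi e + tPsi e' = 0)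
    (h2 : tU8 e + tU8 e' + 2 * (tT8 e + tT8 e') = 0) (h3 : tUm8 e + tUm8 e' = tTm8 e + tTm8 e') : e' = e + 12 := by
  revert e e' he he' h1 h2 h3; decide

/-- Table (opposite fibres): the relations for two odd members `(e, c), (e′, −c)` force `e′ = −e`. [folklore] -/
private theorem tab_neg {e e' : ZMod 24} (he : e.val % 2 = 1) (he' : e'.val % 2 = 1) (h1 : tPsi e = tPsi e')
    (h2 : tU8 e + 2 * tT8 e = tU8 e' + 2 * tT8 e') (h3 : tUm8 e + tUm8 e' = tTm8 e + tTm8 e') : e' = -e := by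
  revert e e' he he' h1 h2 h3; decide

/-- Table (`δ`-configurations): `{e, e + u, e − u}` in one fibre (`u = 4π ∈ {4, 20}`) violates `ψ` or `χ₈`. [folklore] -/
private theorem tab_delta {e u : ZMod 24} (he : e.val % 2 = 1) (hu : u = 4 ∨ u = 20)
    (h1 : tPsi e + tPsi (e + u) + tPsi (e - u) = 0)
    (h2 : tU8 e + tU8 (e + u) + tU8 (e - u) + 2 * (tT8 e + tT8 (e + u) + tT8 (e - u)) = 0) : False := by
  revert e u he hu h1 h2; decide

/-- Table (two even members over opposite fibres): the relations `χ₄`, `χ₃` force them into `{0, 12}`. [folklore] -/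
private theorem tab_even {f f' : ZMod 24} (hf : f.val % 2 = 0) (hf' : f'.val % 2 = 0) (hne : f' ≠ -f)
    (h1 : tE4 f + tE4 f' = 0) (h2 : tS4 f + tS4 f' = 0) (h3 : tE3 f + tE3 f' = 0) (h4 : tQ3 f + tQ3 f' = 0)
    (h5 : tO3 f + tO3 f' = 0) : (f = 0 ∨ f = 12) ∧ (f' = 0 ∨ f' = 12) := by
  revert f f' hf hf' hne h1 h2 h3 h4 h5; decide

/-- Table (reflection `f ↦ 12 − f` of an odd residue): the even-character tables change sign, the odd ones do not. [folklore] -/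
private theorem tab_reflect {f : ZMod 24} (hf : f.val % 2 = 1) :
    tPsi (12 - f) = -tPsi f ∧ tU8 (12 - f) = -tU8 f ∧ tT8 (12 - f) = -tT8 f ∧ tUm8 (12 - f) = tUm8 f ∧
      tTm8 (12 - f) = tTm8 f := by
  revert f hf; decide

/-- An odd residue is a unit (`ψ ≠ 0`) or an odd multiple of `3` (`χ₈ᵗ ≠ 0`); the even tables vanish on it. [folklore] -/
private theorem odd_tables {f : ZMod 24} (hf : f.val % 2 = 1) : tE4 f = 0 ∧ tS4 f = 0 ∧ tE3 f = 0 ∧ tQ3 f = 0 ∧ tO3 f = 0 := by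
  revert f hf; decide

/-- The odd tables vanish on an even residue. [folklore] -/
private theorem even_tables {f : ZMod 24} (hf : f.val % 2 = 0) :
    tPsi f = 0 ∧ tU8 f = 0 ∧ tT8 f = 0 ∧ tUm8 f = 0 ∧ tTm8 f = 0 ∧ tU4 f = 0 ∧ tT4 f = 0 ∧ tU3 f = 0 := by
  revert f hf; decide

/-- Even members are invisible to the relations `ψ`, `χ₈`, `χ₋₈`. [folklore] -/
private theorem RelsOdd.of_cons_even {q : ZMod 24 × ZMod p} {T : Multiset (ZMod 24 × ZMod p)} (h : RelsOdd (q ::ₘ T))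
    (hq : q.1.val % 2 = 0) : RelsOdd T := by
  obtain ⟨f, d⟩ := q
  obtain ⟨hP, hU8, hT8, hUm8, hTm8, -, -, -⟩ := even_tables (f := f) hq
  refine ⟨fun b hb ↦ ?_, fun b hb ↦ ?_, fun b b' hb hb' ↦ ?_⟩
  · have := h.psi b hb
    rw [cPsi_cons, hP, zero_mul, add_zero] at this
    exact this
  · have := h.chi8 b hb
    simp only [cChi8, cU8_cons, cT8_cons, hU8, hT8, zero_mul, add_zero] at this
    simp only [cChi8]
    exact this
  · have := h.gm8 b b' hb hb'
    simp only [cGamM8, cUm8_cons, cTm8_cons, hUm8, hTm8, zero_mul, add_zero] at this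
    simp only [cGamM8]
    exact this

/-! ### Two odd members: the shift `x ↦ x + 12p` -/

/-- **Periodicity for a two-element odd configuration.** If `O = {x, y}` (both odd) satisfies the relations `ψ`, `χ₈`, `χ₋₈`,
`x = (e, c)` with `c ≠ 0` and `y ≠ −x`, then `y = (e + 12, c)` (`= x + 12p` in `ℤ/24p`). Instances used: `ψ` at `c`, `χ₈` at
`d = c/3` (fibres `d, c`), and `Γ_{−8}(d) = Γ_{−8}(c)` (fibres `d, c, 3c`); the fibre of `y` is `c`, `−c` or generic. [folklore] -/
private theorem two_odd_core (hp : p.Prime) (h17 : 17 ≤ p) {O : Multiset (ZMod 24 × ZMod p)} (hO : RelsOdd O)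
    {e e' : ZMod 24} {c c' : ZMod p} (hOe : O = {(e, c), (e', c')}) (he : e.val % 2 = 1) (he' : e'.val % 2 = 1) (hc : c ≠ 0)
    (hyx : ((e', c') : ZMod 24 × ZMod p) ≠ -(e, c)) : e' = e + 12 ∧ c' = c := by
  haveI := Fact.mk hp
  have h3 : (3 : ZMod p) ≠ 0 := by exact_mod_cast natCast_ne_zero_smooth hp h17 (n := 3) (by norm_num)
  have h2c : (2 : ZMod p) * c ≠ 0 := by exact_mod_cast smooth_mul_ne_zero hp h17 hc (n := 2) (by norm_num)
  have h4c : (4 : ZMod p) * c ≠ 0 := by exact_mod_cast smooth_mul_ne_zero hp h17 hc (n := 4) (by norm_num)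
  -- `d` with `3d = c`
  set d : ZMod p := (3 : ZMod p)⁻¹ * c with hd
  have h3d : 3 * d = c := by rw [hd, ← mul_assoc, mul_inv_cancel₀ h3, one_mul]
  have hd0 : d ≠ 0 := fun h0 ↦ hc (by rw [← h3d, h0, mul_zero])
  have h2d : (2 : ZMod p) * d ≠ 0 := by exact_mod_cast smooth_mul_ne_zero hp h17 hd0 (n := 2) (by norm_num)
  have h4d : (4 : ZMod p) * d ≠ 0 := by exact_mod_cast smooth_mul_ne_zero hp h17 hd0 (n := 4) (by norm_num)
  -- non-coincidences of the fibres `c, −c, d, −d, 3c, −3c`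
  have hcc : -c ≠ c := fun h ↦ h2c (by linear_combination -h)
  have hcc' : c ≠ -c := fun h ↦ h2c (by linear_combination h)
  have ndc : d ≠ c := fun h ↦ h2d (by linear_combination h3d - h)
  have nmdc : -d ≠ c := fun h ↦ h4d (by linear_combination h3d - h)
  have ndmc : d ≠ -c := fun h ↦ h4d (by linear_combination h3d + h)
  have nmdmc : -d ≠ -c := fun h ↦ ndc (neg_inj.mp h)
  have n3c : (3 : ZMod p) * c ≠ c := fun h ↦ h2c (by linear_combination h)
  have nm3c : -((3 : ZMod p) * c) ≠ c := fun h ↦ h4c (by linear_combination -h)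
  have n3mc : (3 : ZMod p) * c ≠ -c := fun h ↦ h4c (by linear_combination h)
  have nm3mc : -((3 : ZMod p) * c) ≠ -c := fun h ↦ n3c (neg_inj.mp h)
  -- expansions on `O = {(e,c), (e',c')}`
  have EPsi : ∀ b, cPsi O b = tPsi e * ((if b = c then 1 else 0) - (if -b = c then 1 else 0)) +
      tPsi e' * ((if b = c' then 1 else 0) - (if -b = c' then 1 else 0)) := fun b ↦ by
    rw [hOe, Multiset.insert_eq_cons, cPsi_cons, cPsi_singleton]; ring
  have EChi : ∀ b, cChi8 O b =
      (tU8 e * ((if b = c then 1 else 0) - (if -b = c then 1 else 0)) +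
        tU8 e' * ((if b = c' then 1 else 0) - (if -b = c' then 1 else 0))) +
      (tU8 e * ((if 3 * b = c then 1 else 0) - (if -(3 * b) = c then 1 else 0)) +
        tU8 e' * ((if 3 * b = c' then 1 else 0) - (if -(3 * b) = c' then 1 else 0))) +
      2 * (tT8 e * ((if 3 * b = c then 1 else 0) - (if -(3 * b) = c then 1 else 0)) +
        tT8 e' * ((if 3 * b = c' then 1 else 0) - (if -(3 * b) = c' then 1 else 0))) := fun b ↦ by
    rw [hOe, Multiset.insert_eq_cons]
    simp only [cChi8, cU8_cons, cU8_singleton, cT8_cons, cT8_singleton]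
    ring
  have EGam : ∀ b, cGamM8 O b =
      (tUm8 e * ((if b = c then 1 else 0) + (if -b = c then 1 else 0)) +
        tUm8 e' * ((if b = c' then 1 else 0) + (if -b = c' then 1 else 0))) -
      (tUm8 e * ((if 3 * b = c then 1 else 0) + (if -(3 * b) = c then 1 else 0)) +
        tUm8 e' * ((if 3 * b = c' then 1 else 0) + (if -(3 * b) = c' then 1 else 0))) +
      2 * (tTm8 e * ((if 3 * b = c then 1 else 0) + (if -(3 * b) = c then 1 else 0)) +
        tTm8 e' * ((if 3 * b = c' then 1 else 0) + (if -(3 * b) = c' then 1 else 0))) := fun b ↦ by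
    rw [hOe, Multiset.insert_eq_cons]
    simp only [cGamM8, cUm8_cons, cUm8_singleton, cTm8_cons, cTm8_singleton]
    ring
  by_cases h1 : c' = c
  · subst c'
    have hP := hO.psi c hc
    have hX := hO.chi8 d hd0
    have hG := hO.gm8 d c hd0 hc
    rw [EPsi] at hP
    rw [EChi] at hX
    rw [EGam, EGam] at hG
    simp only [h3d, if_true, if_false, hcc, ndc, nmdc, n3c, nm3c] at hP hX hG
    exact ⟨tab_shift he he' (by linarith) (by linarith) (by linarith), rfl⟩
  by_cases h2 : c' = -c
  · subst c'
    exfalso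
    have hP := hO.psi c hc
    have hX := hO.chi8 d hd0
    have hG := hO.gm8 d c hd0 hc
    rw [EPsi] at hP
    rw [EChi] at hX
    rw [EGam, EGam] at hG
    simp only [h3d, if_true, if_false, hcc, hcc', ndc, nmdc, ndmc, nmdmc, n3c, nm3c, n3mc, nm3mc] at hP hX hG
    have key := tab_neg he he' (by linarith) (by linarith) (by linarith)
    exact hyx (by rw [key, Prod.neg_mk])
  · exfalso
    have h1' : c ≠ c' := fun h ↦ h1 h.symm
    have h2' : -c ≠ c' := fun h ↦ h2 h.symm
    have hP := hO.psi c hc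
    have hX := hO.chi8 d hd0
    rw [EPsi] at hP
    rw [EChi] at hX
    simp only [h3d, if_true, if_false, hcc, h1', h2', ndc, nmdc, mul_zero, add_zero, sub_zero, mul_one] at hP hX
    obtain ⟨g1, g2, g3⟩ := tab_gen (e' := e') he hP
    rcases bracket_sub_cases (d = c') (-d = c') with hb | hb | hb <;> rw [hb] at hX
    · exact g1 (by linarith)
    · exact g2 (by linarith)
    · exact g3 (by linarith)

/-- The relations of a 'half-pair' configuration `{x, 12p − x, y, 12p − y}` (all odd) are twice those of `{x, y}`. [folklore] -/
private theorem relsOdd_halfpair {e f : ZMod 24} {c c' : ZMod p} (he : e.val % 2 = 1) (hf : f.val % 2 = 1)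
    (hH : RelsOdd ({(e, c), (12 - e, -c), (f, c'), (12 - f, -c')} : Multiset (ZMod 24 × ZMod p))) :
    RelsOdd ({(e, c), (f, c')} : Multiset (ZMod 24 × ZMod p)) := by
  obtain ⟨rP, rU, rT, rUm, rTm⟩ := tab_reflect he
  obtain ⟨rP', rU', rT', rUm', rTm'⟩ := tab_reflect hf
  have kP : ∀ b, cPsi ({(e, c), (12 - e, -c), (f, c'), (12 - f, -c')} : Multiset (ZMod 24 × ZMod p)) b =
      2 * cPsi ({(e, c), (f, c')} : Multiset (ZMod 24 × ZMod p)) b := fun b ↦ by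
    simp only [Multiset.insert_eq_cons, cPsi_cons, cPsi_singleton, rP, rP', brkE]; ring
  have kX : ∀ b, cChi8 ({(e, c), (12 - e, -c), (f, c'), (12 - f, -c')} : Multiset (ZMod 24 × ZMod p)) b =
      2 * cChi8 ({(e, c), (f, c')} : Multiset (ZMod 24 × ZMod p)) b := fun b ↦ by
    simp only [Multiset.insert_eq_cons, cChi8, cU8_cons, cU8_singleton, cT8_cons, cT8_singleton, rU, rU', rT, rT', brkE]
    ring
  have kG : ∀ b, cGamM8 ({(e, c), (12 - e, -c), (f, c'), (12 - f, -c')} : Multiset (ZMod 24 × ZMod p)) b =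
      2 * cGamM8 ({(e, c), (f, c')} : Multiset (ZMod 24 × ZMod p)) b := fun b ↦ by
    simp only [Multiset.insert_eq_cons, cGamM8, cUm8_cons, cUm8_singleton, cTm8_cons, cTm8_singleton, rUm, rUm', rTm, rTm',
      brkO]
    ring
  refine ⟨fun b hb ↦ ?_, fun b hb ↦ ?_, fun b b' hb hb' ↦ ?_⟩
  · have := hH.psi b hb
    rw [kP] at this
    linarith
  · have := hH.chi8 b hb
    rw [kX] at this
    linarith
  · have := hH.gm8 b b' hb hb'
    rw [kG, kG] at this
    linarith

/-- **No half-pair configuration.** `{x, 12p − x, y, 12p − y}` with `x = (e, c)` odd off the fibre `0`, `y` odd, `y ≠ −x`,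
`12p − y ≠ −x`, violates the relations `ψ`, `χ₈`, `χ₋₈`. [folklore] -/
private theorem halfpair_odd (hp : p.Prime) (h17 : 17 ≤ p) {e f : ZMod 24} {c c' : ZMod p} (he : e.val % 2 = 1)
    (hf : f.val % 2 = 1) (hc : c ≠ 0)
    (hH : RelsOdd ({(e, c), (12 - e, -c), (f, c'), (12 - f, -c')} : Multiset (ZMod 24 × ZMod p)))
    (hz1 : ((f, c') : ZMod 24 × ZMod p) ≠ -(e, c)) (hz2 : ((12 - f, -c') : ZMod 24 × ZMod p) ≠ -(e, c)) : False := by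
  obtain ⟨hfe, hcc⟩ := two_odd_core hp h17 (relsOdd_halfpair he hf hH) rfl he hf hc hz1
  apply hz2
  rw [hfe, hcc, Prod.neg_mk, Prod.mk.injEq]
  exact ⟨by ring, rfl⟩

/-! ### The wrong lifts `δ_v = {v, v + 4p, v − 4p, −3v}` violate the relations -/

/-- **No `δ`-configuration.** For `v = (e, c)` odd with `c ≠ 0` and `u = 4π` (`π = p mod 24`, so `u ∈ {4, 20}`), the multiset
`{v, v + 4p, v − 4p, −3v}` = `{(e,c), (e+u,c), (e−u,c), (−3e,−3c)}` violates `ψ` (at `c`) or `χ₈` (at `c/3`). [folklore] -/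
private theorem delta_not_rels (hp : p.Prime) (h17 : 17 ≤ p) {e u : ZMod 24} (he : e.val % 2 = 1) (hu : u = 4 ∨ u = 20)
    {c : ZMod p} (hc : c ≠ 0)
    (hD : RelsOdd ({(e, c), (e + u, c), (e - u, c), (-(3 * e), -(3 * c))} : Multiset (ZMod 24 × ZMod p))) : False := by
  haveI := Fact.mk hp
  have h3 : (3 : ZMod p) ≠ 0 := by exact_mod_cast natCast_ne_zero_smooth hp h17 (n := 3) (by norm_num)
  have h2c : (2 : ZMod p) * c ≠ 0 := by exact_mod_cast smooth_mul_ne_zero hp h17 hc (n := 2) (by norm_num)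
  have h4c : (4 : ZMod p) * c ≠ 0 := by exact_mod_cast smooth_mul_ne_zero hp h17 hc (n := 4) (by norm_num)
  have h8c : (8 : ZMod p) * c ≠ 0 := by exact_mod_cast smooth_mul_ne_zero hp h17 hc (n := 8) (by norm_num)
  have h10c : (10 : ZMod p) * c ≠ 0 := by exact_mod_cast smooth_mul_ne_zero hp h17 hc (n := 10) (by norm_num)
  set d : ZMod p := (3 : ZMod p)⁻¹ * c with hd
  have h3d : 3 * d = c := by rw [hd, ← mul_assoc, mul_inv_cancel₀ h3, one_mul]
  have hd0 : d ≠ 0 := fun h0 ↦ hc (by rw [← h3d, h0, mul_zero])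
  have hcc : -c ≠ c := fun h ↦ h2c (by linear_combination -h)
  have a1 : c ≠ -(3 * c) := fun h ↦ h4c (by linear_combination h)
  have a2 : -c ≠ -(3 * c) := fun h ↦ h2c (by linear_combination h)
  have ndc : d ≠ c := fun h ↦ h2c (by linear_combination h3d - 3 * h)
  have nmdc : -d ≠ c := fun h ↦ h4c (by linear_combination -h3d - 3 * h)
  have a3 : d ≠ -(3 * c) := fun h ↦ h10c (by linear_combination -h3d + 3 * h)
  have a4 : -d ≠ -(3 * c) := fun h ↦ h8c (by linear_combination h3d + 3 * h)
  have hP := hD.psi c hc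
  have hX := hD.chi8 d hd0
  simp only [Multiset.insert_eq_cons, cPsi_cons, cPsi_singleton, cChi8, cU8_cons, cU8_singleton, cT8_cons, cT8_singleton,
    h3d, if_true, if_false, hcc, a1, a2, ndc, nmdc, a3, a4] at hP hX
  exact tab_delta he hu (by linarith) (by linarith)

/-! ### Two even members over opposite fibres are of `S`-type -/

/-- **`S`-type.** In `T = {(e₁, 0), (e₂, 0), (f, 24a), (f′, −24a)}` with `f, f′` even, `a ≠ 0` and `(f′, −24a) ≠ −(f, 24a)`, the
relations `χ₄` (at `12a`, `4a` against `2a`) and `χ₃` (at `12a`, `6a`, `3a` against `2a`) force `f, f′ ∈ {0, 12}`: the characters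
`χ₄`, `χ₃` see the residues `2e, 4e′, 8e″, 6e‴` and pair them off. [folklore] -/
private theorem even_pair (hp : p.Prime) (h17 : 17 ≤ p) {T : Multiset (ZMod 24 × ZMod p)} (hT : RelsEven T)
    {e₁ e₂ f f' : ZMod 24} {a : ZMod p} (hTe : T = {(e₁, 0), (e₂, 0), (f, 24 * a), (f', -(24 * a))})
    (hf : f.val % 2 = 0) (hf' : f'.val % 2 = 0) (ha : a ≠ 0)
    (hzw : ((f', -(24 * a)) : ZMod 24 × ZMod p) ≠ -(f, 24 * a)) : (f = 0 ∨ f = 12) ∧ (f' = 0 ∨ f' = 12) := by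
  haveI := Fact.mk hp
  have hne : f' ≠ -f := fun h ↦ hzw (by rw [h, Prod.neg_mk])
  obtain ⟨-, -, -, -, -, hU4f, hT4f, hU3f⟩ := even_tables hf
  obtain ⟨-, -, -, -, -, hU4f', hT4f', hU3f'⟩ := even_tables hf'
  have hk2 : (2 : ZMod p) * a ≠ 0 := by exact_mod_cast smooth_mul_ne_zero hp h17 ha (n := 2) (by norm_num)
  have hk3 : (3 : ZMod p) * a ≠ 0 := by exact_mod_cast smooth_mul_ne_zero hp h17 ha (n := 3) (by norm_num)
  have hk4 : (4 : ZMod p) * a ≠ 0 := by exact_mod_cast smooth_mul_ne_zero hp h17 ha (n := 4) (by norm_num)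
  have hk6 : (6 : ZMod p) * a ≠ 0 := by exact_mod_cast smooth_mul_ne_zero hp h17 ha (n := 6) (by norm_num)
  have hk8 : (8 : ZMod p) * a ≠ 0 := by exact_mod_cast smooth_mul_ne_zero hp h17 ha (n := 8) (by norm_num)
  have hk12 : (12 : ZMod p) * a ≠ 0 := by exact_mod_cast smooth_mul_ne_zero hp h17 ha (n := 12) (by norm_num)
  have hk16 : (16 : ZMod p) * a ≠ 0 := by exact_mod_cast smooth_mul_ne_zero hp h17 ha (n := 16) (by norm_num)
  have hk18 : (18 : ZMod p) * a ≠ 0 := by exact_mod_cast smooth_mul_ne_zero hp h17 ha (n := 18) (by norm_num)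
  have hk20 : (20 : ZMod p) * a ≠ 0 := by exact_mod_cast smooth_mul_ne_zero hp h17 ha (n := 20) (by norm_num)
  have hk21 : (21 : ZMod p) * a ≠ 0 := by exact_mod_cast smooth_mul_ne_zero hp h17 ha (n := 21) (by norm_num)
  have hk22 : (22 : ZMod p) * a ≠ 0 := by exact_mod_cast smooth_mul_ne_zero hp h17 ha (n := 22) (by norm_num)
  have hk24 : (24 : ZMod p) * a ≠ 0 := by exact_mod_cast smooth_mul_ne_zero hp h17 ha (n := 24) (by norm_num)
  have hk26 : (26 : ZMod p) * a ≠ 0 := by exact_mod_cast smooth_mul_ne_zero hp h17 ha (n := 26) (by norm_num)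
  have hk27 : (27 : ZMod p) * a ≠ 0 := by exact_mod_cast smooth_mul_ne_zero hp h17 ha (n := 27) (by norm_num)
  have hk28 : (28 : ZMod p) * a ≠ 0 := by exact_mod_cast smooth_mul_ne_zero hp h17 ha (n := 28) (by norm_num)
  have hk30 : (30 : ZMod p) * a ≠ 0 := by exact_mod_cast smooth_mul_ne_zero hp h17 ha (n := 30) (by norm_num)
  have hk32 : (32 : ZMod p) * a ≠ 0 := by exact_mod_cast smooth_mul_ne_zero hp h17 ha (n := 32) (by norm_num)
  have hk36 : (36 : ZMod p) * a ≠ 0 := by exact_mod_cast smooth_mul_ne_zero hp h17 ha (n := 36) (by norm_num)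
  have hk40 : (40 : ZMod p) * a ≠ 0 := by exact_mod_cast smooth_mul_ne_zero hp h17 ha (n := 40) (by norm_num)
  have hk48 : (48 : ZMod p) * a ≠ 0 := by exact_mod_cast smooth_mul_ne_zero hp h17 ha (n := 48) (by norm_num)
  have hk60 : (60 : ZMod p) * a ≠ 0 := by exact_mod_cast smooth_mul_ne_zero hp h17 ha (n := 60) (by norm_num)
  have hk72 : (72 : ZMod p) * a ≠ 0 := by exact_mod_cast smooth_mul_ne_zero hp h17 ha (n := 72) (by norm_num)
  have hk96 : (96 : ZMod p) * a ≠ 0 := by exact_mod_cast smooth_mul_ne_zero hp h17 ha (n := 96) (by norm_num)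
  have hk120 : (120 : ZMod p) * a ≠ 0 := by exact_mod_cast smooth_mul_ne_zero hp h17 ha (n := 120) (by norm_num)
  have z1 : (12 * a : ZMod p) ≠ 0 := fun h ↦ hk12 (by linear_combination h)
  have q1 : (12 * a : ZMod p) ≠ 24 * a := fun h ↦ hk12 (by linear_combination -h)
  have qn1 : (-(12 * a) : ZMod p) ≠ -(24 * a) := fun h ↦ hk12 (by linear_combination h)
  have r1 : (-(12 * a) : ZMod p) ≠ 24 * a := fun h ↦ hk36 (by linear_combination -h)
  have rn1 : (12 * a : ZMod p) ≠ -(24 * a) := fun h ↦ hk36 (by linear_combination h)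
  have zn1 : (-(12 * a) : ZMod p) ≠ 0 := fun h ↦ hk12 (by linear_combination -h)
  have z2 : (3 * (12 * a) : ZMod p) ≠ 0 := fun h ↦ hk36 (by linear_combination h)
  have q2 : (3 * (12 * a) : ZMod p) ≠ 24 * a := fun h ↦ hk12 (by linear_combination h)
  have qn2 : (-(3 * (12 * a)) : ZMod p) ≠ -(24 * a) := fun h ↦ hk12 (by linear_combination -h)
  have r2 : (-(3 * (12 * a)) : ZMod p) ≠ 24 * a := fun h ↦ hk60 (by linear_combination -h)
  have rn2 : (3 * (12 * a) : ZMod p) ≠ -(24 * a) := fun h ↦ hk60 (by linear_combination h)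
  have zn2 : (-(3 * (12 * a)) : ZMod p) ≠ 0 := fun h ↦ hk36 (by linear_combination -h)
  have z3 : (2 * (12 * a) : ZMod p) ≠ 0 := fun h ↦ hk24 (by linear_combination h)
  have q3 : (2 * (12 * a) : ZMod p) = 24 * a := by ring
  have qn3 : (-(2 * (12 * a)) : ZMod p) = -(24 * a) := by ring
  have r3 : (-(2 * (12 * a)) : ZMod p) ≠ 24 * a := fun h ↦ hk48 (by linear_combination -h)
  have rn3 : (2 * (12 * a) : ZMod p) ≠ -(24 * a) := fun h ↦ hk48 (by linear_combination h)
  have zn3 : (-(2 * (12 * a)) : ZMod p) ≠ 0 := fun h ↦ hk24 (by linear_combination -h)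
  have z4 : (6 * (12 * a) : ZMod p) ≠ 0 := fun h ↦ hk72 (by linear_combination h)
  have q4 : (6 * (12 * a) : ZMod p) ≠ 24 * a := fun h ↦ hk48 (by linear_combination h)
  have qn4 : (-(6 * (12 * a)) : ZMod p) ≠ -(24 * a) := fun h ↦ hk48 (by linear_combination -h)
  have r4 : (-(6 * (12 * a)) : ZMod p) ≠ 24 * a := fun h ↦ hk96 (by linear_combination -h)
  have rn4 : (6 * (12 * a) : ZMod p) ≠ -(24 * a) := fun h ↦ hk96 (by linear_combination h)
  have zn4 : (-(6 * (12 * a)) : ZMod p) ≠ 0 := fun h ↦ hk72 (by linear_combination -h)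
  have z5 : (4 * a : ZMod p) ≠ 0 := fun h ↦ hk4 (by linear_combination h)
  have q5 : (4 * a : ZMod p) ≠ 24 * a := fun h ↦ hk20 (by linear_combination -h)
  have qn5 : (-(4 * a) : ZMod p) ≠ -(24 * a) := fun h ↦ hk20 (by linear_combination h)
  have r5 : (-(4 * a) : ZMod p) ≠ 24 * a := fun h ↦ hk28 (by linear_combination -h)
  have rn5 : (4 * a : ZMod p) ≠ -(24 * a) := fun h ↦ hk28 (by linear_combination h)
  have zn5 : (-(4 * a) : ZMod p) ≠ 0 := fun h ↦ hk4 (by linear_combination -h)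
  have z6 : (3 * (4 * a) : ZMod p) ≠ 0 := fun h ↦ hk12 (by linear_combination h)
  have q6 : (3 * (4 * a) : ZMod p) ≠ 24 * a := fun h ↦ hk12 (by linear_combination -h)
  have qn6 : (-(3 * (4 * a)) : ZMod p) ≠ -(24 * a) := fun h ↦ hk12 (by linear_combination h)
  have r6 : (-(3 * (4 * a)) : ZMod p) ≠ 24 * a := fun h ↦ hk36 (by linear_combination -h)
  have rn6 : (3 * (4 * a) : ZMod p) ≠ -(24 * a) := fun h ↦ hk36 (by linear_combination h)
  have zn6 : (-(3 * (4 * a)) : ZMod p) ≠ 0 := fun h ↦ hk12 (by linear_combination -h)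
  have z7 : (2 * (4 * a) : ZMod p) ≠ 0 := fun h ↦ hk8 (by linear_combination h)
  have q7 : (2 * (4 * a) : ZMod p) ≠ 24 * a := fun h ↦ hk16 (by linear_combination -h)
  have qn7 : (-(2 * (4 * a)) : ZMod p) ≠ -(24 * a) := fun h ↦ hk16 (by linear_combination h)
  have r7 : (-(2 * (4 * a)) : ZMod p) ≠ 24 * a := fun h ↦ hk32 (by linear_combination -h)
  have rn7 : (2 * (4 * a) : ZMod p) ≠ -(24 * a) := fun h ↦ hk32 (by linear_combination h)
  have zn7 : (-(2 * (4 * a)) : ZMod p) ≠ 0 := fun h ↦ hk8 (by linear_combination -h)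
  have z8 : (6 * (4 * a) : ZMod p) ≠ 0 := fun h ↦ hk24 (by linear_combination h)
  have q8 : (6 * (4 * a) : ZMod p) = 24 * a := by ring
  have qn8 : (-(6 * (4 * a)) : ZMod p) = -(24 * a) := by ring
  have r8 : (-(6 * (4 * a)) : ZMod p) ≠ 24 * a := fun h ↦ hk48 (by linear_combination -h)
  have rn8 : (6 * (4 * a) : ZMod p) ≠ -(24 * a) := fun h ↦ hk48 (by linear_combination h)
  have zn8 : (-(6 * (4 * a)) : ZMod p) ≠ 0 := fun h ↦ hk24 (by linear_combination -h)
  have z9 : (2 * a : ZMod p) ≠ 0 := fun h ↦ hk2 (by linear_combination h)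
  have q9 : (2 * a : ZMod p) ≠ 24 * a := fun h ↦ hk22 (by linear_combination -h)
  have qn9 : (-(2 * a) : ZMod p) ≠ -(24 * a) := fun h ↦ hk22 (by linear_combination h)
  have r9 : (-(2 * a) : ZMod p) ≠ 24 * a := fun h ↦ hk26 (by linear_combination -h)
  have rn9 : (2 * a : ZMod p) ≠ -(24 * a) := fun h ↦ hk26 (by linear_combination h)
  have zn9 : (-(2 * a) : ZMod p) ≠ 0 := fun h ↦ hk2 (by linear_combination -h)
  have z10 : (3 * (2 * a) : ZMod p) ≠ 0 := fun h ↦ hk6 (by linear_combination h)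
  have q10 : (3 * (2 * a) : ZMod p) ≠ 24 * a := fun h ↦ hk18 (by linear_combination -h)
  have qn10 : (-(3 * (2 * a)) : ZMod p) ≠ -(24 * a) := fun h ↦ hk18 (by linear_combination h)
  have r10 : (-(3 * (2 * a)) : ZMod p) ≠ 24 * a := fun h ↦ hk30 (by linear_combination -h)
  have rn10 : (3 * (2 * a) : ZMod p) ≠ -(24 * a) := fun h ↦ hk30 (by linear_combination h)
  have zn10 : (-(3 * (2 * a)) : ZMod p) ≠ 0 := fun h ↦ hk6 (by linear_combination -h)
  have z11 : (2 * (2 * a) : ZMod p) ≠ 0 := fun h ↦ hk4 (by linear_combination h)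
  have q11 : (2 * (2 * a) : ZMod p) ≠ 24 * a := fun h ↦ hk20 (by linear_combination -h)
  have qn11 : (-(2 * (2 * a)) : ZMod p) ≠ -(24 * a) := fun h ↦ hk20 (by linear_combination h)
  have r11 : (-(2 * (2 * a)) : ZMod p) ≠ 24 * a := fun h ↦ hk28 (by linear_combination -h)
  have rn11 : (2 * (2 * a) : ZMod p) ≠ -(24 * a) := fun h ↦ hk28 (by linear_combination h)
  have zn11 : (-(2 * (2 * a)) : ZMod p) ≠ 0 := fun h ↦ hk4 (by linear_combination -h)
  have z12 : (6 * (2 * a) : ZMod p) ≠ 0 := fun h ↦ hk12 (by linear_combination h)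
  have q12 : (6 * (2 * a) : ZMod p) ≠ 24 * a := fun h ↦ hk12 (by linear_combination -h)
  have qn12 : (-(6 * (2 * a)) : ZMod p) ≠ -(24 * a) := fun h ↦ hk12 (by linear_combination h)
  have r12 : (-(6 * (2 * a)) : ZMod p) ≠ 24 * a := fun h ↦ hk36 (by linear_combination -h)
  have rn12 : (6 * (2 * a) : ZMod p) ≠ -(24 * a) := fun h ↦ hk36 (by linear_combination h)
  have zn12 : (-(6 * (2 * a)) : ZMod p) ≠ 0 := fun h ↦ hk12 (by linear_combination -h)
  have z13 : (4 * (12 * a) : ZMod p) ≠ 0 := fun h ↦ hk48 (by linear_combination h)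
  have q13 : (4 * (12 * a) : ZMod p) ≠ 24 * a := fun h ↦ hk24 (by linear_combination h)
  have qn13 : (-(4 * (12 * a)) : ZMod p) ≠ -(24 * a) := fun h ↦ hk24 (by linear_combination -h)
  have r13 : (-(4 * (12 * a)) : ZMod p) ≠ 24 * a := fun h ↦ hk72 (by linear_combination -h)
  have rn13 : (4 * (12 * a) : ZMod p) ≠ -(24 * a) := fun h ↦ hk72 (by linear_combination h)
  have zn13 : (-(4 * (12 * a)) : ZMod p) ≠ 0 := fun h ↦ hk48 (by linear_combination -h)
  have z14 : (8 * (12 * a) : ZMod p) ≠ 0 := fun h ↦ hk96 (by linear_combination h)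
  have q14 : (8 * (12 * a) : ZMod p) ≠ 24 * a := fun h ↦ hk72 (by linear_combination h)
  have qn14 : (-(8 * (12 * a)) : ZMod p) ≠ -(24 * a) := fun h ↦ hk72 (by linear_combination -h)
  have r14 : (-(8 * (12 * a)) : ZMod p) ≠ 24 * a := fun h ↦ hk120 (by linear_combination -h)
  have rn14 : (8 * (12 * a) : ZMod p) ≠ -(24 * a) := fun h ↦ hk120 (by linear_combination h)
  have zn14 : (-(8 * (12 * a)) : ZMod p) ≠ 0 := fun h ↦ hk96 (by linear_combination -h)
  have z15 : (6 * a : ZMod p) ≠ 0 := fun h ↦ hk6 (by linear_combination h)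
  have q15 : (6 * a : ZMod p) ≠ 24 * a := fun h ↦ hk18 (by linear_combination -h)
  have qn15 : (-(6 * a) : ZMod p) ≠ -(24 * a) := fun h ↦ hk18 (by linear_combination h)
  have r15 : (-(6 * a) : ZMod p) ≠ 24 * a := fun h ↦ hk30 (by linear_combination -h)
  have rn15 : (6 * a : ZMod p) ≠ -(24 * a) := fun h ↦ hk30 (by linear_combination h)
  have zn15 : (-(6 * a) : ZMod p) ≠ 0 := fun h ↦ hk6 (by linear_combination -h)
  have z16 : (2 * (6 * a) : ZMod p) ≠ 0 := fun h ↦ hk12 (by linear_combination h)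
  have q16 : (2 * (6 * a) : ZMod p) ≠ 24 * a := fun h ↦ hk12 (by linear_combination -h)
  have qn16 : (-(2 * (6 * a)) : ZMod p) ≠ -(24 * a) := fun h ↦ hk12 (by linear_combination h)
  have r16 : (-(2 * (6 * a)) : ZMod p) ≠ 24 * a := fun h ↦ hk36 (by linear_combination -h)
  have rn16 : (2 * (6 * a) : ZMod p) ≠ -(24 * a) := fun h ↦ hk36 (by linear_combination h)
  have zn16 : (-(2 * (6 * a)) : ZMod p) ≠ 0 := fun h ↦ hk12 (by linear_combination -h)
  have z17 : (4 * (6 * a) : ZMod p) ≠ 0 := fun h ↦ hk24 (by linear_combination h)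
  have q17 : (4 * (6 * a) : ZMod p) = 24 * a := by ring
  have qn17 : (-(4 * (6 * a)) : ZMod p) = -(24 * a) := by ring
  have r17 : (-(4 * (6 * a)) : ZMod p) ≠ 24 * a := fun h ↦ hk48 (by linear_combination -h)
  have rn17 : (4 * (6 * a) : ZMod p) ≠ -(24 * a) := fun h ↦ hk48 (by linear_combination h)
  have zn17 : (-(4 * (6 * a)) : ZMod p) ≠ 0 := fun h ↦ hk24 (by linear_combination -h)
  have z18 : (8 * (6 * a) : ZMod p) ≠ 0 := fun h ↦ hk48 (by linear_combination h)
  have q18 : (8 * (6 * a) : ZMod p) ≠ 24 * a := fun h ↦ hk24 (by linear_combination h)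
  have qn18 : (-(8 * (6 * a)) : ZMod p) ≠ -(24 * a) := fun h ↦ hk24 (by linear_combination -h)
  have r18 : (-(8 * (6 * a)) : ZMod p) ≠ 24 * a := fun h ↦ hk72 (by linear_combination -h)
  have rn18 : (8 * (6 * a) : ZMod p) ≠ -(24 * a) := fun h ↦ hk72 (by linear_combination h)
  have zn18 : (-(8 * (6 * a)) : ZMod p) ≠ 0 := fun h ↦ hk48 (by linear_combination -h)
  have z19 : (3 * a : ZMod p) ≠ 0 := fun h ↦ hk3 (by linear_combination h)
  have q19 : (3 * a : ZMod p) ≠ 24 * a := fun h ↦ hk21 (by linear_combination -h)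
  have qn19 : (-(3 * a) : ZMod p) ≠ -(24 * a) := fun h ↦ hk21 (by linear_combination h)
  have r19 : (-(3 * a) : ZMod p) ≠ 24 * a := fun h ↦ hk27 (by linear_combination -h)
  have rn19 : (3 * a : ZMod p) ≠ -(24 * a) := fun h ↦ hk27 (by linear_combination h)
  have zn19 : (-(3 * a) : ZMod p) ≠ 0 := fun h ↦ hk3 (by linear_combination -h)
  have z20 : (2 * (3 * a) : ZMod p) ≠ 0 := fun h ↦ hk6 (by linear_combination h)
  have q20 : (2 * (3 * a) : ZMod p) ≠ 24 * a := fun h ↦ hk18 (by linear_combination -h)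
  have qn20 : (-(2 * (3 * a)) : ZMod p) ≠ -(24 * a) := fun h ↦ hk18 (by linear_combination h)
  have r20 : (-(2 * (3 * a)) : ZMod p) ≠ 24 * a := fun h ↦ hk30 (by linear_combination -h)
  have rn20 : (2 * (3 * a) : ZMod p) ≠ -(24 * a) := fun h ↦ hk30 (by linear_combination h)
  have zn20 : (-(2 * (3 * a)) : ZMod p) ≠ 0 := fun h ↦ hk6 (by linear_combination -h)
  have z21 : (4 * (3 * a) : ZMod p) ≠ 0 := fun h ↦ hk12 (by linear_combination h)
  have q21 : (4 * (3 * a) : ZMod p) ≠ 24 * a := fun h ↦ hk12 (by linear_combination -h)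
  have qn21 : (-(4 * (3 * a)) : ZMod p) ≠ -(24 * a) := fun h ↦ hk12 (by linear_combination h)
  have r21 : (-(4 * (3 * a)) : ZMod p) ≠ 24 * a := fun h ↦ hk36 (by linear_combination -h)
  have rn21 : (4 * (3 * a) : ZMod p) ≠ -(24 * a) := fun h ↦ hk36 (by linear_combination h)
  have zn21 : (-(4 * (3 * a)) : ZMod p) ≠ 0 := fun h ↦ hk12 (by linear_combination -h)
  have z22 : (8 * (3 * a) : ZMod p) ≠ 0 := fun h ↦ hk24 (by linear_combination h)
  have q22 : (8 * (3 * a) : ZMod p) = 24 * a := by ring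
  have qn22 : (-(8 * (3 * a)) : ZMod p) = -(24 * a) := by ring
  have r22 : (-(8 * (3 * a)) : ZMod p) ≠ 24 * a := fun h ↦ hk48 (by linear_combination -h)
  have rn22 : (8 * (3 * a) : ZMod p) ≠ -(24 * a) := fun h ↦ hk48 (by linear_combination h)
  have zn22 : (-(8 * (3 * a)) : ZMod p) ≠ 0 := fun h ↦ hk24 (by linear_combination -h)
  have z23 : (4 * (2 * a) : ZMod p) ≠ 0 := fun h ↦ hk8 (by linear_combination h)
  have q23 : (4 * (2 * a) : ZMod p) ≠ 24 * a := fun h ↦ hk16 (by linear_combination -h)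
  have qn23 : (-(4 * (2 * a)) : ZMod p) ≠ -(24 * a) := fun h ↦ hk16 (by linear_combination h)
  have r23 : (-(4 * (2 * a)) : ZMod p) ≠ 24 * a := fun h ↦ hk32 (by linear_combination -h)
  have rn23 : (4 * (2 * a) : ZMod p) ≠ -(24 * a) := fun h ↦ hk32 (by linear_combination h)
  have zn23 : (-(4 * (2 * a)) : ZMod p) ≠ 0 := fun h ↦ hk8 (by linear_combination -h)
  have z24 : (8 * (2 * a) : ZMod p) ≠ 0 := fun h ↦ hk16 (by linear_combination h)
  have q24 : (8 * (2 * a) : ZMod p) ≠ 24 * a := fun h ↦ hk8 (by linear_combination -h)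
  have qn24 : (-(8 * (2 * a)) : ZMod p) ≠ -(24 * a) := fun h ↦ hk8 (by linear_combination h)
  have r24 : (-(8 * (2 * a)) : ZMod p) ≠ 24 * a := fun h ↦ hk40 (by linear_combination -h)
  have rn24 : (8 * (2 * a) : ZMod p) ≠ -(24 * a) := fun h ↦ hk40 (by linear_combination h)
  have zn24 : (-(8 * (2 * a)) : ZMod p) ≠ 0 := fun h ↦ hk16 (by linear_combination -h)
  have n24 : (24 * a : ZMod p) ≠ -(24 * a) := fun h ↦ hk48 (by linear_combination h)
  have nm24 : (-(24 * a) : ZMod p) ≠ 24 * a := fun h ↦ hk48 (by linear_combination -h)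
  have zm24 : (-(24 * a) : ZMod p) ≠ 0 := fun h ↦ hk24 (by linear_combination -h)
  have G1 := hT.g4 (12 * a) (2 * a) hk12 hk2
  have G2 := hT.g4 (4 * a) (2 * a) hk4 hk2
  have G3 := hT.g3 (12 * a) (2 * a) hk12 hk2
  have G4 := hT.g3 (6 * a) (2 * a) hk6 hk2
  have G5 := hT.g3 (3 * a) (2 * a) hk3 hk2
  rw [hTe] at G1 G2 G3 G4 G5
  simp only [Multiset.insert_eq_cons, cGam4, cGam3, cU4_cons, cU4_singleton, cE4_cons, cE4_singleton, cT4_cons,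
    cT4_singleton, cS4_cons, cS4_singleton, cU3_cons, cU3_singleton, cE3_cons, cE3_singleton, cQ3_cons, cQ3_singleton,
    cO3_cons, cO3_singleton, if_true, if_false, neg_zero, hk24, n24, nm24, zm24, add_zero, zero_add, mul_zero,
    hU4f, hT4f, hU3f, hU4f', hT4f', hU3f',
      z1, q1, qn1, r1, rn1, zn1, z2, q2, qn2, r2,
      rn2, zn2, z3, q3, qn3, r3, rn3, zn3, z4, q4,
      qn4, r4, rn4, zn4, z5, q5, qn5, r5, rn5, zn5,
      z6, q6, qn6, r6, rn6, zn6, z7, q7, qn7, r7,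
      rn7, zn7, z8, q8, qn8, r8, rn8, zn8, z9, q9,
      qn9, r9, rn9, zn9, z10, q10, qn10, r10, rn10, zn10,
      z11, q11, qn11, r11, rn11, zn11, z12, q12, qn12, r12,
      rn12, zn12, z13, q13, qn13, r13, rn13, zn13, z14, q14,
      qn14, r14, rn14, zn14, z15, q15, qn15, r15, rn15, zn15,
      z16, q16, qn16, r16, rn16, zn16, z17, q17, qn17, r17,
      rn17, zn17, z18, q18, qn18, r18, rn18, zn18, z19, q19,
      qn19, r19, rn19, zn19, z20, q20, qn20, r20, rn20, zn20,
      z21, q21, qn21, r21, rn21, zn21, z22, q22, qn22, r22,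
      rn22, zn22, z23, q23, qn23, r23, rn23, zn23, z24, q24,
      qn24, r24, rn24, zn24] at G1 G2 G3 G4 G5
  exact tab_even hf hf' hne (by linarith) (by linarith) (by linarith) (by linarith) (by linarith)

/-! ### Level `24p`: arithmetic, the transfer to level `12p`, pair removal, the doubling map -/

/-- `12p` as a residue modulo `24p` (Shioda's `m′ = m/2`). -/
local notation "K24" => (((12 * p : ℕ)) : ZMod (24 * p))

/-- `12p + 12p = 0` in `ℤ/24p`. [folklore] -/
private theorem K_add_K : K24 + K24 = 0 := by
  have h : K24 + K24 = (((24 * p : ℕ)) : ZMod (24 * p)) := by push_cast; ring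
  rw [h, ZMod.natCast_self]

/-- `2 · 12p = 0`. [folklore] -/
private theorem two_mul_K : (2 : ZMod (24 * p)) * K24 = 0 := by rw [two_mul, K_add_K]

/-- `−12p = 12p`. [folklore] -/
private theorem neg_K : -K24 = K24 := by linear_combination -(K_add_K (p := p))

/-- `⟨12p⟩ = 12p`. [folklore] -/
private theorem val_K (hp : 0 < p) : (K24).val = 12 * p := by
  rw [ZMod.val_natCast, Nat.mod_eq_of_lt (by omega)]

/-- `12p ≠ 0`. [folklore] -/
private theorem K_ne_zero (hp : 0 < p) : K24 ≠ 0 := fun h ↦ by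
  have := val_K hp; rw [h, ZMod.val_zero] at this; omega

/-- `⟨x + 12p⟩`: add `12p` and reduce. [folklore] -/
private theorem val_add_K [NeZero (24 * p)] (hp : 0 < p) (x : ZMod (24 * p)) :
    ((x + K24).val = x.val + 12 * p ∧ x.val < 12 * p) ∨ ((x + K24).val + 24 * p = x.val + 12 * p ∧ 12 * p ≤ x.val) := by
  have hq := val_K hp
  have hx := ZMod.val_lt x
  by_cases h : x.val < 12 * p
  · left
    refine ⟨?_, h⟩
    rw [ZMod.val_add_of_lt (by rw [hq]; omega), hq]
  · right
    refine ⟨?_, by omega⟩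
    have := ZMod.val_add_val_of_le (a := x) (b := K24) (by rw [hq]; omega)
    rw [hq] at this
    omega

/-- `⟨2x⟩`: double and reduce. [folklore] -/
private theorem val_two_mul [NeZero (24 * p)] (hp : 0 < p) (x : ZMod (24 * p)) :
    (((2 : ZMod (24 * p)) * x).val = 2 * x.val ∧ x.val < 12 * p) ∨
      (((2 : ZMod (24 * p)) * x).val + 24 * p = 2 * x.val ∧ 12 * p ≤ x.val) := by
  have h2 : ((2 : ZMod (24 * p))).val = 2 := by
    rw [show (2 : ZMod (24 * p)) = ((2 : ℕ) : ZMod (24 * p)) by norm_cast, ZMod.val_natCast, Nat.mod_eq_of_lt (by omega)]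
  have hx := ZMod.val_lt x
  rw [ZMod.val_mul, h2]
  by_cases h : x.val < 12 * p
  · left
    exact ⟨Nat.mod_eq_of_lt (by omega), h⟩
  · right
    refine ⟨?_, by omega⟩
    rw [Nat.mod_eq_sub_mod (by omega), Nat.mod_eq_of_lt (by omega)]
    omega

/-- `12p · x = 12p` for odd `x`, `= 0` for even `x`. [folklore] -/
private theorem K_mul [NeZero (24 * p)] (x : ZMod (24 * p)) : K24 * x = if x.val % 2 = 1 then K24 else 0 := by
  have e : x = ((x.val : ℕ) : ZMod (24 * p)) := (ZMod.natCast_zmod_val x).symm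
  have hd := Nat.div_add_mod x.val 2
  have h2 := two_mul_K (p := p)
  push_cast at h2
  split_ifs with h
  · rw [h] at hd
    conv_lhs => rw [e, ← hd]
    push_cast
    linear_combination (↑(x.val / 2) : ZMod (24 * p)) * h2
  · have h0 : x.val % 2 = 0 := by omega
    rw [h0, add_zero] at hd
    conv_lhs => rw [e, ← hd]
    push_cast
    linear_combination (↑(x.val / 2) : ZMod (24 * p)) * h2

/-- A unit of `ℤ/24p` is odd. [folklore] -/
private theorem odd_of_isUnit {u : ZMod (24 * p)} (hu : IsUnit u) : u.val % 2 = 1 := by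
  obtain ⟨u, rfl⟩ := hu
  have hc := ZMod.val_coe_unit_coprime u
  by_contra h
  have h2 : 2 ∣ (u : ZMod (24 * p)).val := Nat.dvd_of_mod_eq_zero (by omega)
  have : 2 ∣ Nat.gcd (u : ZMod (24 * p)).val (24 * p) := Nat.dvd_gcd h2 ⟨12 * p, by omega⟩
  rw [hc] at this
  omega

/-- `1 + 12p` is a unit (an involution). [folklore] -/
private theorem isUnit_one_add_K : IsUnit (1 + K24 : ZMod (24 * p)) := by
  have hq2 : (K24 : ZMod (24 * p)) * K24 = 0 := by
    have : (K24 : ZMod (24 * p)) * K24 = ((6 * p : ℕ) : ZMod (24 * p)) * (((24 * p : ℕ)) : ZMod (24 * p)) := by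
      push_cast; ring
    rw [this, ZMod.natCast_self, mul_zero]
  have h1 : (1 + K24 : ZMod (24 * p)) * (1 + K24) = 1 := by linear_combination hq2 + two_mul_K (p := p)
  exact ⟨⟨1 + K24, 1 + K24, h1, h1⟩, rfl⟩

/-- Half the representative: `⟨w⟩/2` as a residue (used for even `w`). [folklore] -/
private def half (w : ZMod (24 * p)) : ZMod (24 * p) := ((w.val / 2 : ℕ) : ZMod (24 * p))

/-- `2 · (⟨w⟩/2) = w` for even `w`. [folklore] -/
private theorem two_mul_half [NeZero (24 * p)] {w : ZMod (24 * p)} (hw : w.val % 2 = 0) : (2 : ZMod (24 * p)) * half w = w := by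
  have h := Nat.div_add_mod w.val 2
  rw [hw, add_zero] at h
  have e : (((2 * (w.val / 2) : ℕ)) : ZMod (24 * p)) = w := by rw [h, ZMod.natCast_zmod_val]
  calc (2 : ZMod (24 * p)) * half w = (((2 * (w.val / 2) : ℕ)) : ZMod (24 * p)) := by unfold half; push_cast; ring
    _ = w := e

/-- `⟨w⟩/2 + ⟨w⟩/2 = w` for even `w`. [folklore] -/
private theorem half_add_half [NeZero (24 * p)] {w : ZMod (24 * p)} (hw : w.val % 2 = 0) : half w + half w = w := by
  rw [← two_mul, two_mul_half hw]

/-- The norm sum of a mapped multiset as a sum of representatives. [folklore] -/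
private theorem mNormSum_map {X : Type*} (t : Multiset X) {k : ℕ} (g : X → ZMod k) :
    mNormSum (t.map g) = (t.map fun w ↦ (g w).val).sum := by
  simp only [mNormSum, Multiset.map_map, Function.comp_def]

/-- The representative of the reduction modulo `12p`. [folklore] -/
private theorem val_castHom [NeZero (24 * p)] (hnm : 12 * p ∣ 24 * p) (y : ZMod (24 * p)) :
    (ZMod.castHom hnm (ZMod (12 * p)) y).val = y.val % (12 * p) := by
  rw [ZMod.castHom_apply, ZMod.cast_eq_val, ZMod.val_natCast]

/-- **`⟨y⟩ + ⟨y + 12p⟩ = 2⟨ȳ⟩ + 12p`** (`ȳ = y mod 12p`). [folklore] -/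
private theorem val_add_val_add_K [NeZero (24 * p)] (hp : 0 < p) (hnm : 12 * p ∣ 24 * p) (y : ZMod (24 * p)) :
    y.val + (y + K24).val = 2 * (ZMod.castHom hnm (ZMod (12 * p)) y).val + 12 * p := by
  rw [val_castHom]
  rcases val_add_K hp y with ⟨h, hlt⟩ | ⟨h, hle⟩
  · rw [Nat.mod_eq_of_lt hlt]; omega
  · rw [Nat.mod_eq_sub_mod hle, Nat.mod_eq_of_lt (by have := ZMod.val_lt y; omega)]; omega

/-- **`⟨2y⟩ = 2⟨ȳ⟩`**. [folklore] -/
private theorem val_two_mul_eq [NeZero (24 * p)] (hp : 0 < p) (hnm : 12 * p ∣ 24 * p) (y : ZMod (24 * p)) :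
    ((2 : ZMod (24 * p)) * y).val = 2 * (ZMod.castHom hnm (ZMod (12 * p)) y).val := by
  rw [val_castHom]
  rcases val_two_mul hp y with ⟨h, hlt⟩ | ⟨h, hle⟩
  · rw [Nat.mod_eq_of_lt hlt]; omega
  · rw [Nat.mod_eq_sub_mod hle, Nat.mod_eq_of_lt (by have := ZMod.val_lt y; omega)]; omega

/-- The reduction of an odd residue is non-zero. [folklore] -/
private theorem castHom_ne_zero_of_odd [NeZero (24 * p)] (hnm : 12 * p ∣ 24 * p) {w : ZMod (24 * p)} (hw : w.val % 2 = 1) :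
    ZMod.castHom hnm (ZMod (12 * p)) w ≠ 0 := by
  intro h
  have hv := congrArg ZMod.val h
  rw [val_castHom, ZMod.val_zero] at hv
  obtain ⟨k, hk⟩ := Nat.dvd_of_mod_eq_zero hv
  have : 2 ∣ w.val := ⟨6 * p * k, by rw [hk]; ring⟩
  omega

/-- The reduction of half a non-zero even residue is non-zero. [folklore] -/
private theorem castHom_half_ne_zero [NeZero (24 * p)] (hnm : 12 * p ∣ 24 * p) {w : ZMod (24 * p)} (hw0 : w ≠ 0)
    (hw : w.val % 2 = 0) : ZMod.castHom hnm (ZMod (12 * p)) (half w) ≠ 0 := by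
  intro h
  have hv := congrArg ZMod.val h
  rw [val_castHom, ZMod.val_zero, half, ZMod.val_natCast, Nat.mod_mod_of_dvd _ ⟨2, by ring⟩] at hv
  have hlt := ZMod.val_lt w
  have hdvd : 12 * p ∣ w.val / 2 := Nat.dvd_of_mod_eq_zero hv
  have h0' : w.val / 2 = 0 := Nat.eq_zero_of_dvd_of_lt hdvd (by omega)
  have h0 : w.val = 0 := by omega
  exact hw0 ((ZMod.val_eq_zero w).mp h0)

/-- The image of a unit under `unitsMap` is its reduction. [folklore] -/
private theorem coe_unitsMap (hnm : 12 * p ∣ 24 * p) (u : (ZMod (24 * p))ˣ) :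
    ((ZMod.unitsMap hnm u : (ZMod (12 * p))ˣ) : ZMod (12 * p)) = ZMod.castHom hnm (ZMod (12 * p)) (u : ZMod (24 * p)) := by
  simp [ZMod.unitsMap_def]

/-- **The transfer of a Hodge multiset of level `24p` is a Hodge multiset of level `12p`.** Split a multiset over `ℤ/24p` into
its odd part `s₁` and its even part `s₀`; then `T(s) = (s₁ mod 12p) + 2·((s₀/2) mod 12p)` (halve the even members, reduce
everything modulo `12p`, count the halved members twice) is a Hodge multiset over `ℤ/12p` whenever `s₁ + s₀` is one over `ℤ/24p`.
PROOF: for a unit `u` of `ℤ/24p` also `u(1 + 12p)` is a unit, and `u(1 + 12p)w = uw + 12p` for odd `w`, `= uw` for even `w`; adding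
the two norm equations and using `⟨y⟩ + ⟨y + 12p⟩ = 2⟨ȳ⟩ + 12p`, `⟨2y⟩ = 2⟨ȳ⟩` gives the norm equation of `T(s)` at `ū`; every unit
of `ℤ/12p` is such a `ū` (verbatim the computation of the tree's `isHodgeMultiset_transfer_twelvePrime`, one storey higher; the
elementary shadow of the distribution relation of the Bernoulli function). [cite: Aoki1983, Prop. 2.2] [cite: Shioda1979PJA, §1 eq. (2)] -/
theorem isHodgeMultiset_transfer_twentyFourPrime [NeZero (24 * p)] (hp : 0 < p) (hnm : 12 * p ∣ 24 * p)
    {so se : Multiset (ZMod (24 * p))} (hso : ∀ w ∈ so, w.val % 2 = 1) (hse : ∀ w ∈ se, w.val % 2 = 0)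
    (hs : IsHodgeMultiset (so + se)) :
    IsHodgeMultiset (so.map (ZMod.castHom hnm (ZMod (12 * p))) +
      (se.map fun w ↦ ZMod.castHom hnm (ZMod (12 * p)) (half w)) + se.map fun w ↦ ZMod.castHom hnm (ZMod (12 * p)) (half w)) := by
  classical
  set R := ZMod.castHom hnm (ZMod (12 * p)) with hR
  obtain ⟨⟨hne, hsum⟩, hnorm⟩ := hs
  refine ⟨⟨?_, ?_⟩, fun v ↦ ?_⟩
  · intro a ha
    rcases Multiset.mem_add.mp ha with ha | ha
    · rcases Multiset.mem_add.mp ha with ha | ha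
      · obtain ⟨w, hw, rfl⟩ := Multiset.mem_map.mp ha
        exact castHom_ne_zero_of_odd hnm (hso w hw)
      · obtain ⟨w, hw, rfl⟩ := Multiset.mem_map.mp ha
        exact castHom_half_ne_zero hnm (hne w (Multiset.mem_add.mpr (Or.inr hw))) (hse w hw)
    · obtain ⟨w, hw, rfl⟩ := Multiset.mem_map.mp ha
      exact castHom_half_ne_zero hnm (hne w (Multiset.mem_add.mpr (Or.inr hw))) (hse w hw)
  · have h1 : (so.map R).sum = R so.sum := (map_multiset_sum R so).symm
    have h2 : (se.map fun w ↦ R (half w)).sum + (se.map fun w ↦ R (half w)).sum = R se.sum := by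
      rw [← Multiset.sum_map_add, map_multiset_sum]
      congr 1
      refine Multiset.map_congr rfl fun w hw ↦ ?_
      rw [← RingHom.map_add, half_add_half (hse w hw)]
    rw [Multiset.sum_add, Multiset.sum_add, add_assoc, h1, h2, ← RingHom.map_add, ← Multiset.sum_add, hsum, RingHom.map_zero]
  · obtain ⟨u, hu⟩ := ZMod.unitsMap_surjective hnm v
    have hvu : (v : ZMod (12 * p)) = R u := by rw [← hu, coe_unitsMap]
    obtain ⟨w1, hw1⟩ := isUnit_one_add_K (p := p)
    have odd_u : (u : ZMod (24 * p)).val % 2 = 1 := odd_of_isUnit u.isUnit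
    have hqu : K24 * (u : ZMod (24 * p)) = K24 := by rw [K_mul, if_pos odd_u]
    have h1 := hnorm u
    have h2 := hnorm (u * w1)
    rw [Multiset.map_add, mNormSum_add, mNormSum_map, mNormSum_map, Multiset.card_add] at h1 h2
    have eso : (so.map fun w ↦ (((u * w1 : (ZMod (24 * p))ˣ) : ZMod (24 * p)) * w).val) =
        so.map fun w ↦ ((u : ZMod (24 * p)) * w + K24).val := by
      refine Multiset.map_congr rfl fun w hw ↦ ?_
      have hqw : K24 * w = K24 := by rw [K_mul, if_pos (hso w hw)]
      rw [Units.val_mul, hw1]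
      congr 1
      linear_combination (u : ZMod (24 * p)) * hqw + hqu
    have ese : (se.map fun w ↦ (((u * w1 : (ZMod (24 * p))ˣ) : ZMod (24 * p)) * w).val) =
        se.map fun w ↦ ((u : ZMod (24 * p)) * w).val := by
      refine Multiset.map_congr rfl fun w hw ↦ ?_
      have hqw : K24 * w = 0 := by rw [K_mul, if_neg (by rw [hse w hw]; omega)]
      rw [Units.val_mul, hw1]
      congr 1
      linear_combination (u : ZMod (24 * p)) * hqw
    rw [eso, ese] at h2
    have hO : (so.map fun w ↦ ((u : ZMod (24 * p)) * w).val).sum + (so.map fun w ↦ ((u : ZMod (24 * p)) * w + K24).val).sum =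
        2 * (so.map fun w ↦ (R ((u : ZMod (24 * p)) * w)).val).sum + 12 * p * Multiset.card so := by
      rw [← Multiset.sum_map_add]
      have : (so.map fun w ↦ ((u : ZMod (24 * p)) * w).val + ((u : ZMod (24 * p)) * w + K24).val) =
          so.map fun w ↦ 2 * (R ((u : ZMod (24 * p)) * w)).val + 12 * p :=
        Multiset.map_congr rfl fun w _ ↦ val_add_val_add_K hp hnm _
      rw [this, Multiset.sum_map_add, Multiset.sum_map_mul_left, Multiset.map_const', Multiset.sum_replicate, smul_eq_mul,
        mul_comm (Multiset.card so)]
    have hE : (se.map fun w ↦ ((u : ZMod (24 * p)) * w).val).sum =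
        2 * (se.map fun w ↦ (R ((u : ZMod (24 * p)) * half w)).val).sum := by
      rw [← Multiset.sum_map_mul_left]
      congr 1
      refine Multiset.map_congr rfl fun w hw ↦ ?_
      rw [← val_two_mul_eq hp hnm, mul_left_comm, two_mul_half (hse w hw)]
    simp only [Multiset.map_add, mNormSum_add, Multiset.map_map, mNormSum_map, Multiset.card_add, Multiset.card_map,
      Function.comp_apply]
    have tso : (so.map fun w ↦ ((v : ZMod (12 * p)) * R w).val) = so.map fun w ↦ (R ((u : ZMod (24 * p)) * w)).val := by
      refine Multiset.map_congr rfl fun w _ ↦ ?_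
      rw [hvu, ← map_mul]
    have tse : (se.map fun w ↦ ((v : ZMod (12 * p)) * R (half w)).val) =
        se.map fun w ↦ (R ((u : ZMod (24 * p)) * half w)).val := by
      refine Multiset.map_congr rfl fun w _ ↦ ?_
      rw [hvu, ← map_mul]
    rw [tso, tse]
    generalize Multiset.card so = cso at h1 h2 hO ⊢
    generalize Multiset.card se = cse at h1 h2 ⊢
    have hmn : 24 * p * (cso + cse) = 2 * (12 * p * cso) + 2 * (12 * p * cse) := by ring
    have hgoal : 12 * p * (cso + cse + cse) = 12 * p * cso + 2 * (12 * p * cse) := by ring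
    rw [hgoal]
    omega
/-- **Pair removal.** A Hodge multiset minus a pair `{a, −a}` is a Hodge multiset (the norm of a pair is the level at every
unit). [cite: Shioda1979PJA, §1 (elements of length 1)] -/
private theorem isHodgeMultiset_of_cons_cons_neg {n : ℕ} [NeZero n] {a : ZMod n} {τ : Multiset (ZMod n)}
    (h : IsHodgeMultiset (a ::ₘ (-a) ::ₘ τ)) : IsHodgeMultiset τ := by
  obtain ⟨⟨hne, hsum⟩, hnorm⟩ := h
  have ha : a ≠ 0 := hne a (Multiset.mem_cons_self _ _)
  refine ⟨⟨fun x hx ↦ hne x (Multiset.mem_cons_of_mem (Multiset.mem_cons_of_mem hx)), ?_⟩, fun t ↦ ?_⟩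
  · simpa [Multiset.sum_cons] using hsum
  · have h := hnorm t
    simp only [Multiset.map_cons, mNormSum_cons, Multiset.card_cons] at h
    have hta : ((t : ZMod n) * a) ≠ 0 := (t.isUnit.mul_right_eq_zero).not.mpr ha
    have hneg : ((t : ZMod n) * -a).val = n - ((t : ZMod n) * a).val := by
      rw [mul_neg, ZMod.neg_val, if_neg hta]
    have hlt := ZMod.val_lt ((t : ZMod n) * a)
    rw [hneg] at h
    have e : n * (Multiset.card τ + 1 + 1) = n * Multiset.card τ + 2 * n := by ring
    rw [e] at h
    omega

/-- **A Hodge pair sums to zero** (the congruence part of the definition). [folklore] -/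
private theorem eq_neg_of_isHodgeMultiset_pair {n : ℕ} {a b : ZMod n} (h : IsHodgeMultiset ({a, b} : Multiset (ZMod n))) :
    b = -a := by
  have := h.1.2
  simp only [Multiset.insert_eq_cons, Multiset.sum_cons, Multiset.sum_singleton] at this
  linear_combination this

/-- **Halving the multiplicities keeps the norm equations** (`T(s) = σ + σ`). [folklore] -/
private theorem norm_of_add_self {n : ℕ} {σ : Multiset (ZMod n)} (h : IsHodgeMultiset (σ + σ)) (t : (ZMod n)ˣ) :
    2 * mNormSum (σ.map fun a ↦ (t : ZMod n) * a) = n * Multiset.card σ := by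
  have := h.2 t
  rw [Multiset.map_add, mNormSum_add, Multiset.card_add,
    show n * (Multiset.card σ + Multiset.card σ) = 2 * (n * Multiset.card σ) by ring] at this
  omega

/-- `6p` as a residue modulo `12p` (Shioda's `m′` of the level `12p`). -/
local notation "K12" => (((6 * p : ℕ)) : ZMod (12 * p))

/-- `4p` as a residue modulo `12p` (Shioda's `m″` of the level `12p`). -/
local notation "D12" => (((4 * p : ℕ)) : ZMod (12 * p))

/-- `8p` as a residue modulo `24p` (Shioda's `m″ = m/3`). -/
local notation "D24" => (((8 * p : ℕ)) : ZMod (24 * p))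

/-- `4p` as a residue modulo `24p`. -/
local notation "E24" => (((4 * p : ℕ)) : ZMod (24 * p))

section Double

/-- The doubling map `t ↦ 2t` from `ℤ/12p` to `ℤ/24p` (on representatives). [folklore] -/
private def dbl (t : ZMod (12 * p)) : ZMod (24 * p) := ((2 * t.val : ℕ) : ZMod (24 * p))

/-- `dbl` is additive. [folklore] -/
private theorem dbl_add [NeZero (12 * p)] (a b : ZMod (12 * p)) : dbl (a + b) = dbl a + dbl b := by
  have key : ∃ k : ℕ, 2 * a.val + 2 * b.val = 2 * (a + b).val + 24 * p * k := by
    by_cases h : a.val + b.val < 12 * p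
    · exact ⟨0, by rw [ZMod.val_add_of_lt h]; ring⟩
    · refine ⟨1, ?_⟩
      have e := ZMod.val_add_val_of_le (not_lt.mp h)
      omega
  obtain ⟨k, hk⟩ := key
  have := congrArg (Nat.cast : ℕ → ZMod (24 * p)) hk
  rw [Nat.cast_add, Nat.cast_add, Nat.cast_mul ((24 * p : ℕ)), ZMod.natCast_self, zero_mul, add_zero] at this
  unfold dbl
  rw [this]

/-- `dbl 0 = 0`. [folklore] -/
private theorem dbl_zero : dbl (0 : ZMod (12 * p)) = 0 := by
  simp [dbl]

/-- `dbl (−a) = −dbl a`. [folklore] -/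
private theorem dbl_neg [NeZero (12 * p)] (a : ZMod (12 * p)) : dbl (-a) = -dbl a :=
  eq_neg_of_add_eq_zero_left (by rw [← dbl_add, neg_add_cancel, dbl_zero])

/-- `dbl (k a) = k dbl a`. [folklore] -/
private theorem dbl_natCast_mul [NeZero (12 * p)] (k : ℕ) (a : ZMod (12 * p)) :
    dbl ((k : ZMod (12 * p)) * a) = (k : ZMod (24 * p)) * dbl a := by
  induction k with
  | zero => simp [dbl_zero]
  | succ k ih => rw [Nat.cast_succ, Nat.cast_succ, add_mul, one_mul, dbl_add, ih, add_mul, one_mul]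

/-- `dbl (2a) = 2 dbl a`. [folklore] -/
private theorem dbl_two_mul [NeZero (12 * p)] (a : ZMod (12 * p)) : dbl (2 * a) = 2 * dbl a := by
  exact_mod_cast dbl_natCast_mul 2 a

/-- `dbl (3a) = 3 dbl a`. [folklore] -/
private theorem dbl_three_mul [NeZero (12 * p)] (a : ZMod (12 * p)) : dbl (3 * a) = 3 * dbl a := by
  exact_mod_cast dbl_natCast_mul 3 a

/-- `dbl (4a) = 4 dbl a`. [folklore] -/
private theorem dbl_four_mul [NeZero (12 * p)] (a : ZMod (12 * p)) : dbl (4 * a) = 4 * dbl a := by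
  exact_mod_cast dbl_natCast_mul 4 a

/-- `dbl (n a) = n dbl a` for a numeral `n`. [folklore] -/
private theorem dbl_ofNat_mul [NeZero (12 * p)] (n : ℕ) [n.AtLeastTwo] (a : ZMod (12 * p)) :
    dbl ((ofNat(n) : ZMod (12 * p)) * a) = (ofNat(n) : ZMod (24 * p)) * dbl a := by
  exact_mod_cast dbl_natCast_mul (OfNat.ofNat n) a

/-- `dbl n̄ = 2n` for `n < 12p`. [folklore] -/
private theorem dbl_natCast {n : ℕ} (hn : n < 12 * p) : dbl ((n : ℕ) : ZMod (12 * p)) = (((2 * n : ℕ)) : ZMod (24 * p)) := by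
  unfold dbl
  rw [ZMod.val_natCast, Nat.mod_eq_of_lt hn]

/-- `dbl (y mod 12p) = 2y`. [folklore] -/
private theorem dbl_castHom [NeZero (24 * p)] (hnm : 12 * p ∣ 24 * p) (y : ZMod (24 * p)) :
    dbl (ZMod.castHom hnm (ZMod (12 * p)) y) = 2 * y := by
  unfold dbl
  rw [val_castHom]
  have key : ∃ k : ℕ, 2 * y.val = 2 * (y.val % (12 * p)) + 24 * p * k := by
    have hlt := ZMod.val_lt y
    by_cases h : y.val < 12 * p
    · exact ⟨0, by rw [Nat.mod_eq_of_lt h]; ring⟩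
    · refine ⟨1, ?_⟩
      rw [Nat.mod_eq_sub_mod (not_lt.mp h), Nat.mod_eq_of_lt (by omega)]
      omega
  obtain ⟨k, hk⟩ := key
  have := congrArg (Nat.cast : ℕ → ZMod (24 * p)) hk
  rw [Nat.cast_add, Nat.cast_mul ((24 * p : ℕ)), ZMod.natCast_self, zero_mul, add_zero, Nat.cast_mul, Nat.cast_ofNat,
    ZMod.natCast_zmod_val] at this
  rw [← this]

/-- `dbl ((w/2) mod 12p) = w` for even `w`. [folklore] -/
private theorem dbl_castHom_half [NeZero (24 * p)] (hnm : 12 * p ∣ 24 * p) {w : ZMod (24 * p)} (hw : w.val % 2 = 0) :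
    dbl (ZMod.castHom hnm (ZMod (12 * p)) (half w)) = w := by
  rw [dbl_castHom hnm, two_mul_half hw]

/-- `⟨6p̄⟩ = 6p` at level `12p`. [folklore] -/
private theorem val_K12 (hp : 0 < p) : (K12).val = 6 * p := by
  rw [ZMod.val_natCast, Nat.mod_eq_of_lt (by omega)]

/-- `dbl 6p̄ = 12p`. [folklore] -/
private theorem dbl_K12 (hp : 0 < p) : dbl K12 = K24 := by
  unfold dbl
  rw [val_K12 hp, show 2 * (6 * p) = 12 * p by ring]

/-- `dbl 4p̄ = 8p`. [folklore] -/
private theorem dbl_D12 (hp : 0 < p) : dbl D12 = D24 := by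
  unfold dbl
  rw [ZMod.val_natCast, Nat.mod_eq_of_lt (by omega), show 2 * (4 * p) = 8 * p by ring]

/-- `6p̄ ≠ 0` at level `12p`. [folklore] -/
private theorem K12_ne_zero (hp : 0 < p) : K12 ≠ 0 := fun h ↦ by
  have h1 := congrArg ZMod.val h
  rw [val_K12 hp, ZMod.val_zero] at h1
  omega

/-- `−6p̄ = 6p̄` at level `12p`. [folklore] -/
private theorem neg_K12 : -K12 = K12 := by
  have h : K12 + K12 = (((12 * p : ℕ)) : ZMod (12 * p)) := by push_cast; ring
  rw [ZMod.natCast_self] at h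
  linear_combination -h

/-- `2z = 0` iff `z ∈ {0, 6p̄}` at level `12p`. [folklore] -/
private theorem two_mul_eq_zero_twelveP [NeZero (12 * p)] (hp : 0 < p) {z : ZMod (12 * p)} :
    (2 : ZMod (12 * p)) * z = 0 ↔ z = 0 ∨ z = K12 := by
  constructor
  · intro h
    have hv := congrArg ZMod.val h
    have h2 : ((2 : ZMod (12 * p))).val = 2 := by
      rw [show (2 : ZMod (12 * p)) = ((2 : ℕ) : ZMod (12 * p)) by norm_cast, ZMod.val_natCast, Nat.mod_eq_of_lt (by omega)]
    rw [ZMod.val_mul, h2, ZMod.val_zero] at hv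
    have hlt := ZMod.val_lt z
    obtain ⟨k, hk⟩ := Nat.dvd_of_mod_eq_zero hv
    have hk2 : k < 2 := by
      by_contra hk2
      have : 12 * p * 2 ≤ 12 * p * k := Nat.mul_le_mul_left _ (by omega)
      omega
    interval_cases k
    · left
      apply ZMod.val_injective (12 * p)
      rw [ZMod.val_zero]; omega
    · right
      apply ZMod.val_injective (12 * p)
      rw [val_K12 hp]; omega
  · rintro (rfl | rfl)
    · rw [mul_zero]
    · linear_combination -(neg_K12 (p := p))

/-- The residue of the norm sum is the sum. [folklore] -/
private theorem natCast_mNormSum {n : ℕ} [NeZero n] (t : Multiset (ZMod n)) : ((mNormSum t : ℕ) : ZMod n) = t.sum := by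
  rw [mNormSum, Nat.cast_multiset_sum, Multiset.map_map]
  have : (t.map (Nat.cast ∘ ZMod.val) : Multiset (ZMod n)) = t.map id :=
    Multiset.map_congr rfl fun a _ ↦ ZMod.natCast_zmod_val a
  rw [this, Multiset.map_id]

/-- Parity at level `12p`: the reduction keeps the parity of the representative. [folklore] -/
private theorem val_castHom_mod_two [NeZero (24 * p)] (hnm : 12 * p ∣ 24 * p) (y : ZMod (24 * p)) :
    (ZMod.castHom hnm (ZMod (12 * p)) y).val % 2 = y.val % 2 := by
  rw [val_castHom, Nat.mod_mod_of_dvd _ (⟨6 * p, by ring⟩ : 2 ∣ 12 * p)]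

/-- Parity at level `12p`: negation keeps parity. [folklore] -/
private theorem val_neg_mod_two_twelve [NeZero (12 * p)] (a : ZMod (12 * p)) : (-a).val % 2 = a.val % 2 := by
  rw [ZMod.neg_val]
  split_ifs with h
  · rw [h, ZMod.val_zero]
  · have := ZMod.val_lt a
    omega

/-- Parity at level `12p`: a `k`-multiple with `k` even is even. [folklore] -/
private theorem val_two_mul_mod_two_twelve [NeZero (12 * p)] (a : ZMod (12 * p)) : ((2 : ZMod (12 * p)) * a).val % 2 = 0 := by
  have h2 : ((2 : ZMod (12 * p))).val % 2 = 0 := by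
    rw [show (2 : ZMod (12 * p)) = ((2 : ℕ) : ZMod (12 * p)) by norm_cast, ZMod.val_natCast]
    rcases Nat.lt_or_ge 2 (12 * p) with h | h
    · rw [Nat.mod_eq_of_lt h]
    · have : 12 * p = 0 ∨ 12 * p = 1 ∨ 12 * p = 2 := by omega
      rcases this with h0 | h0 | h0
      · exact absurd h0 (NeZero.ne _)
      · omega
      · rw [h0]
  rw [ZMod.val_mul, Nat.mod_mod_of_dvd _ ⟨6 * p, by ring⟩, Nat.mul_mod, h2, zero_mul, Nat.zero_mod]

end Double

/-! ### Indices: pair-freeness of explicit quadruples -/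

/-- Two distinct positions of a tuple give a member of the value multiset and a member of its erasure. [folklore] -/
private theorem apply_mem_erase_of_ne {K : ℕ} {X : Type*} [DecidableEq X] (Z : Fin K → X) {i j : Fin K} (hij : i ≠ j) :
    Z j ∈ (univ.val.map Z).erase (Z i) := by
  by_cases h : Z j = Z i
  · rw [h, ← Multiset.count_pos, Multiset.count_erase_self]
    have h2 : 2 ≤ count (Z i) (univ.val.map Z) := by
      rw [Multiset.count_map]
      have hsub : ({i, j} : Finset (Fin K)).val ≤ univ.val.filter fun k ↦ Z i = Z k := by
        rw [Multiset.le_iff_subset (Finset.nodup _)]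
        intro k hk
        rw [Finset.mem_val, Finset.mem_insert, Finset.mem_singleton] at hk
        rw [Multiset.mem_filter]
        rcases hk with rfl | rfl
        · exact ⟨Finset.mem_univ_val _, rfl⟩
        · exact ⟨Finset.mem_univ_val _, h.symm⟩
      calc 2 = Multiset.card ({i, j} : Finset (Fin K)).val := by rw [Finset.card_val, Finset.card_pair hij]
        _ ≤ _ := Multiset.card_le_card hsub
    omega
  · exact (Multiset.mem_erase_of_ne h).mpr (Multiset.mem_map.mpr ⟨j, Finset.mem_univ_val j, rfl⟩)

/-- Indecomposability of a tuple in terms of its multiset of values. [folklore] -/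
private theorem pairfree_of_fun {n : ℕ} {α : Fin 4 → ZMod n} (hind : ∀ i j : Fin 4, i ≠ j → α i + α j ≠ 0) :
    ∀ a ∈ univ.val.map α, ∀ b ∈ (univ.val.map α).erase a, a + b ≠ 0 := by
  classical
  intro a ha b hb hab
  obtain ⟨i, -, rfl⟩ := Multiset.mem_map.mp ha
  by_cases hba : b = α i
  · have h2 : 2 ≤ count (α i) (univ.val.map α) := by
      have := Multiset.count_pos.mpr (hba ▸ hb)
      rw [Multiset.count_erase_self] at this
      omega
    rw [count_univ_val_map] at h2
    obtain ⟨j, hj, k, hk, hjk⟩ := Finset.one_lt_card.mp h2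
    simp only [Finset.mem_filter, Finset.mem_univ, true_and] at hj hk
    exact hind j k hjk (by rw [hj, hk, ← hba]; nth_rw 1 [hba]; exact hab)
  · have hb' : b ∈ univ.val.map α := Multiset.mem_of_mem_erase hb
    obtain ⟨j, -, rfl⟩ := Multiset.mem_map.mp hb'
    exact hind i j (fun e ↦ hba (by rw [e])) hab

/-- The value multiset of `![a, b, c, d]`. [folklore] -/
private theorem univ_val_map_four {X : Type*} (a b c d : X) : univ.val.map ![a, b, c, d] = {a, b, c, d} := by
  simp; rfl

/-- **Parity count.** A multiset over `ℤ/24p` with sum `0` has an even number of odd entries. [folklore] -/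
private theorem even_card_filter_odd [NeZero (24 * p)] {s : Multiset (ZMod (24 * p))} (hs : s.sum = 0) :
    Even (Multiset.card (s.filter fun a ↦ a.val % 2 = 1)) := by
  have hsum : 24 * p ∣ (s.map ZMod.val).sum := by
    rw [← ZMod.natCast_eq_zero_iff, Nat.cast_multiset_sum, Multiset.map_map]
    have : (s.map (Nat.cast ∘ ZMod.val) : Multiset (ZMod (24 * p))) = s.map id :=
      Multiset.map_congr rfl fun a _ ↦ ZMod.natCast_zmod_val a
    rw [this, Multiset.map_id, hs]
  have h2 : 2 ∣ (s.map ZMod.val).sum := Nat.dvd_trans ⟨12 * p, by ring⟩ hsum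
  have key : ∀ t : Multiset (ZMod (24 * p)),
      (t.map ZMod.val).sum % 2 = Multiset.card (t.filter fun a ↦ a.val % 2 = 1) % 2 := by
    intro t
    induction t using Multiset.induction_on with
    | empty => simp
    | cons a t ih =>
      rw [Multiset.map_cons, Multiset.sum_cons, Multiset.filter_cons, Multiset.card_add, Nat.add_mod, ih]
      split_ifs with ha
      · rw [Multiset.card_singleton]
        omega
      · rw [Multiset.card_zero]
        omega
  have := key s
  rw [Nat.even_iff]
  omega
/-! ### Case I: no odd member — the doubled standard elements of level `12p` -/

/-- **All members even:** `T(s) = 2·σ` with `σ` a pair-free Hodge `4`-multiset of level `12p`, which the level-`12p` theorem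
classifies; doubling back, `s = {x, x + 12p, −2x, 12p}`, `{x, x + 12p, 2x + 12p, −4x}` or `{x, x + 8p, x + 16p, −3x}` with `x = 2y`,
or `s = 2·(t p)·(1, 4, 9, 10)`, `2·(t p)·(1, 6, 8, 9)` — the doubles of the two exceptional quadruples of level `12p`.
[cite: Shioda1982PicardFermat, §2 p. 726 (𝔍²ₘ(d) ≅ 𝔍²_{m/d}(1)) and Prop. 4 (Q′) p. 729] [cite: MeyerNeutsch1981Fermatquadrupel, Tabelle 1 p. 54 (N = 12)] -/
private theorem case_all_even [NeZero (24 * p)] (hp : p.Prime) (h17 : 17 ≤ p) {s : Multiset (ZMod (24 * p))}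
    (hs : IsHodgeMultiset s) (hcard : Multiset.card s = 4) (hpf : ∀ a ∈ s, ∀ b ∈ s.erase a, a + b ≠ 0)
    (hev : ∀ w ∈ s, w.val % 2 = 0) :
    ∃ x : ZMod (24 * p), s = {x, x + K24, -(2 * x), K24} ∨ s = {x, x + K24, 2 * x + K24, -(4 * x)} ∨
      s = {x, x + D24, x + 2 * D24, -(3 * x)} ∨
      ((∃ t : ℕ, (t = 1 ∨ t = 5 ∨ t = 7 ∨ t = 11) ∧ x = ((t * p : ℕ) : ZMod (24 * p))) ∧
        (s = {2 * x, 8 * x, 18 * x, 20 * x} ∨ s = {2 * x, 12 * x, 16 * x, 18 * x})) := by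
  classical
  have hp0 := hp.pos
  haveI : NeZero (12 * p) := ⟨by omega⟩
  have hnm : 12 * p ∣ 24 * p := ⟨2, by ring⟩
  set R := ZMod.castHom hnm (ZMod (12 * p)) with hR
  -- enumerate `s`
  obtain ⟨z1, hz1⟩ := Multiset.card_pos_iff_exists_mem.mp (by omega : 0 < Multiset.card s)
  have hct : Multiset.card (s.erase z1) = 3 := by rw [Multiset.card_erase_of_mem hz1, hcard]; rfl
  obtain ⟨z2, z3, z4, ht⟩ := Multiset.card_eq_three.mp hct
  have hsZ : s = {z1, z2, z3, z4} := by rw [← Multiset.cons_erase hz1, ht]; rfl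
  set Z : Fin 4 → ZMod (24 * p) := ![z1, z2, z3, z4] with hZ
  have hZs : univ.val.map Z = s := by rw [hsZ, hZ, univ_val_map_four]
  have hZev : ∀ i, (Z i).val % 2 = 0 := fun i ↦ hev _ (by rw [← hZs]; exact Multiset.mem_map.mpr ⟨i, Finset.mem_univ_val i, rfl⟩)
  -- the transfer `T(s) = σ + σ`
  have hT := isHodgeMultiset_transfer_twentyFourPrime hp0 hnm (so := 0) (se := s) (by simp) hev (by simpa using hs)
  rw [Multiset.map_zero, zero_add] at hT
  set σ := s.map fun w ↦ R (half w) with hσ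
  have hc4 : Multiset.card σ = 4 := by rw [hσ, Multiset.card_map, hcard]
  have hσH : IsHodgeMultiset σ := by
    have hnorm' := norm_of_add_self hT
    refine ⟨⟨fun a ha ↦ hT.1.1 a (Multiset.mem_add.mpr (Or.inl ha)), ?_⟩, hnorm'⟩
    have h1 := hnorm' 1
    simp only [Units.val_one, one_mul, Multiset.map_id', hc4] at h1
    have hN : mNormSum σ = 2 * (12 * p) := by omega
    have := natCast_mNormSum σ
    rw [hN, show ((2 * (12 * p) : ℕ) : ZMod (12 * p)) = 2 * ((12 * p : ℕ) : ZMod (12 * p)) by push_cast; ring,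
      ZMod.natCast_self, mul_zero] at this
    exact this.symm
  -- `σ` is pair-free (double back)
  set β : Fin 4 → ZMod (12 * p) := fun i ↦ R (half (Z i)) with hβ
  have hβσ : univ.val.map β = σ := by rw [hσ, ← hZs, Multiset.map_map]; rfl
  have hβind : ∀ i j : Fin 4, i ≠ j → β i + β j ≠ 0 := by
    intro i j hij h
    have h' := congrArg dbl h
    rw [dbl_add, dbl_zero, hβ] at h'
    simp only at h'
    rw [dbl_castHom_half hnm (hZev i), dbl_castHom_half hnm (hZev j)] at h'
    exact hpf (Z i) (by rw [← hZs]; exact Multiset.mem_map.mpr ⟨i, Finset.mem_univ_val i, rfl⟩) (Z j)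
      (hZs ▸ apply_mem_erase_of_ne Z hij) h'
  have hσpf : ∀ a ∈ σ, ∀ b ∈ σ.erase a, a + b ≠ 0 := by rw [← hβσ]; exact pairfree_of_fun hβind
  -- the classification at level `12p`
  obtain ⟨y, hy⟩ := classify_hodgeMultiset_twelvePrime hp h17 hσH hc4 hσpf
  -- `s = σ.map dbl`
  have hsd : s = σ.map dbl := by
    rw [hσ, Multiset.map_map]
    conv_lhs => rw [← Multiset.map_id s]
    refine Multiset.map_congr rfl fun w hw ↦ ?_
    simp only [Function.comp_apply, id]
    rw [dbl_castHom_half hnm (hev w hw)]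
  rcases hy with e | e | e | ⟨⟨t, ht, rfl⟩, e⟩
  · refine ⟨dbl y, Or.inl ?_⟩
    rw [hsd, e]
    simp only [Multiset.insert_eq_cons, Multiset.map_cons, Multiset.map_singleton, dbl_add, dbl_neg, dbl_two_mul, dbl_K12 hp0]
  · refine ⟨dbl y, Or.inr (Or.inl ?_)⟩
    rw [hsd, e]
    simp only [Multiset.insert_eq_cons, Multiset.map_cons, Multiset.map_singleton, dbl_add, dbl_neg, dbl_two_mul,
      dbl_four_mul, dbl_K12 hp0]
  · refine ⟨dbl y, Or.inr (Or.inr (Or.inl ?_))⟩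
    rw [hsd, e]
    simp only [Multiset.insert_eq_cons, Multiset.map_cons, Multiset.map_singleton, dbl_add, dbl_neg, dbl_two_mul,
      dbl_three_mul, dbl_D12 hp0]
  · -- the doubled exceptional quadruples of level `12p`
    set X : ZMod (24 * p) := (((t * p : ℕ)) : ZMod (24 * p)) with hX
    refine ⟨X, Or.inr (Or.inr (Or.inr ⟨⟨t, ht, rfl⟩, ?_⟩))⟩
    have htp : t * p < 12 * p := by rcases ht with rfl | rfl | rfl | rfl <;> omega
    have hd1 : dbl ((((t * p : ℕ)) : ZMod (12 * p))) = 2 * X := by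
      rw [dbl_natCast htp, hX]; push_cast; ring
    have m4 : (4 : ZMod (24 * p)) * (2 * X) = 8 * X := by ring
    have m6 : (6 : ZMod (24 * p)) * (2 * X) = 12 * X := by ring
    have m8 : (8 : ZMod (24 * p)) * (2 * X) = 16 * X := by ring
    have m9 : (9 : ZMod (24 * p)) * (2 * X) = 18 * X := by ring
    have m10 : (10 : ZMod (24 * p)) * (2 * X) = 20 * X := by ring
    rcases e with e | e
    · left
      rw [hsd, e]
      simp only [Multiset.insert_eq_cons, Multiset.map_cons, Multiset.map_singleton, dbl_ofNat_mul, hd1, m4, m9, m10]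
    · right
      rw [hsd, e]
      simp only [Multiset.insert_eq_cons, Multiset.map_cons, Multiset.map_singleton, dbl_ofNat_mul, hd1, m6, m8, m9]

/-! ### Small multiset and coordinate helpers -/

/-- `{a, b} + {c, d} = {a, b, c, d}`. [folklore] -/
private theorem pair_add_pair {X : Type*} (a b c d : X) : ({a, b} : Multiset X) + {c, d} = {a, b, c, d} := by
  simp only [Multiset.insert_eq_cons, Multiset.cons_add, Multiset.singleton_add]

/-- A `4`-multiset whose six pairwise sums are non-zero is pair-free. [folklore] -/
private theorem pairfree_quad {n : ℕ} {a b c d : ZMod n} (hab : a + b ≠ 0) (hac : a + c ≠ 0) (had : a + d ≠ 0)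
    (hbc : b + c ≠ 0) (hbd : b + d ≠ 0) (hcd : c + d ≠ 0) :
    ∀ u ∈ ({a, b, c, d} : Multiset (ZMod n)), ∀ v ∈ (({a, b, c, d} : Multiset (ZMod n))).erase u, u + v ≠ 0 := by
  rw [← univ_val_map_four]
  refine pairfree_of_fun fun i j hij h ↦ ?_
  fin_cases i <;> fin_cases j <;> simp at hij h <;>
    first
    | exact hab (by linear_combination h)
    | exact hac (by linear_combination h)
    | exact had (by linear_combination h)
    | exact hbc (by linear_combination h)
    | exact hbd (by linear_combination h)
    | exact hcd (by linear_combination h)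

/-- Pull a member back through `Multiset.map`. [folklore] -/
private theorem exists_cons_of_map_eq_cons {X Y : Type*} [DecidableEq X] [DecidableEq Y] (f : X → Y) {s : Multiset X}
    {b : Y} {t : Multiset Y} (h : s.map f = b ::ₘ t) : ∃ a s', s = a ::ₘ s' ∧ f a = b ∧ s'.map f = t := by
  have hb : b ∈ s.map f := by rw [h]; exact Multiset.mem_cons_self _ _
  obtain ⟨a, ha, hfa⟩ := Multiset.mem_map.mp hb
  refine ⟨a, s.erase a, (Multiset.cons_erase ha).symm, hfa, ?_⟩
  rw [Multiset.map_erase_of_mem _ _ ha, h, hfa, Multiset.erase_cons_head]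

/-- The kernel of the reduction `ℤ/24p → ℤ/12p` is `{0, 12p}`. [folklore] -/
private theorem castHom_eq_zero_iff [NeZero (24 * p)] (hp : 0 < p) (hnm : 12 * p ∣ 24 * p) {w : ZMod (24 * p)} :
    ZMod.castHom hnm (ZMod (12 * p)) w = 0 ↔ w = 0 ∨ w = K24 := by
  haveI : NeZero (12 * p) := ⟨by omega⟩
  constructor
  · intro h0
    have hv := congrArg ZMod.val h0
    rw [val_castHom, ZMod.val_zero] at hv
    have hlt := ZMod.val_lt w
    obtain ⟨k, hk⟩ := Nat.dvd_of_mod_eq_zero hv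
    have hk2 : k < 2 := by
      by_contra hk2
      have : 12 * p * 2 ≤ 12 * p * k := Nat.mul_le_mul_left _ (by omega)
      omega
    interval_cases k
    · left
      apply ZMod.val_injective (24 * p)
      rw [ZMod.val_zero]; omega
    · right
      apply ZMod.val_injective (24 * p)
      rw [val_K hp]; omega
  · rintro (rfl | rfl)
    · exact _root_.map_zero _
    · rw [map_natCast, show ((12 * p : ℕ) : ZMod (12 * p)) = 0 from ZMod.natCast_self _]

/-- Two residues with the same reduction mod `12p` differ by `0` or `12p`. [folklore] -/
private theorem lift_eq [NeZero (24 * p)] (hp : 0 < p) (hnm : 12 * p ∣ 24 * p) {a b : ZMod (24 * p)}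
    (h : ZMod.castHom hnm (ZMod (12 * p)) a = ZMod.castHom hnm (ZMod (12 * p)) b) : a = b ∨ a = b + K24 := by
  have : ZMod.castHom hnm (ZMod (12 * p)) (a - b) = 0 := by rw [_root_.map_sub, h, sub_self]
  rcases (castHom_eq_zero_iff hp hnm).mp this with e | e
  · left; linear_combination e
  · right; linear_combination e

/-- The coordinates of a `δ`-quadruple `{v, v + 4p, v − 4p, −3v}`, `v = pt(e, c)`. [folklore] -/
private theorem map_crt_delta (h : Nat.Coprime 24 p) [NeZero (24 * p)] (e : ZMod 24) (c : ZMod p) :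
    Multiset.map (crt h) {pt h e c, pt h e c + E24, pt h e c - E24, -(3 * pt h e c)} =
      {(e, c), (e + 4 * π, c), (e - 4 * π, c), (-(3 * e), -(3 * c))} := by
  rw [natCast_mul_P h 4, Nat.cast_ofNat, pt_add, pt_sub,
    show (3 : ZMod (24 * p)) = ((3 : ℕ) : ZMod (24 * p)) by norm_num, natCast_mul_pt, neg_pt]
  simp only [Multiset.insert_eq_cons, Multiset.map_cons, Multiset.map_singleton, crt_pt, add_zero, sub_zero, Nat.cast_ofNat]


/-! ### Case 0: all members in the fibre `0` — the level `24` -/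

/-- The level-`24` multiset `{k₁, k₂, k₃, −(k₁ + k₂ + k₃)}`. [folklore] -/
private def lev (k₁ k₂ k₃ : ZMod 24) : Multiset (ZMod 24) := {k₁, k₂, k₃, -(k₁ + k₂ + k₃)}

/-- The `68` pair-free Hodge quadruples of level `24`, by representatives `0 ≤ k < 24` (kernel-enumerated below; up to the
units of `ℤ/24` and the standard families these are the `8` rows of Tabelle 1 at `N = 24` and the doubles of its `2` rows at
`N = 12`). [cite: MeyerNeutsch1981Fermatquadrupel, Tabelle 1 p. 54 (N = 12, 24)] [cite: Shioda1982PicardFermat, table p. 727 (m = 12, 24)] -/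
private def table24 : List (Multiset (ZMod 24)) :=
  [{1, 6, 19, 22}, {1, 8, 17, 22}, {1, 8, 19, 20}, {1, 9, 17, 21}, {1, 10, 18, 19}, {1, 11, 17, 19}, {1, 12, 13, 22},
    {1, 12, 16, 19}, {1, 12, 17, 18}, {1, 13, 14, 20}, {1, 13, 16, 18}, {1, 14, 16, 17}, {2, 5, 18, 23},
    {2, 7, 16, 23}, {2, 7, 19, 20}, {2, 8, 18, 20}, {2, 9, 16, 21}, {2, 10, 18, 18}, {2, 11, 12, 23},
    {2, 11, 16, 19}, {2, 11, 17, 18}, {2, 12, 14, 20}, {2, 12, 16, 18}, {2, 14, 16, 16}, {3, 7, 15, 23},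
    {3, 8, 15, 22}, {3, 11, 15, 19}, {3, 12, 15, 18}, {3, 14, 15, 16}, {4, 5, 16, 23}, {4, 5, 17, 22},
    {4, 6, 16, 22}, {4, 10, 11, 23}, {4, 10, 12, 22}, {4, 10, 16, 18}, {4, 11, 16, 17}, {4, 12, 16, 16},
    {5, 6, 14, 23}, {5, 7, 13, 23}, {5, 8, 12, 23}, {5, 8, 13, 22}, {5, 8, 17, 18}, {5, 9, 13, 21}, {5, 12, 13, 18},
    {5, 12, 14, 17}, {5, 13, 14, 16}, {6, 6, 14, 22}, {6, 7, 12, 23}, {6, 7, 13, 22}, {6, 7, 16, 19}, {6, 8, 11, 23},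
    {6, 8, 12, 22}, {6, 8, 14, 20}, {6, 9, 12, 21}, {6, 11, 12, 19}, {6, 11, 14, 17}, {6, 12, 14, 16},
    {7, 8, 10, 23}, {7, 8, 13, 20}, {7, 10, 12, 19}, {7, 10, 13, 18}, {7, 12, 13, 16}, {8, 8, 10, 22},
    {8, 8, 12, 20}, {8, 9, 10, 21}, {8, 10, 11, 19}, {8, 10, 12, 18}, {8, 11, 12, 17}]

set_option maxHeartbeats 0 in
set_option maxRecDepth 16384 in
set_option synthInstance.maxHeartbeats 0 in
set_option synthInstance.maxSize 4096 in
/-- `level_twentyFour_pairfree`, slice `k₁ = 1` (kernel enumeration of the `24²` pairs). [folklore] -/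
private theorem lev24_slice_1 : ∀ k₂ k₃ : ZMod 24,
    (1 : ZMod 24).val ≤ k₂.val → (1 : ZMod 24).val ≤ k₃.val → (1 : ZMod 24).val ≤ (-(1 + k₂ + k₃)).val →
    ((lev 1 k₂ k₃).map ZMod.val).sum = 48 → (∀ a ∈ lev 1 k₂ k₃, a ≠ 0) →
    ((lev 1 k₂ k₃).map fun k ↦ (5 * k).val).sum = 48 →
    ((lev 1 k₂ k₃).map fun k ↦ (7 * k).val).sum = 48 →
    ((lev 1 k₂ k₃).map fun k ↦ (11 * k).val).sum = 48 →
    (∀ a ∈ lev 1 k₂ k₃, ∀ b ∈ (lev 1 k₂ k₃).erase a, a + b ≠ 0) →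
    lev 1 k₂ k₃ ∈ table24 := by
  decide +kernel

set_option maxHeartbeats 0 in
set_option maxRecDepth 16384 in
set_option synthInstance.maxHeartbeats 0 in
set_option synthInstance.maxSize 4096 in
/-- `level_twentyFour_pairfree`, slice `k₁ = 2` (kernel enumeration of the `24²` pairs). [folklore] -/
private theorem lev24_slice_2 : ∀ k₂ k₃ : ZMod 24,
    (2 : ZMod 24).val ≤ k₂.val → (2 : ZMod 24).val ≤ k₃.val → (2 : ZMod 24).val ≤ (-(2 + k₂ + k₃)).val →
    ((lev 2 k₂ k₃).map ZMod.val).sum = 48 → (∀ a ∈ lev 2 k₂ k₃, a ≠ 0) →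
    ((lev 2 k₂ k₃).map fun k ↦ (5 * k).val).sum = 48 →
    ((lev 2 k₂ k₃).map fun k ↦ (7 * k).val).sum = 48 →
    ((lev 2 k₂ k₃).map fun k ↦ (11 * k).val).sum = 48 →
    (∀ a ∈ lev 2 k₂ k₃, ∀ b ∈ (lev 2 k₂ k₃).erase a, a + b ≠ 0) →
    lev 2 k₂ k₃ ∈ table24 := by
  decide +kernel

set_option maxHeartbeats 0 in
set_option maxRecDepth 16384 in
set_option synthInstance.maxHeartbeats 0 in
set_option synthInstance.maxSize 4096 in
/-- `level_twentyFour_pairfree`, slice `k₁ = 3` (kernel enumeration of the `24²` pairs). [folklore] -/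
private theorem lev24_slice_3 : ∀ k₂ k₃ : ZMod 24,
    (3 : ZMod 24).val ≤ k₂.val → (3 : ZMod 24).val ≤ k₃.val → (3 : ZMod 24).val ≤ (-(3 + k₂ + k₃)).val →
    ((lev 3 k₂ k₃).map ZMod.val).sum = 48 → (∀ a ∈ lev 3 k₂ k₃, a ≠ 0) →
    ((lev 3 k₂ k₃).map fun k ↦ (5 * k).val).sum = 48 →
    ((lev 3 k₂ k₃).map fun k ↦ (7 * k).val).sum = 48 →
    ((lev 3 k₂ k₃).map fun k ↦ (11 * k).val).sum = 48 →
    (∀ a ∈ lev 3 k₂ k₃, ∀ b ∈ (lev 3 k₂ k₃).erase a, a + b ≠ 0) →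
    lev 3 k₂ k₃ ∈ table24 := by
  decide +kernel

set_option maxHeartbeats 0 in
set_option maxRecDepth 16384 in
set_option synthInstance.maxHeartbeats 0 in
set_option synthInstance.maxSize 4096 in
/-- `level_twentyFour_pairfree`, slice `k₁ = 4` (kernel enumeration of the `24²` pairs). [folklore] -/
private theorem lev24_slice_4 : ∀ k₂ k₃ : ZMod 24,
    (4 : ZMod 24).val ≤ k₂.val → (4 : ZMod 24).val ≤ k₃.val → (4 : ZMod 24).val ≤ (-(4 + k₂ + k₃)).val →
    ((lev 4 k₂ k₃).map ZMod.val).sum = 48 → (∀ a ∈ lev 4 k₂ k₃, a ≠ 0) →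
    ((lev 4 k₂ k₃).map fun k ↦ (5 * k).val).sum = 48 →
    ((lev 4 k₂ k₃).map fun k ↦ (7 * k).val).sum = 48 →
    ((lev 4 k₂ k₃).map fun k ↦ (11 * k).val).sum = 48 →
    (∀ a ∈ lev 4 k₂ k₃, ∀ b ∈ (lev 4 k₂ k₃).erase a, a + b ≠ 0) →
    lev 4 k₂ k₃ ∈ table24 := by
  decide +kernel

set_option maxHeartbeats 0 in
set_option maxRecDepth 16384 in
set_option synthInstance.maxHeartbeats 0 in
set_option synthInstance.maxSize 4096 in
/-- `level_twentyFour_pairfree`, slice `k₁ = 5` (kernel enumeration of the `24²` pairs). [folklore] -/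
private theorem lev24_slice_5 : ∀ k₂ k₃ : ZMod 24,
    (5 : ZMod 24).val ≤ k₂.val → (5 : ZMod 24).val ≤ k₃.val → (5 : ZMod 24).val ≤ (-(5 + k₂ + k₃)).val →
    ((lev 5 k₂ k₃).map ZMod.val).sum = 48 → (∀ a ∈ lev 5 k₂ k₃, a ≠ 0) →
    ((lev 5 k₂ k₃).map fun k ↦ (5 * k).val).sum = 48 →
    ((lev 5 k₂ k₃).map fun k ↦ (7 * k).val).sum = 48 →
    ((lev 5 k₂ k₃).map fun k ↦ (11 * k).val).sum = 48 →
    (∀ a ∈ lev 5 k₂ k₃, ∀ b ∈ (lev 5 k₂ k₃).erase a, a + b ≠ 0) →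
    lev 5 k₂ k₃ ∈ table24 := by
  decide +kernel

set_option maxHeartbeats 0 in
set_option maxRecDepth 16384 in
set_option synthInstance.maxHeartbeats 0 in
set_option synthInstance.maxSize 4096 in
/-- `level_twentyFour_pairfree`, slice `k₁ = 6` (kernel enumeration of the `24²` pairs). [folklore] -/
private theorem lev24_slice_6 : ∀ k₂ k₃ : ZMod 24,
    (6 : ZMod 24).val ≤ k₂.val → (6 : ZMod 24).val ≤ k₃.val → (6 : ZMod 24).val ≤ (-(6 + k₂ + k₃)).val →
    ((lev 6 k₂ k₃).map ZMod.val).sum = 48 → (∀ a ∈ lev 6 k₂ k₃, a ≠ 0) →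
    ((lev 6 k₂ k₃).map fun k ↦ (5 * k).val).sum = 48 →
    ((lev 6 k₂ k₃).map fun k ↦ (7 * k).val).sum = 48 →
    ((lev 6 k₂ k₃).map fun k ↦ (11 * k).val).sum = 48 →
    (∀ a ∈ lev 6 k₂ k₃, ∀ b ∈ (lev 6 k₂ k₃).erase a, a + b ≠ 0) →
    lev 6 k₂ k₃ ∈ table24 := by
  decide +kernel

set_option maxHeartbeats 0 in
set_option maxRecDepth 16384 in
set_option synthInstance.maxHeartbeats 0 in
set_option synthInstance.maxSize 4096 in
/-- `level_twentyFour_pairfree`, slice `k₁ = 7` (kernel enumeration of the `24²` pairs). [folklore] -/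
private theorem lev24_slice_7 : ∀ k₂ k₃ : ZMod 24,
    (7 : ZMod 24).val ≤ k₂.val → (7 : ZMod 24).val ≤ k₃.val → (7 : ZMod 24).val ≤ (-(7 + k₂ + k₃)).val →
    ((lev 7 k₂ k₃).map ZMod.val).sum = 48 → (∀ a ∈ lev 7 k₂ k₃, a ≠ 0) →
    ((lev 7 k₂ k₃).map fun k ↦ (5 * k).val).sum = 48 →
    ((lev 7 k₂ k₃).map fun k ↦ (7 * k).val).sum = 48 →
    ((lev 7 k₂ k₃).map fun k ↦ (11 * k).val).sum = 48 →
    (∀ a ∈ lev 7 k₂ k₃, ∀ b ∈ (lev 7 k₂ k₃).erase a, a + b ≠ 0) →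
    lev 7 k₂ k₃ ∈ table24 := by
  decide +kernel

set_option maxHeartbeats 0 in
set_option maxRecDepth 16384 in
set_option synthInstance.maxHeartbeats 0 in
set_option synthInstance.maxSize 4096 in
/-- `level_twentyFour_pairfree`, slice `k₁ = 8` (kernel enumeration of the `24²` pairs). [folklore] -/
private theorem lev24_slice_8 : ∀ k₂ k₃ : ZMod 24,
    (8 : ZMod 24).val ≤ k₂.val → (8 : ZMod 24).val ≤ k₃.val → (8 : ZMod 24).val ≤ (-(8 + k₂ + k₃)).val →
    ((lev 8 k₂ k₃).map ZMod.val).sum = 48 → (∀ a ∈ lev 8 k₂ k₃, a ≠ 0) →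
    ((lev 8 k₂ k₃).map fun k ↦ (5 * k).val).sum = 48 →
    ((lev 8 k₂ k₃).map fun k ↦ (7 * k).val).sum = 48 →
    ((lev 8 k₂ k₃).map fun k ↦ (11 * k).val).sum = 48 →
    (∀ a ∈ lev 8 k₂ k₃, ∀ b ∈ (lev 8 k₂ k₃).erase a, a + b ≠ 0) →
    lev 8 k₂ k₃ ∈ table24 := by
  decide +kernel

set_option maxHeartbeats 0 in
set_option maxRecDepth 16384 in
set_option synthInstance.maxHeartbeats 0 in
set_option synthInstance.maxSize 4096 in
/-- `level_twentyFour_pairfree`, slice `k₁ = 9` (kernel enumeration of the `24²` pairs). [folklore] -/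
private theorem lev24_slice_9 : ∀ k₂ k₃ : ZMod 24,
    (9 : ZMod 24).val ≤ k₂.val → (9 : ZMod 24).val ≤ k₃.val → (9 : ZMod 24).val ≤ (-(9 + k₂ + k₃)).val →
    ((lev 9 k₂ k₃).map ZMod.val).sum = 48 → (∀ a ∈ lev 9 k₂ k₃, a ≠ 0) →
    ((lev 9 k₂ k₃).map fun k ↦ (5 * k).val).sum = 48 →
    ((lev 9 k₂ k₃).map fun k ↦ (7 * k).val).sum = 48 →
    ((lev 9 k₂ k₃).map fun k ↦ (11 * k).val).sum = 48 →
    (∀ a ∈ lev 9 k₂ k₃, ∀ b ∈ (lev 9 k₂ k₃).erase a, a + b ≠ 0) →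
    lev 9 k₂ k₃ ∈ table24 := by
  decide +kernel

set_option maxHeartbeats 0 in
set_option maxRecDepth 16384 in
set_option synthInstance.maxHeartbeats 0 in
set_option synthInstance.maxSize 4096 in
/-- `level_twentyFour_pairfree`, slice `k₁ = 10` (kernel enumeration of the `24²` pairs). [folklore] -/
private theorem lev24_slice_10 : ∀ k₂ k₃ : ZMod 24,
    (10 : ZMod 24).val ≤ k₂.val → (10 : ZMod 24).val ≤ k₃.val → (10 : ZMod 24).val ≤ (-(10 + k₂ + k₃)).val →
    ((lev 10 k₂ k₃).map ZMod.val).sum = 48 → (∀ a ∈ lev 10 k₂ k₃, a ≠ 0) →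
    ((lev 10 k₂ k₃).map fun k ↦ (5 * k).val).sum = 48 →
    ((lev 10 k₂ k₃).map fun k ↦ (7 * k).val).sum = 48 →
    ((lev 10 k₂ k₃).map fun k ↦ (11 * k).val).sum = 48 →
    (∀ a ∈ lev 10 k₂ k₃, ∀ b ∈ (lev 10 k₂ k₃).erase a, a + b ≠ 0) →
    lev 10 k₂ k₃ ∈ table24 := by
  decide +kernel

set_option maxHeartbeats 0 in
set_option maxRecDepth 16384 in
set_option synthInstance.maxHeartbeats 0 in
set_option synthInstance.maxSize 4096 in
/-- `level_twentyFour_pairfree`, slice `k₁ = 11` (kernel enumeration of the `24²` pairs). [folklore] -/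
private theorem lev24_slice_11 : ∀ k₂ k₃ : ZMod 24,
    (11 : ZMod 24).val ≤ k₂.val → (11 : ZMod 24).val ≤ k₃.val → (11 : ZMod 24).val ≤ (-(11 + k₂ + k₃)).val →
    ((lev 11 k₂ k₃).map ZMod.val).sum = 48 → (∀ a ∈ lev 11 k₂ k₃, a ≠ 0) →
    ((lev 11 k₂ k₃).map fun k ↦ (5 * k).val).sum = 48 →
    ((lev 11 k₂ k₃).map fun k ↦ (7 * k).val).sum = 48 →
    ((lev 11 k₂ k₃).map fun k ↦ (11 * k).val).sum = 48 →
    (∀ a ∈ lev 11 k₂ k₃, ∀ b ∈ (lev 11 k₂ k₃).erase a, a + b ≠ 0) →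
    lev 11 k₂ k₃ ∈ table24 := by
  decide +kernel

set_option maxHeartbeats 0 in
set_option maxRecDepth 16384 in
set_option synthInstance.maxHeartbeats 0 in
set_option synthInstance.maxSize 4096 in
/-- `level_twentyFour_pairfree`, slice `k₁ = 12` (kernel enumeration of the `24²` pairs). [folklore] -/
private theorem lev24_slice_12 : ∀ k₂ k₃ : ZMod 24,
    (12 : ZMod 24).val ≤ k₂.val → (12 : ZMod 24).val ≤ k₃.val → (12 : ZMod 24).val ≤ (-(12 + k₂ + k₃)).val →
    ((lev 12 k₂ k₃).map ZMod.val).sum = 48 → (∀ a ∈ lev 12 k₂ k₃, a ≠ 0) →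
    ((lev 12 k₂ k₃).map fun k ↦ (5 * k).val).sum = 48 →
    ((lev 12 k₂ k₃).map fun k ↦ (7 * k).val).sum = 48 →
    ((lev 12 k₂ k₃).map fun k ↦ (11 * k).val).sum = 48 →
    (∀ a ∈ lev 12 k₂ k₃, ∀ b ∈ (lev 12 k₂ k₃).erase a, a + b ≠ 0) →
    lev 12 k₂ k₃ ∈ table24 := by
  decide +kernel

/-- The non-zero residues mod `24` of representative `≤ 12`. [folklore] -/
private theorem val_le_twelve_cases : ∀ k : ZMod 24, k.val ≤ 12 → k ≠ 0 → k = 1 ∨ k = 2 ∨ k = 3 ∨ k = 4 ∨ k = 5 ∨ k = 6 ∨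
    k = 7 ∨ k = 8 ∨ k = 9 ∨ k = 10 ∨ k = 11 ∨ k = 12 := by
  decide

/-- **The pair-free Hodge quadruples of level `24`** (kernel enumeration, by slices `k₁ = 1, …, 12` of a member of least
representative): a `4`-multiset of non-zero residues mod `24` with `Σ = 0`, satisfying the four norm equations `Σ⟨u k⟩ = 48`
(`u = 1, 5, 7, 11`; those at `−u` follow) and without a pair is one of the `68` multisets of `table24`.
[cite: MeyerNeutsch1981Fermatquadrupel, Tabelle 1 p. 54 (N = 12, 24)] [cite: Shioda1982PicardFermat, table p. 727 (m = 24, Δ(24) = 38)] -/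
private theorem level_twentyFour_pairfree (k₁ k₂ k₃ : ZMod 24) (h12 : k₁.val ≤ 12) (ho₂ : k₁.val ≤ k₂.val)
    (ho₃ : k₁.val ≤ k₃.val) (ho₄ : k₁.val ≤ (-(k₁ + k₂ + k₃)).val) (hsum : ((lev k₁ k₂ k₃).map ZMod.val).sum = 48)
    (hM0 : ∀ a ∈ lev k₁ k₂ k₃, a ≠ 0) (hn5 : ((lev k₁ k₂ k₃).map fun k ↦ (5 * k).val).sum = 48)
    (hn7 : ((lev k₁ k₂ k₃).map fun k ↦ (7 * k).val).sum = 48)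
    (hn11 : ((lev k₁ k₂ k₃).map fun k ↦ (11 * k).val).sum = 48)
    (hpf : ∀ a ∈ lev k₁ k₂ k₃, ∀ b ∈ (lev k₁ k₂ k₃).erase a, a + b ≠ 0) : lev k₁ k₂ k₃ ∈ table24 := by
  have h0 : k₁ ≠ 0 := hM0 k₁ (by simp [lev])
  rcases val_le_twelve_cases k₁ h12 h0 with rfl | rfl | rfl | rfl | rfl | rfl | rfl | rfl | rfl | rfl | rfl | rfl
  exacts [lev24_slice_1 k₂ k₃ ho₂ ho₃ ho₄ hsum hM0 hn5 hn7 hn11 hpf, lev24_slice_2 k₂ k₃ ho₂ ho₃ ho₄ hsum hM0 hn5 hn7 hn11 hpf,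
    lev24_slice_3 k₂ k₃ ho₂ ho₃ ho₄ hsum hM0 hn5 hn7 hn11 hpf, lev24_slice_4 k₂ k₃ ho₂ ho₃ ho₄ hsum hM0 hn5 hn7 hn11 hpf,
    lev24_slice_5 k₂ k₃ ho₂ ho₃ ho₄ hsum hM0 hn5 hn7 hn11 hpf, lev24_slice_6 k₂ k₃ ho₂ ho₃ ho₄ hsum hM0 hn5 hn7 hn11 hpf,
    lev24_slice_7 k₂ k₃ ho₂ ho₃ ho₄ hsum hM0 hn5 hn7 hn11 hpf, lev24_slice_8 k₂ k₃ ho₂ ho₃ ho₄ hsum hM0 hn5 hn7 hn11 hpf,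
    lev24_slice_9 k₂ k₃ ho₂ ho₃ ho₄ hsum hM0 hn5 hn7 hn11 hpf, lev24_slice_10 k₂ k₃ ho₂ ho₃ ho₄ hsum hM0 hn5 hn7 hn11 hpf,
    lev24_slice_11 k₂ k₃ ho₂ ho₃ ho₄ hsum hM0 hn5 hn7 hn11 hpf, lev24_slice_12 k₂ k₃ ho₂ ho₃ ho₄ hsum hM0 hn5 hn7 hn11 hpf]

set_option maxHeartbeats 0 in
set_option maxRecDepth 16384 in
set_option synthInstance.maxHeartbeats 0 in
set_option synthInstance.maxSize 4096 in
/-- **The `68` quadruples by type:** `{k, k + 12, −2k, 12}` (`α`), `{k, k + 12, 2k + 12, −4k}` (`β`), `{k, k + 8, k + 16, −3k}` (`γ`),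
or a unit multiple `u·r` of one of the `8` representatives `r` printed in Tabelle 1 at `N = 24` — `(1, 6, 19, 22)`, `(1, 8, 17, 22)`,
`(1, 8, 19, 20)`, `(1, 11, 17, 19)`, `(1, 12, 16, 19)`, `(1, 12, 17, 18)`, `(1, 13, 16, 18)`, `(2, 9, 16, 21)` — or of the doubles
`(2, 8, 18, 20)`, `(2, 12, 16, 18)` of the two printed at `N = 12` (orbit sizes `8, 8, 4, 2, 4, 4, 4, 4` and `4, 4`; Shioda's
`Δ(24) = 38`, table p. 727). Kernel check.
[cite: MeyerNeutsch1981Fermatquadrupel, Tabelle 1 p. 54 (N = 12, 24)] [cite: Shioda1982PicardFermat, table p. 727 (m = 12, 24)] -/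
private theorem table24_forms : ∀ M ∈ table24, ∃ k : ZMod 24, M = {k, k + 12, -(2 * k), 12} ∨
    M = {k, k + 12, 2 * k + 12, -(4 * k)} ∨ M = {k, k + 8, k + 16, -(3 * k)} ∨
    (k * k = 1 ∧ (M = {k, 6 * k, 19 * k, 22 * k} ∨ M = {k, 8 * k, 17 * k, 22 * k} ∨ M = {k, 8 * k, 19 * k, 20 * k} ∨
      M = {k, 11 * k, 17 * k, 19 * k} ∨ M = {k, 12 * k, 16 * k, 19 * k} ∨ M = {k, 12 * k, 17 * k, 18 * k} ∨
      M = {k, 13 * k, 16 * k, 18 * k} ∨ M = {2 * k, 9 * k, 16 * k, 21 * k} ∨ M = {2 * k, 8 * k, 18 * k, 20 * k} ∨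
      M = {2 * k, 12 * k, 16 * k, 18 * k})) := by
  decide +kernel

/-- The units of `ℤ/24` by representative. [folklore] -/
private theorem unit_val {k : ZMod 24} (hk : k * k = 1) :
    k.val = 1 ∨ k.val = 5 ∨ k.val = 7 ∨ k.val = 11 ∨ k.val = 13 ∨ k.val = 17 ∨ k.val = 19 ∨ k.val = 23 := by
  revert k; decide

/-- `φ k = pt(kπ, 0)`: the multiple `⟨k⟩·p` of `p` in `ℤ/24p`. [folklore] -/
private def phi (h : Nat.Coprime 24 p) (k : ZMod 24) : ZMod (24 * p) := pt h (k * π) 0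

/-- `φ` is additive. [folklore] -/
private theorem phi_add (h : Nat.Coprime 24 p) (a b : ZMod 24) : phi h (a + b) = phi h a + phi h b := by
  unfold phi; rw [add_mul, pt_add, add_zero]

/-- `φ(−a) = −φ a`. [folklore] -/
private theorem phi_neg (h : Nat.Coprime 24 p) (a : ZMod 24) : phi h (-a) = -phi h a := by
  unfold phi; rw [neg_pt, neg_zero, neg_mul]

/-- `φ(n a) = n φ a`. [folklore] -/
private theorem phi_natCast_mul (h : Nat.Coprime 24 p) (n : ℕ) (a : ZMod 24) :
    phi h (n * a) = (n : ZMod (24 * p)) * phi h a := by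
  unfold phi; rw [natCast_mul_pt, mul_zero, mul_assoc]

/-- `φ(2a) = 2φ a`. [folklore] -/
private theorem phi_two_mul (h : Nat.Coprime 24 p) (a : ZMod 24) : phi h (2 * a) = 2 * phi h a := by
  exact_mod_cast phi_natCast_mul h 2 a

/-- `φ(3a) = 3φ a`. [folklore] -/
private theorem phi_three_mul (h : Nat.Coprime 24 p) (a : ZMod 24) : phi h (3 * a) = 3 * phi h a := by
  exact_mod_cast phi_natCast_mul h 3 a

/-- `φ(n a) = n φ a` for a numeral `n`. [folklore] -/
private theorem phi_ofNat_mul (h : Nat.Coprime 24 p) (n : ℕ) [n.AtLeastTwo] (a : ZMod 24) :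
    phi h ((ofNat(n) : ZMod 24) * a) = (ofNat(n) : ZMod (24 * p)) * phi h a := by
  exact_mod_cast phi_natCast_mul h (OfNat.ofNat n) a

/-- `φ 12 = 12p`. [folklore] -/
private theorem phi_twelve (h : Nat.Coprime 24 p) [NeZero (24 * p)] (hp : p.Prime) (h5 : 5 ≤ p) : phi h 12 = K24 := by
  unfold phi; rw [(pi_facts hp h5).2.1, twelveP_eq_pt h hp h5]

/-- `φ 8 = 8p`. [folklore] -/
private theorem phi_eight (h : Nat.Coprime 24 p) [NeZero (24 * p)] : phi h 8 = D24 := by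
  unfold phi; rw [natCast_mul_P h 8, Nat.cast_ofNat]

/-- `φ 16 = 2·8p`. [folklore] -/
private theorem phi_sixteen (h : Nat.Coprime 24 p) [NeZero (24 * p)] : phi h 16 = 2 * D24 := by
  rw [show (16 : ZMod 24) = 2 * 8 by decide, phi_two_mul, phi_eight]

/-- `φ k = ⟨k⟩p`. [folklore] -/
private theorem phi_eq_natCast (h : Nat.Coprime 24 p) [NeZero (24 * p)] (k : ZMod 24) :
    phi h k = ((k.val * p : ℕ) : ZMod (24 * p)) := by
  unfold phi; rw [natCast_mul_P h, ZMod.natCast_zmod_val]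

/-- `⟨φ k⟩ = ⟨k⟩ p`. [folklore] -/
private theorem val_phi (h : Nat.Coprime 24 p) [NeZero (24 * p)] (hp : 0 < p) (k : ZMod 24) : (phi h k).val = k.val * p := by
  rw [phi_eq_natCast, ZMod.val_natCast, Nat.mod_eq_of_lt (by have := ZMod.val_lt k; nlinarith)]

/-- `ψ w = (w mod 12)·π`, an additive map `ℤ/24p → ℤ/24` inverting `φ` on the fibre `0`. [folklore] -/
private def psi (h : Nat.Coprime 24 p) : ZMod (24 * p) →+ ZMod 24 where
  toFun w := (crt h w).1 * π
  map_zero' := by simp only [_root_.map_zero, Prod.fst_zero, zero_mul]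
  map_add' a b := by simp only [_root_.map_add, Prod.fst_add, add_mul]

/-- Unfolding `ψ`. [folklore] -/
private theorem psi_apply (h : Nat.Coprime 24 p) (w : ZMod (24 * p)) : psi h w = (crt h w).1 * π := rfl

/-- `φ(ψ w) = w` on the fibre `0`. [folklore] -/
private theorem phi_psi (h : Nat.Coprime 24 p) [NeZero (24 * p)] (hp : p.Prime) (h5 : 5 ≤ p) {w : ZMod (24 * p)}
    (hw : (crt h w).2 = 0) : phi h (psi h w) = w := by
  rw [psi_apply, phi, mul_assoc, (pi_facts hp h5).1, mul_one]
  conv_rhs => rw [← pt_crt h w, hw]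

/-- On the fibre `0`, `ψ w = 0` forces `w = 0`. [folklore] -/
private theorem eq_zero_of_psi (h : Nat.Coprime 24 p) [NeZero (24 * p)] (hp : p.Prime) (h5 : 5 ≤ p) {w : ZMod (24 * p)}
    (hw : (crt h w).2 = 0) (h0 : psi h w = 0) : w = 0 := by
  rw [← phi_psi h hp h5 hw, h0, phi, zero_mul, pt_zero]

/-- **All members in the fibre `0`** (multiples of `p`): `s = φ(M)` for a pair-free Hodge quadruple `M` of level `24` (the norm
equation of `s` at the unit `pt(u, 1)` is the norm equation of `M` at `u`), read off from `level_twentyFour_pairfree` and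
`table24_forms`. [cite: Shioda1982PicardFermat, §2 p. 726 (𝔍²ₘ(d) ≅ 𝔍²_{m/d}(1)) and table p. 727 (m = 12, 24)]
[cite: MeyerNeutsch1981Fermatquadrupel, Tabelle 1 p. 54 (N = 12, 24)] -/
private theorem fibre_zero (h : Nat.Coprime 24 p) [NeZero (24 * p)] (hp : p.Prime) (h17 : 17 ≤ p)
    {s : Multiset (ZMod (24 * p))} (hs : IsHodgeMultiset s) (hcard : Multiset.card s = 4)
    (hind : ∀ a ∈ s, ∀ b ∈ s.erase a, a + b ≠ 0) (h0 : ∀ w ∈ s, (crt h w).2 = 0) :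
    ∃ x : ZMod (24 * p), s = {x, x + K24, -(2 * x), K24} ∨ s = {x, x + K24, 2 * x + K24, -(4 * x)} ∨
      s = {x, x + D24, x + 2 * D24, -(3 * x)} ∨
      ((∃ t : ℕ, (t = 1 ∨ t = 5 ∨ t = 7 ∨ t = 11 ∨ t = 13 ∨ t = 17 ∨ t = 19 ∨ t = 23) ∧ x = ((t * p : ℕ) : ZMod (24 * p))) ∧
        (s = {x, 6 * x, 19 * x, 22 * x} ∨ s = {x, 8 * x, 17 * x, 22 * x} ∨ s = {x, 8 * x, 19 * x, 20 * x} ∨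
          s = {x, 11 * x, 17 * x, 19 * x} ∨ s = {x, 12 * x, 16 * x, 19 * x} ∨ s = {x, 12 * x, 17 * x, 18 * x} ∨
          s = {x, 13 * x, 16 * x, 18 * x} ∨ s = {2 * x, 9 * x, 16 * x, 21 * x} ∨ s = {2 * x, 8 * x, 18 * x, 20 * x} ∨
          s = {2 * x, 12 * x, 16 * x, 18 * x})) := by
  classical
  have h5 : 5 ≤ p := by omega
  have hp0 := hp.pos
  set M := s.map (psi h) with hM
  have hsM : s = M.map (phi h) := by
    rw [hM, Multiset.map_map]
    conv_lhs => rw [← Multiset.map_id s]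
    refine Multiset.map_congr rfl fun w hw ↦ ?_
    simp only [Function.comp_apply, id]
    exact (phi_psi h hp h5 (h0 w hw)).symm
  have hcM : Multiset.card M = 4 := by rw [hM, Multiset.card_map, hcard]
  -- (i) non-zero
  have hM0 : ∀ a ∈ M, a ≠ 0 := by
    intro a ha ha0
    rw [hM] at ha
    obtain ⟨w, hw, rfl⟩ := Multiset.mem_map.mp ha
    exact hs.1.1 w hw (eq_zero_of_psi h hp h5 (h0 w hw) ha0)
  -- (ii) no pair
  have hMpf : ∀ a ∈ M, ∀ b ∈ M.erase a, a + b ≠ 0 := by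
    intro a ha b hb hab
    rw [hM] at ha
    obtain ⟨w, hw, rfl⟩ := Multiset.mem_map.mp ha
    rw [hM, ← Multiset.map_erase_of_mem _ _ hw] at hb
    obtain ⟨w', hw', rfl⟩ := Multiset.mem_map.mp hb
    have hw's : w' ∈ s := Multiset.mem_of_mem_erase hw'
    refine hind w hw w' hw' (eq_zero_of_psi h hp h5 ?_ ?_)
    · rw [_root_.map_add, Prod.snd_add, h0 w hw, h0 w' hw's, add_zero]
    · rw [_root_.map_add, hab]
  -- (iii) the norm equations at the units `pt(u, 1)`
  have hnormM : ∀ u : ZMod 24, u * u = 1 → (M.map fun k ↦ (u * k).val).sum = 48 := by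
    intro u hu
    obtain ⟨t, ht⟩ := isUnit_pt h hu
    have key := hs.2 t
    rw [hcard, hsM, Multiset.map_map] at key
    have e : (M.map ((fun x ↦ (t : ZMod (24 * p)) * x) ∘ phi h)) = M.map (fun k ↦ phi h (u * k)) := by
      refine Multiset.map_congr rfl fun k _ ↦ ?_
      simp only [Function.comp_apply, ht, phi]
      rw [pt_mul, one_mul, mul_assoc]
    rw [e, mNormSum, Multiset.map_map] at key
    have e2 : (M.map (ZMod.val ∘ fun k ↦ phi h (u * k))) = M.map (fun k ↦ (u * k).val * p) := by
      refine Multiset.map_congr rfl fun k _ ↦ ?_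
      simp only [Function.comp_apply, val_phi h hp0]
    rw [e2, Multiset.sum_map_mul_right] at key
    have : (M.map fun k ↦ (u * k).val).sum * p = 48 * p := by linarith
    exact Nat.eq_of_mul_eq_mul_right hp0 this
  -- (iv) enumerate `M` from a member of least representative and apply `level_twentyFour_pairfree`
  obtain ⟨k₀, hk₀⟩ := Multiset.card_pos_iff_exists_mem.mp (by omega : 0 < Multiset.card M)
  obtain ⟨k₁, hk₁', hmin⟩ := Finset.exists_min_image M.toFinset ZMod.val ⟨k₀, Multiset.mem_toFinset.mpr hk₀⟩
  have hk₁ : k₁ ∈ M := Multiset.mem_toFinset.mp hk₁'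
  have hmin' : ∀ a ∈ M, k₁.val ≤ a.val := fun a ha ↦ hmin a (Multiset.mem_toFinset.mpr ha)
  have hct : Multiset.card (M.erase k₁) = 3 := by rw [Multiset.card_erase_of_mem hk₁, hcM]; rfl
  obtain ⟨k₂, k₃, k₄, ht⟩ := Multiset.card_eq_three.mp hct
  have hMk : M = {k₁, k₂, k₃, k₄} := by rw [← Multiset.cons_erase hk₁, ht]; rfl
  have hsum : M.sum = 0 := by rw [hM, ← map_multiset_sum, hs.1.2, _root_.map_zero]
  have hk₄ : k₄ = -(k₁ + k₂ + k₃) := by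
    rw [hMk] at hsum
    simp only [Multiset.insert_eq_cons, Multiset.sum_cons, Multiset.sum_singleton] at hsum
    linear_combination hsum
  have hML : M = lev k₁ k₂ k₃ := by rw [hMk, hk₄]; rfl
  rw [hML] at hM0 hMpf hnormM hmin'
  have h1 := hnormM 1 (one_mul 1)
  simp only [one_mul] at h1
  have ho₂ : k₁.val ≤ k₂.val := hmin' k₂ (by simp [lev])
  have ho₃ : k₁.val ≤ k₃.val := hmin' k₃ (by simp [lev])
  have ho₄ : k₁.val ≤ (-(k₁ + k₂ + k₃)).val := hmin' _ (by simp [lev])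
  have h12 : k₁.val ≤ 12 := by
    have h1' := h1
    simp only [lev, Multiset.insert_eq_cons, Multiset.map_cons, Multiset.map_singleton, Multiset.sum_cons,
      Multiset.sum_singleton] at h1'
    omega
  have hmem := level_twentyFour_pairfree k₁ k₂ k₃ h12 ho₂ ho₃ ho₄ h1 hM0 (hnormM 5 (by decide)) (hnormM 7 (by decide))
    (hnormM 11 (by decide)) hMpf
  obtain ⟨k, hk⟩ := table24_forms _ hmem
  refine ⟨phi h k, ?_⟩
  rw [hsM, hML]
  rcases hk with e | e | e | ⟨hkk, e⟩
  · left
    rw [e]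
    simp only [Multiset.insert_eq_cons, Multiset.map_cons, Multiset.map_singleton, phi_add, phi_neg, phi_ofNat_mul,
      phi_twelve h hp h5]
  · right; left
    rw [e]
    simp only [Multiset.insert_eq_cons, Multiset.map_cons, Multiset.map_singleton, phi_add, phi_neg, phi_ofNat_mul,
      phi_twelve h hp h5]
  · right; right; left
    rw [e]
    simp only [Multiset.insert_eq_cons, Multiset.map_cons, Multiset.map_singleton, phi_add, phi_neg, phi_ofNat_mul,
      phi_eight, phi_sixteen]
  · right; right; right
    refine ⟨⟨k.val, unit_val hkk, phi_eq_natCast h k⟩, ?_⟩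
    rcases e with e | e | e | e | e | e | e | e | e | e <;> rw [e] <;>
      simp only [Multiset.insert_eq_cons, Multiset.map_cons, Multiset.map_singleton, phi_ofNat_mul, true_or, or_true]


/-! ### Case II: two odd members -/

/-- **Two odd members, one off the fibre `0`:** the odd members are `x, x + 12p` (`two_odd_core`), `T(s) = 2·{x̄, ẑ, ŵ}` and
`{x̄, ẑ, ŵ, 6p}` is a Hodge quadruple of level `12p`; it has a pair exactly when `s = α_x`, and otherwise it is the level-`12p`
`α_y` with `y ∈ {x̄, x̄ + 6p}` (the level-`12p` `β_y`, `γ_y` and the exceptional quadruples `⊂ pℤ/12p` cannot contain `6p` next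
to the class `x̄ ∉ pℤ/12p`), i.e. `s = β_x`.
[cite: Shioda1982PicardFermat, Prop. 4 (Q′) p. 729] [cite: AokiShioda1983, §2 Theorem (𝔅²ₘ) (ii) a), b), p. 3] -/
private theorem case_two_odd (h : Nat.Coprime 24 p) [NeZero (24 * p)] (hp : p.Prime) (h17 : 17 ≤ p)
    {s : Multiset (ZMod (24 * p))} (hs : IsHodgeMultiset s) (hpf : ∀ a ∈ s, ∀ b ∈ s.erase a, a + b ≠ 0)
    {x y z w : ZMod (24 * p)} (hsx : s = {x, y, z, w}) (hx1 : x.val % 2 = 1) (hy1 : y.val % 2 = 1)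
    (hz0 : z.val % 2 = 0) (hw0 : w.val % 2 = 0) (hxc : (crt h x).2 ≠ 0) :
    s = {x, x + K24, -(2 * x), K24} ∨ s = {x, x + K24, 2 * x + K24, -(4 * x)} := by
  classical
  haveI := Fact.mk hp
  have hp0 := hp.pos
  have hp2 : p % 2 = 1 := Nat.odd_iff.mp (hp.odd_of_ne_two (by omega))
  have h5 : 5 ≤ p := by omega
  haveI : NeZero (12 * p) := ⟨by omega⟩
  have hnm : 12 * p ∣ 24 * p := ⟨2, by ring⟩
  have hx : x ∈ s := by rw [hsx]; simp
  have hy : y ∈ s.erase x := by rw [hsx, Multiset.insert_eq_cons, Multiset.erase_cons_head]; simp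
  have hz : z ∈ s := by rw [hsx]; simp
  have hw : w ∈ s := by rw [hsx]; simp
  have hz_ne : z ≠ 0 := hs.1.1 z hz
  have hw_ne : w ≠ 0 := hs.1.1 w hw
  -- Step 1: `y = x + 12p` by the relations `ψ`, `χ₈`, `χ₋₈` on the odd part `{crt x, crt y}`
  have hRel := relsOdd_of_isHodgeMultiset h hp h5 hs
  have hsw : s = {z, w, x, y} := by
    rw [hsx]; simp only [Multiset.insert_eq_cons, ← Multiset.singleton_add]; abel
  rw [hsw] at hRel
  simp only [Multiset.insert_eq_cons, Multiset.map_cons, Multiset.map_singleton] at hRel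
  have hO := (hRel.of_cons_even (by rw [fst_val_mod_two]; exact hz0)).of_cons_even
    (by rw [fst_val_mod_two]; exact hw0)
  have hex : (crt h x).1.val % 2 = 1 := by rw [fst_val_mod_two]; exact hx1
  have hey : (crt h y).1.val % 2 = 1 := by rw [fst_val_mod_two]; exact hy1
  have hyx : (((crt h y).1, (crt h y).2) : ZMod 24 × ZMod p) ≠ -((crt h x).1, (crt h x).2) := by
    rw [Prod.mk.eta, Prod.mk.eta, ← _root_.map_neg, (crt h).injective.ne_iff]
    intro e; exact hpf x hx y hy (by rw [e, add_neg_cancel])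
  obtain ⟨he', hc'⟩ := two_odd_core hp h17 hO (e := (crt h x).1) (c := (crt h x).2) (e' := (crt h y).1)
    (c' := (crt h y).2) (by simp only [Prod.mk.eta, Multiset.insert_eq_cons]) hex hey hxc hyx
  have hyK : y = x + K24 := by
    have e1 : pt h ((crt h x).1 + 12) (crt h x).2 = pt h (crt h x).1 (crt h x).2 + pt h 12 0 := by rw [pt_add, add_zero]
    rw [← pt_crt h y, he', hc', e1, pt_crt, twelveP_eq_pt h hp h5]
  subst hyK
  -- Step 2: the transfer `T(s) = 2·{x̄, ẑ, ŵ}`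
  have hxK1 : (x + K24).val % 2 = 1 := by
    rcases val_add_K hp0 x with ⟨e, -⟩ | ⟨e, -⟩ <;> omega
  have hsplit : s = ({x, x + K24} : Multiset (ZMod (24 * p))) + {z, w} := by rw [hsx, pair_add_pair]
  have hT := isHodgeMultiset_transfer_twentyFourPrime hp0 hnm (so := {x, x + K24}) (se := {z, w})
    (by intro v hv; simp only [Multiset.insert_eq_cons, Multiset.mem_cons, Multiset.mem_singleton] at hv
        rcases hv with rfl | rfl <;> assumption)
    (by intro v hv; simp only [Multiset.insert_eq_cons, Multiset.mem_cons, Multiset.mem_singleton] at hv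
        rcases hv with rfl | rfl <;> assumption)
    (hsplit ▸ hs)
  have hRK : ZMod.castHom hnm (ZMod (12 * p)) (x + K24) = ZMod.castHom hnm (ZMod (12 * p)) x := by
    rw [_root_.map_add, map_natCast, ZMod.natCast_self, add_zero]
  simp only [Multiset.insert_eq_cons, Multiset.map_cons, Multiset.map_singleton, hRK] at hT
  set xb := ZMod.castHom hnm (ZMod (12 * p)) x with hxb
  set zt := ZMod.castHom hnm (ZMod (12 * p)) (half z) with hzt
  set wt := ZMod.castHom hnm (ZMod (12 * p)) (half w) with hwt
  have hxb0 : xb ≠ 0 := castHom_ne_zero_of_odd hnm hx1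
  have hzt0 : zt ≠ 0 := castHom_half_ne_zero hnm hz_ne hz0
  have hwt0 : wt ≠ 0 := castHom_half_ne_zero hnm hw_ne hw0
  have hK60 : K12 ≠ 0 := K12_ne_zero hp0
  have hxodd : xb.val % 2 = 1 := by rw [hxb, val_castHom_mod_two hnm, hx1]
  -- `x̄ ∉ pℤ/12p`
  set ρ := ZMod.castHom (dvd_mul_left p 12) (ZMod p) with hρ
  have hρR : ∀ v : ZMod (24 * p), ρ (ZMod.castHom hnm (ZMod (12 * p)) v) = (crt h v).2 := by
    intro v
    rw [crt_snd, hρ, ZMod.castHom_apply, ZMod.cast_eq_val, val_castHom, ZMod.natCast_eq_natCast_iff',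
      Nat.mod_mod_of_dvd _ (dvd_mul_left p 12)]
  have hρK : ρ K12 = 0 := by rw [map_natCast, Nat.cast_mul, ZMod.natCast_self, mul_zero]
  have hρD : ρ D12 = 0 := by rw [map_natCast, Nat.cast_mul, ZMod.natCast_self, mul_zero]
  have hxbρ : ρ xb ≠ 0 := by rw [hxb, hρR]; exact hxc
  have hxbK : xb ≠ K12 := fun e ↦ hxbρ (by rw [e, hρK])
  -- norms and sum of `{x̄, ẑ, ŵ}`
  obtain ⟨⟨-, hTsum⟩, hTnorm⟩ := hT
  have hA : ∀ v : (ZMod (12 * p))ˣ,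
      ((v : ZMod (12 * p)) * xb).val + ((v : ZMod (12 * p)) * zt).val + ((v : ZMod (12 * p)) * wt).val = 18 * p := by
    intro v
    have e := hTnorm v
    simp only [Multiset.map_add, Multiset.map_cons, Multiset.map_singleton, mNormSum_add, mNormSum_cons,
      Multiset.card_add, Multiset.card_cons, Multiset.card_singleton] at e
    simp only [mNormSum, Multiset.map_singleton, Multiset.sum_singleton] at e
    omega
  have hsum3 : xb + zt + wt = K12 := by
    have h2 : (2 : ZMod (12 * p)) * (xb + zt + wt) = 0 := by
      simp only [Multiset.sum_add, Multiset.sum_cons, Multiset.sum_singleton] at hTsum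
      linear_combination hTsum
    rcases (two_mul_eq_zero_twelveP hp0).mp h2 with e | e
    · exfalso
      have h1 := hA 1
      simp only [Units.val_one, one_mul] at h1
      have hcast : (((xb.val + zt.val + wt.val : ℕ)) : ZMod (12 * p)) = xb + zt + wt := by
        push_cast; simp only [ZMod.natCast_zmod_val]
      rw [h1, e, show ((18 * p : ℕ) : ZMod (12 * p)) = K12 + ((12 * p : ℕ) : ZMod (12 * p)) by push_cast; ring,
        ZMod.natCast_self, add_zero] at hcast
      exact hK60 hcast
    · exact e
  -- `τ = {x̄, ẑ, ŵ, 6p}` is a Hodge quadruple of level `12p`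
  have hτ : IsHodgeMultiset ({xb, zt, wt, K12} : Multiset (ZMod (12 * p))) := by
    refine ⟨⟨?_, ?_⟩, fun v ↦ ?_⟩
    · intro a ha
      simp only [Multiset.insert_eq_cons, Multiset.mem_cons, Multiset.mem_singleton] at ha
      rcases ha with rfl | rfl | rfl | rfl <;> assumption
    · simp only [Multiset.insert_eq_cons, Multiset.sum_cons, Multiset.sum_singleton]
      linear_combination hsum3 - neg_K12 (p := p)
    · have hvK : ((v : ZMod (12 * p)) * K12).val = 6 * p := by
        rw [unit_mul_natCast_half (m := 12 * p) (K := 6 * p) (by ring) v, val_K12 hp0]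
      simp only [Multiset.insert_eq_cons, Multiset.map_cons, Multiset.map_singleton, mNormSum_cons, Multiset.card_cons,
        Multiset.card_singleton]
      simp only [mNormSum, Multiset.map_singleton, Multiset.sum_singleton, hvK]
      have := hA v
      omega
  -- the doubles
  have hdx : dbl xb = 2 * x := dbl_castHom hnm x
  have hdz : dbl zt = z := dbl_castHom_half hnm hz0
  have hdw : dbl wt = w := dbl_castHom_half hnm hw0
  have hdK : dbl K12 = K24 := dbl_K12 hp0
  -- (i) `τ` has a pair: `s = α_x`
  by_cases h1 : xb + zt = 0
  · left
    have ezt : zt = -xb := by linear_combination h1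
    have ewt : wt = K12 := by linear_combination hsum3 - h1
    have ez : z = -(2 * x) := by rw [← hdz, ezt, dbl_neg, hdx]
    have ew : w = K24 := by rw [← hdw, ewt, hdK]
    rw [hsx, ez, ew]
  by_cases h2 : xb + wt = 0
  · left
    have ewt : wt = -xb := by linear_combination h2
    have ezt : zt = K12 := by linear_combination hsum3 - h2
    have ez : z = K24 := by rw [← hdz, ezt, hdK]
    have ew : w = -(2 * x) := by rw [← hdw, ewt, dbl_neg, hdx]
    rw [hsx, ez, ew]
    simp only [Multiset.insert_eq_cons, ← Multiset.singleton_add]; abel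
  -- (ii) `τ` is pair-free: `τ = A_y`, `y ∈ {x̄, x̄ + 6p}`, and `s = β_x`
  right
  have h3 : zt + wt ≠ 0 := fun e ↦ hxbK (by linear_combination hsum3 - e)
  have h4 : zt ≠ K12 := fun e ↦ h2 (by linear_combination hsum3 - e)
  have h5' : wt ≠ K12 := fun e ↦ h1 (by linear_combination hsum3 - e)
  have hτpf : ∀ a ∈ ({xb, zt, wt, K12} : Multiset (ZMod (12 * p))), ∀ b ∈ (({xb, zt, wt, K12} : Multiset (ZMod (12 * p)))).erase a,
      a + b ≠ 0 :=
    pairfree_quad h1 h2 (fun e ↦ hxbK (by linear_combination e + neg_K12 (p := p))) h3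
      (fun e ↦ h4 (by linear_combination e + neg_K12 (p := p))) (fun e ↦ h5' (by linear_combination e + neg_K12 (p := p)))
  have hc4 : Multiset.card ({xb, zt, wt, K12} : Multiset (ZMod (12 * p))) = 4 := rfl
  obtain ⟨y, hy⟩ := classify_hodgeMultiset_twelvePrime hp h17 hτ hc4 hτpf
  rcases hy with e | e | e | ⟨⟨t, -, rfl⟩, e⟩
  · -- type `α` (level `12p`): cancel `6p`
    have e3 : ({xb, zt, wt} : Multiset (ZMod (12 * p))) = {y, y + K12, -(2 * y)} := by
      have e' : ({xb, zt, wt} : Multiset (ZMod (12 * p))) + {K12} = {y, y + K12, -(2 * y)} + {K12} := by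
        simpa only [Multiset.insert_eq_cons, Multiset.cons_add, Multiset.singleton_add] using e
      exact add_right_cancel e'
    have hxmem3 : xb ∈ ({y, y + K12, -(2 * y)} : Multiset (ZMod (12 * p))) := by rw [← e3]; simp
    simp only [Multiset.insert_eq_cons, Multiset.mem_cons, Multiset.mem_singleton] at hxmem3
    obtain ⟨y', e4, hy'⟩ : ∃ y' : ZMod (12 * p),
        ({xb, zt, wt} : Multiset (ZMod (12 * p))) = {y', y' + K12, -(2 * y')} ∧ xb = y' := by
      rcases hxmem3 with e4 | e4 | e4
      · exact ⟨y, e3, e4⟩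
      · refine ⟨y + K12, ?_, e4⟩
        rw [e3, show y + K12 + K12 = y by linear_combination -(neg_K12 (p := p)),
          show -(2 * (y + K12)) = -(2 * y) by linear_combination neg_K12 (p := p)]
        simp only [Multiset.insert_eq_cons, ← Multiset.singleton_add]; abel
      · exfalso
        rw [e4, val_neg_mod_two_twelve, val_two_mul_mod_two_twelve] at hxodd
        omega
    rw [← hy'] at e4
    have e5 : ({zt, wt} : Multiset (ZMod (12 * p))) = {xb + K12, -(2 * xb)} := by
      simp only [Multiset.insert_eq_cons] at e4
      exact (Multiset.cons_inj_right _).mp e4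
    have e6 := congrArg (Multiset.map dbl) e5
    simp only [Multiset.insert_eq_cons, Multiset.map_cons, Multiset.map_singleton, hdz, hdw, dbl_add, dbl_neg,
      dbl_two_mul, hdx, hdK] at e6
    rw [hsx, show -(4 * x) = -(2 * (2 * x)) by ring]
    simp only [Multiset.insert_eq_cons]
    rw [e6]
  · -- type `β` (level `12p`): `6p ∈ β_y` is impossible
    exfalso
    have hmem : K12 ∈ ({y, y + K12, 2 * y + K12, -(4 * y)} : Multiset (ZMod (12 * p))) := by rw [← e]; simp
    have hne : ∀ a ∈ ({y, y + K12, 2 * y + K12, -(4 * y)} : Multiset (ZMod (12 * p))), a ≠ 0 := by rw [← e]; exact hτ.1.1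
    have hy0 : y ≠ 0 := hne y (by simp)
    have hyK0 : y + K12 ≠ 0 := hne (y + K12) (by simp)
    simp only [Multiset.insert_eq_cons, Multiset.mem_cons, Multiset.mem_singleton] at hmem
    rcases hmem with e' | e' | e' | e'
    · exact hyK0 (by rw [← e']; linear_combination -(neg_K12 (p := p)))
    · exact hy0 (by linear_combination -e')
    · have h2y : (2 : ZMod (12 * p)) * y = 0 := by linear_combination -e'
      rcases (two_mul_eq_zero_twelveP hp0).mp h2y with e'' | e''
      · exact hy0 e''
      · exact hyK0 (by rw [e'']; linear_combination -(neg_K12 (p := p)))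
    · -- `4y = 6p` is impossible modulo `4` (`p` odd)
      have e4 : (4 : ZMod (12 * p)) * y = K12 := by linear_combination e' + neg_K12 (p := p)
      have h4 := congrArg (ZMod.castHom (⟨3 * p, by ring⟩ : 4 ∣ 12 * p) (ZMod 4)) e4
      rw [_root_.map_mul, map_ofNat, map_natCast, show (4 : ZMod 4) = 0 from rfl, zero_mul, eq_comm,
        ZMod.natCast_eq_zero_iff] at h4
      omega
  · -- type `γ` (level `12p`): `6p ∈ γ_y` forces `y ∈ pℤ/12p`, but `x̄ ∈ γ_y` is not in `pℤ/12p`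
    exfalso
    have hmem : K12 ∈ ({y, y + D12, y + 2 * D12, -(3 * y)} : Multiset (ZMod (12 * p))) := by rw [← e]; simp
    have hxmem' : xb ∈ ({y, y + D12, y + 2 * D12, -(3 * y)} : Multiset (ZMod (12 * p))) := by rw [← e]; simp
    have hρy : ρ y = 0 := by
      simp only [Multiset.insert_eq_cons, Multiset.mem_cons, Multiset.mem_singleton] at hmem
      rcases hmem with e' | e' | e' | e'
      · rw [← e', hρK]
      · have := congrArg ρ e'
        rw [hρK, _root_.map_add, hρD, add_zero] at this
        exact this.symm
      · have := congrArg ρ e'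
        rw [hρK, _root_.map_add, _root_.map_mul, map_ofNat, hρD, mul_zero, add_zero] at this
        exact this.symm
      · have := congrArg ρ e'
        rw [hρK, _root_.map_neg, _root_.map_mul, map_ofNat] at this
        have h' : (3 : ZMod p) * ρ y = 0 := by linear_combination this
        by_contra hy
        have h3y : (3 : ZMod p) * ρ y ≠ 0 := by exact_mod_cast smooth_mul_ne_zero hp h17 hy (n := 3) (by norm_num)
        exact h3y h'
    apply hxbρ
    simp only [Multiset.insert_eq_cons, Multiset.mem_cons, Multiset.mem_singleton] at hxmem'
    rcases hxmem' with e' | e' | e' | e' <;> rw [e'] <;>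
      simp only [_root_.map_add, _root_.map_neg, _root_.map_mul, map_ofNat, hρy, hρD, mul_zero, add_zero, neg_zero]
  · -- exceptional (level `12p`): every member lies in `pℤ/12p`, but `x̄` does not
    exfalso
    have hρy : ρ ((((t * p : ℕ)) : ZMod (12 * p))) = 0 := by
      rw [map_natCast, Nat.cast_mul, ZMod.natCast_self, mul_zero]
    have hxmem' : xb ∈ ({xb, zt, wt, K12} : Multiset (ZMod (12 * p))) := by simp
    apply hxbρ
    rcases e with e | e <;> rw [e] at hxmem' <;>
      simp only [Multiset.insert_eq_cons, Multiset.mem_cons, Multiset.mem_singleton] at hxmem' <;>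
      rcases hxmem' with e' | e' | e' | e' <;> rw [e'] <;>
      simp only [_root_.map_mul, map_ofNat, hρy, mul_zero]

/-- **Two odd members, both in the fibre `0`:** impossible. The even members are then `pt(f, c)`, `pt(f′, −c)` with
`f, f′ ∈ {0, 12}` (the relations `Γ(χ₄)`, `Γ(χ₃)`: `even_pair`), so the unit `t = pt(1, −1)` fixes the odd members and negates
the even ones; comparing the norm equations at `1` and `t` gives `⟨x⟩ + ⟨y⟩ = 24p`, i.e. `y = −x`. [cite: Aoki1983, Prop. 2.2] -/
private theorem case_two_odd_fibre (h : Nat.Coprime 24 p) [NeZero (24 * p)] (hp : p.Prime) (h17 : 17 ≤ p)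
    {s : Multiset (ZMod (24 * p))} (hs : IsHodgeMultiset s) (hpf : ∀ a ∈ s, ∀ b ∈ s.erase a, a + b ≠ 0)
    {x y z w : ZMod (24 * p)} (hsx : s = {x, y, z, w})
    (hz0 : z.val % 2 = 0) (hw0 : w.val % 2 = 0) (hxc : (crt h x).2 = 0) (hyc : (crt h y).2 = 0)
    (hzc : (crt h z).2 ≠ 0) : False := by
  classical
  haveI := Fact.mk hp
  have h5 : 5 ≤ p := by omega
  have h24 : (24 : ZMod p) ≠ 0 := by exact_mod_cast natCast_ne_zero_smooth hp h17 (n := 24) (by norm_num)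
  have hx : x ∈ s := by rw [hsx]; simp
  have hy : y ∈ s.erase x := by rw [hsx, Multiset.insert_eq_cons, Multiset.erase_cons_head]; simp
  have hz : z ∈ s := by rw [hsx]; simp
  have hw : w ∈ s := by rw [hsx]; simp
  have hwz : w ∈ s.erase z := by
    rw [hsx, show ({x, y, z, w} : Multiset (ZMod (24 * p))) = {z, x, y, w} by
      simp only [Multiset.insert_eq_cons, ← Multiset.singleton_add]; abel, Multiset.insert_eq_cons,
      Multiset.erase_cons_head]
    simp
  have hz_ne : z ≠ 0 := hs.1.1 z hz
  have hw_ne : w ≠ 0 := hs.1.1 w hw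
  -- coordinates
  obtain ⟨e₁, rfl⟩ : ∃ e₁, x = pt h e₁ 0 := ⟨(crt h x).1, by conv_lhs => rw [← pt_crt h x, hxc]⟩
  obtain ⟨e₂, rfl⟩ : ∃ e₂, y = pt h e₂ 0 := ⟨(crt h y).1, by conv_lhs => rw [← pt_crt h y, hyc]⟩
  obtain ⟨f, c, rfl⟩ : ∃ f c, z = pt h f c := ⟨_, _, (pt_crt h z).symm⟩
  obtain ⟨f', c', rfl⟩ : ∃ f' c', w = pt h f' c' := ⟨_, _, (pt_crt h w).symm⟩
  simp only [crt_pt] at hzc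
  have hc' : c' = -c := by
    have := congrArg (fun v ↦ (crt h v).2) hs.1.2
    simp only [hsx, Multiset.insert_eq_cons, Multiset.sum_cons, Multiset.sum_singleton, _root_.map_add, Prod.snd_add, crt_pt,
      _root_.map_zero, Prod.snd_zero] at this
    linear_combination this
  subst hc'
  have hf : f.val % 2 = 0 := by rwa [val_pt_mod_two] at hz0
  have hf' : f'.val % 2 = 0 := by rwa [val_pt_mod_two] at hw0
  -- `c = 24a`; the relations `Γ(χ₄)`, `Γ(χ₃)`: `f, f′ ∈ {0, 12}`
  obtain ⟨a, rfl⟩ : ∃ a, c = 24 * a := ⟨(24 : ZMod p)⁻¹ * c, by rw [← mul_assoc, mul_inv_cancel₀ h24, one_mul]⟩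
  have ha : a ≠ 0 := fun h0 ↦ hzc (by rw [h0, mul_zero])
  have hRel := relsEven_of_isHodgeMultiset h hp h5 hs
  rw [hsx] at hRel
  simp only [Multiset.insert_eq_cons, Multiset.map_cons, Multiset.map_singleton, crt_pt] at hRel
  have hzw : ((f', -(24 * a)) : ZMod 24 × ZMod p) ≠ -(f, 24 * a) := by
    intro e
    apply hpf _ hz _ hwz
    rw [Prod.neg_mk, Prod.mk.injEq] at e
    rw [e.1, ← neg_pt, add_neg_cancel]
  obtain ⟨hf6, hf'6⟩ := even_pair hp h17 hRel rfl hf hf' ha hzw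
  -- the unit `t = pt(1, −1)` and the two norm equations
  have hu : IsUnit (pt h 1 (-1)) :=
    IsUnit.of_mul_eq_one (pt h 1 (-1)) (by rw [pt_mul, mul_one, neg_mul_neg, mul_one, pt_one])
  obtain ⟨t, ht⟩ := hu
  have n1 := hs.2 1
  have nt := hs.2 t
  rw [hsx] at n1 nt
  simp only [Units.val_one, one_mul, Multiset.map_id', Multiset.insert_eq_cons, Multiset.map_cons,
    Multiset.map_singleton, Multiset.card_cons, Multiset.card_singleton, mNormSum_cons, ht, pt_mul, mul_zero,
    neg_one_mul, neg_zero, neg_neg] at n1 nt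
  simp only [mNormSum, Multiset.map_singleton, Multiset.sum_singleton] at n1 nt
  have hnegf : -f = f := by rcases hf6 with rfl | rfl <;> decide
  have hnegf' : -f' = f' := by rcases hf'6 with rfl | rfl <;> decide
  have ez : pt h f (-(24 * a)) = -(pt h f (24 * a)) := by rw [neg_pt, hnegf]
  have ew : pt h f' (24 * a) = -(pt h f' (-(24 * a))) := by rw [neg_pt, hnegf', neg_neg]
  rw [ez, ew, ZMod.neg_val, if_neg hz_ne, ZMod.neg_val, if_neg hw_ne] at nt
  have hlt1 := ZMod.val_lt (pt h f (24 * a))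
  have hlt2 := ZMod.val_lt (pt h f' (-(24 * a)))
  have hxy : (pt h e₁ 0).val + (pt h e₂ 0).val = 24 * p := by omega
  apply hpf _ hx _ hy
  have : (((pt h e₁ 0).val + (pt h e₂ 0).val : ℕ) : ZMod (24 * p)) = 0 := by rw [hxy]; exact ZMod.natCast_self _
  rw [Nat.cast_add, ZMod.natCast_zmod_val, ZMod.natCast_zmod_val] at this
  exact this

/-! ### Case III: four odd members -/

/-- **All members odd, one off the fibre `0`:** `s̄ = s mod 12p` is a Hodge quadruple of level `12p` with odd members. If `s̄` has
no pair it is the level-`12p` `γ_y` (the level-`12p` types `α`, `β` and the exceptional quadruples have an even member) and `s` is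
one of the four lifts of `γ_y` with `Σ = 0`: `γ_u` itself, or a `δ`-quadruple `{v, v + 4p, v − 4p, −3v}`, which violates the
relations `ψ`, `χ₈` (`delta_not_rels`); if `s̄` has a pair then `s = {u₁, 12p − u₁, u₃, 12p − u₃}`, which violates `ψ`, `χ₈`, `χ₋₈`
(`halfpair_odd`).
[cite: Shioda1982PicardFermat, Prop. 4 (Q′) p. 729] [cite: AokiShioda1983, §2 Theorem (𝔅²ₘ) (ii) c), p. 3] [cite: Aoki1983, Prop. 2.2] -/
private theorem case_all_odd (h : Nat.Coprime 24 p) [NeZero (24 * p)] (hp : p.Prime) (h17 : 17 ≤ p)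
    {s : Multiset (ZMod (24 * p))} (hs : IsHodgeMultiset s) (hcard : Multiset.card s = 4)
    (hpf : ∀ a ∈ s, ∀ b ∈ s.erase a, a + b ≠ 0) (hodd : ∀ w ∈ s, w.val % 2 = 1) (hex : ∃ w ∈ s, (crt h w).2 ≠ 0) :
    ∃ x : ZMod (24 * p), s = {x, x + D24, x + 2 * D24, -(3 * x)} := by
  classical
  haveI := Fact.mk hp
  have hp0 := hp.pos
  have h5 : 5 ≤ p := by omega
  haveI : NeZero (12 * p) := ⟨by omega⟩
  have hnm : 12 * p ∣ 24 * p := ⟨2, by ring⟩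
  have hT := isHodgeMultiset_transfer_twentyFourPrime hp0 hnm (so := s) (se := 0) hodd (by simp) (by simpa using hs)
  simp only [Multiset.map_zero, add_zero] at hT
  have hc4 : Multiset.card (s.map (ZMod.castHom hnm (ZMod (12 * p)))) = 4 := by rw [Multiset.card_map, hcard]
  have hRel := relsOdd_of_isHodgeMultiset h hp h5 hs
  have hRodd : ∀ a ∈ s.map (ZMod.castHom hnm (ZMod (12 * p))), a.val % 2 = 1 := by
    intro a ha
    obtain ⟨w, hw, rfl⟩ := Multiset.mem_map.mp ha
    rw [val_castHom_mod_two hnm, hodd w hw]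
  have P24 : (24 : ZMod (24 * p)) * (p : ZMod (24 * p)) = 0 := by
    have : (((24 * p : ℕ)) : ZMod (24 * p)) = 0 := ZMod.natCast_self _
    push_cast at this; exact this
  have hE : E24 = 4 * (p : ZMod (24 * p)) := by push_cast; ring
  have hD : D24 = 8 * (p : ZMod (24 * p)) := by push_cast; ring
  have hK : K24 = 12 * (p : ZMod (24 * p)) := by push_cast; ring
  by_cases hpair : ∀ a ∈ s.map (ZMod.castHom hnm (ZMod (12 * p))),
      ∀ b ∈ (s.map (ZMod.castHom hnm (ZMod (12 * p)))).erase a, a + b ≠ 0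
  · obtain ⟨y, hy⟩ := classify_hodgeMultiset_twelvePrime hp h17 hT hc4 hpair
    rcases hy with e | e | e | ⟨-, e⟩
    rotate_left 3
    · -- exceptional (level `12p`): `4y` resp. `6y` is an even member
      exfalso
      rcases e with e | e
      · have := hRodd (4 * y) (by rw [e]; simp)
        rw [show (4 : ZMod (12 * p)) * y = 2 * (2 * y) by ring, val_two_mul_mod_two_twelve] at this
        omega
      · have := hRodd (6 * y) (by rw [e]; simp)
        rw [show (6 : ZMod (12 * p)) * y = 2 * (3 * y) by ring, val_two_mul_mod_two_twelve] at this
        omega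
    · exfalso
      have := hRodd (-(2 * y)) (by rw [e]; simp)
      rw [val_neg_mod_two_twelve, val_two_mul_mod_two_twelve] at this
      omega
    · exfalso
      have := hRodd (-(4 * y)) (by rw [e]; simp)
      rw [val_neg_mod_two_twelve, show (4 : ZMod (12 * p)) * y = 2 * (2 * y) by ring, val_two_mul_mod_two_twelve] at this
      omega
    · -- `s̄ = C_y`: pull the four members back
      simp only [Multiset.insert_eq_cons] at e
      obtain ⟨x₁, s₁, hs₁, hx₁, e₁⟩ := exists_cons_of_map_eq_cons (ZMod.castHom hnm (ZMod (12 * p))) e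
      obtain ⟨x₂, s₂, hs₂, hx₂, e₂⟩ := exists_cons_of_map_eq_cons (ZMod.castHom hnm (ZMod (12 * p))) e₁
      obtain ⟨x₃, s₃, hs₃, hx₃, e₃⟩ := exists_cons_of_map_eq_cons (ZMod.castHom hnm (ZMod (12 * p))) e₂
      rw [← Multiset.cons_zero] at e₃
      obtain ⟨x₄, s₄, hs₄, hx₄, e₄⟩ := exists_cons_of_map_eq_cons (ZMod.castHom hnm (ZMod (12 * p))) e₃
      have hs₄0 : s₄ = 0 := Multiset.map_eq_zero.mp e₄
      have hsx : s = {x₁, x₂, x₃, x₄} := by rw [hs₁, hs₂, hs₃, hs₄, hs₄0]; rfl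
      have hRE : ZMod.castHom hnm (ZMod (12 * p)) E24 = D12 := map_natCast _ (4 * p)
      have h₂ := lift_eq hp0 hnm (a := x₂) (b := x₁ + E24) (by rw [_root_.map_add, hx₁, hRE, hx₂])
      have h₃ := lift_eq hp0 hnm (a := x₃) (b := x₁ + 2 * E24) (by rw [_root_.map_add, _root_.map_mul, map_ofNat, hx₁, hRE, hx₃])
      have h₄ := lift_eq hp0 hnm (a := x₄) (b := -(3 * x₁)) (by rw [_root_.map_neg, _root_.map_mul, map_ofNat, hx₁, hx₄])
      have hsum := hs.1.2
      rw [hsx] at hsum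
      simp only [Multiset.insert_eq_cons, Multiset.sum_cons, Multiset.sum_singleton] at hsum
      -- the four lifts with `Σ = 0`: `γ` or `δ`
      have hγδ : s = {x₁, x₁ + D24, x₁ + 2 * D24, -(3 * x₁)} ∨ ∃ v ∈ s, s = {v, v + E24, v - E24, -(3 * v)} := by
        rcases h₂ with rfl | rfl <;> rcases h₃ with rfl | rfl <;> rcases h₄ with rfl | rfl
        · exfalso; apply K_ne_zero (p := p) hp0
          simp only [hE, hK] at hsum ⊢; linear_combination hsum
        · refine Or.inr ⟨x₁ + E24, by rw [hsx]; simp, ?_⟩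
          rw [hsx, show x₁ + E24 + E24 = x₁ + 2 * E24 by ring, show x₁ + E24 - E24 = x₁ by ring,
            show -(3 * (x₁ + E24)) = -(3 * x₁) + K24 by simp only [hE, hK]; linear_combination -P24]
          simp only [Multiset.insert_eq_cons, ← Multiset.singleton_add]; abel
        · refine Or.inr ⟨x₁, by rw [hsx]; simp, ?_⟩
          rw [hsx, show x₁ + 2 * E24 + K24 = x₁ - E24 by simp only [hE, hK]; linear_combination P24]
        · exfalso; apply K_ne_zero (p := p) hp0
          simp only [hE, hK] at hsum ⊢; linear_combination hsum - P24
        · left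
          rw [hsx, show x₁ + E24 + K24 = x₁ + 2 * D24 by simp only [hE, hK, hD]; ring,
            show x₁ + 2 * E24 = x₁ + D24 by simp only [hE, hD]; ring]
          simp only [Multiset.insert_eq_cons, ← Multiset.singleton_add]; abel
        · exfalso; apply K_ne_zero (p := p) hp0
          simp only [hE, hK] at hsum ⊢; linear_combination hsum - P24
        · exfalso; apply K_ne_zero (p := p) hp0
          simp only [hE, hK] at hsum ⊢; linear_combination hsum - P24
        · refine Or.inr ⟨x₁ + 2 * E24 + K24, by rw [hsx]; simp, ?_⟩
          rw [hsx, show x₁ + 2 * E24 + K24 + E24 = x₁ by simp only [hE, hK]; linear_combination P24,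
            show x₁ + 2 * E24 + K24 - E24 = x₁ + E24 + K24 by ring,
            show -(3 * (x₁ + 2 * E24 + K24)) = -(3 * x₁) + K24 by simp only [hE, hK]; linear_combination (-3) * P24]
          simp only [Multiset.insert_eq_cons, ← Multiset.singleton_add]; abel
      rcases hγδ with e' | ⟨v, hv, e'⟩
      · exact ⟨x₁, e'⟩
      · exfalso
        obtain ⟨e₀, c, rfl⟩ : ∃ e₀ c, v = pt h e₀ c := ⟨_, _, (pt_crt h v).symm⟩
        have hc : c ≠ 0 := by
          intro hc0
          subst hc0
          obtain ⟨w, hw, hw0⟩ := hex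
          apply hw0
          rw [e'] at hw
          have hE2 : (crt h E24).2 = 0 := by rw [natCast_mul_P h 4, crt_pt]
          simp only [Multiset.insert_eq_cons, Multiset.mem_cons, Multiset.mem_singleton] at hw
          rcases hw with rfl | rfl | rfl | rfl
          · simp only [crt_pt]
          · simp only [_root_.map_add, Prod.snd_add, crt_pt, hE2, add_zero]
          · simp only [_root_.map_sub, Prod.snd_sub, crt_pt, hE2, sub_zero]
          · simp only [_root_.map_neg, _root_.map_mul, map_ofNat, Prod.snd_neg, Prod.snd_mul, Prod.snd_ofNat, crt_pt, mul_zero, neg_zero]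
        have he₀ : e₀.val % 2 = 1 := by rw [← val_pt_mod_two h e₀ c]; exact hodd _ hv
        refine delta_not_rels hp h17 he₀ (pi_facts hp h5).2.2 hc ?_
        rw [e', map_crt_delta] at hRel
        exact hRel
  · -- `s̄` has a pair: `s = {u₁, 12p − u₁, u₃, 12p − u₃}`
    push Not at hpair
    exfalso
    obtain ⟨a, ha, b, hb, hab⟩ := hpair
    obtain ⟨u₁, hu₁, rfl⟩ := Multiset.mem_map.mp ha
    rw [← Multiset.map_erase_of_mem _ _ hu₁] at hb
    obtain ⟨u₂, hu₂, rfl⟩ := Multiset.mem_map.mp hb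
    have hK0 : ZMod.castHom hnm (ZMod (12 * p)) K24 = 0 := by rw [map_natCast, ZMod.natCast_self]
    rcases lift_eq hp0 hnm (a := u₂) (b := -u₁) (by rw [_root_.map_neg]; linear_combination hab) with e2 | e2
    · exact hpf u₁ hu₁ u₂ hu₂ (by rw [e2, add_neg_cancel])
    -- the other two members
    obtain ⟨t, ht⟩ : ∃ t, s = u₁ ::ₘ u₂ ::ₘ t := by
      obtain ⟨t, ht⟩ := Multiset.exists_cons_of_mem hu₂
      exact ⟨t, by rw [← Multiset.cons_erase hu₁, ht]⟩
    have hct : Multiset.card t = 2 := by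
      rw [ht, Multiset.card_cons, Multiset.card_cons] at hcard; omega
    obtain ⟨u₃, u₄, rfl⟩ := Multiset.card_eq_two.mp hct
    have hu₃ : u₃ ∈ s := by rw [ht]; simp
    have hu₄ : u₄ ∈ s.erase u₃ := by
      rw [ht, show u₁ ::ₘ u₂ ::ₘ ({u₃, u₄} : Multiset (ZMod (24 * p))) = u₃ ::ₘ u₁ ::ₘ u₂ ::ₘ {u₄} by
        simp only [Multiset.insert_eq_cons, ← Multiset.singleton_add]; abel, Multiset.erase_cons_head]
      simp
    have hτ : IsHodgeMultiset ({ZMod.castHom hnm (ZMod (12 * p)) u₃, ZMod.castHom hnm (ZMod (12 * p)) u₄} :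
        Multiset (ZMod (12 * p))) := by
      have e3 : s.map (ZMod.castHom hnm (ZMod (12 * p))) = ZMod.castHom hnm (ZMod (12 * p)) u₁ ::ₘ
          (-ZMod.castHom hnm (ZMod (12 * p)) u₁) ::ₘ {ZMod.castHom hnm (ZMod (12 * p)) u₃, ZMod.castHom hnm (ZMod (12 * p)) u₄} := by
        rw [ht]
        simp only [Multiset.map_cons, Multiset.insert_eq_cons, Multiset.map_singleton, e2, _root_.map_add, _root_.map_neg, hK0, add_zero]
      rw [e3] at hT
      exact isHodgeMultiset_of_cons_cons_neg hT
    have e4 := eq_neg_of_isHodgeMultiset_pair hτ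
    rcases lift_eq hp0 hnm (a := u₄) (b := -u₃) (by rw [_root_.map_neg]; exact e4) with e5 | e5
    · exact hpf u₃ hu₃ u₄ hu₄ (by rw [e5, add_neg_cancel])
    -- order the two half-pairs so that the first is off the fibre `0`
    have hsw : s = {u₁, -u₁ + K24, u₃, -u₃ + K24} := by rw [ht, e2, e5]; rfl
    have hord : ∃ v₁ v₃ : ZMod (24 * p), (crt h v₁).2 ≠ 0 ∧ s = {v₁, -v₁ + K24, v₃, -v₃ + K24} := by
      by_cases h₁ : (crt h u₁).2 ≠ 0
      · exact ⟨u₁, u₃, h₁, hsw⟩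
      · push Not at h₁
        refine ⟨u₃, u₁, ?_, by rw [hsw]; simp only [Multiset.insert_eq_cons, ← Multiset.singleton_add]; abel⟩
        obtain ⟨w, hw, hw0⟩ := hex
        rw [hsw] at hw
        have hK2 : (crt h K24).2 = 0 := by rw [twelveP_eq_pt h hp h5, crt_pt]
        simp only [Multiset.insert_eq_cons, Multiset.mem_cons, Multiset.mem_singleton] at hw
        rcases hw with rfl | rfl | rfl | rfl
        · exact absurd h₁ hw0
        · exfalso; apply hw0; rw [_root_.map_add, Prod.snd_add, _root_.map_neg, Prod.snd_neg, h₁, hK2, neg_zero, add_zero]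
        · exact hw0
        · intro h₃; apply hw0; rw [_root_.map_add, Prod.snd_add, _root_.map_neg, Prod.snd_neg, h₃, hK2, neg_zero, add_zero]
    obtain ⟨v₁, v₃, hc, hsv⟩ := hord
    have hv₁ : v₁ ∈ s := by rw [hsv]; simp
    have hv₃ : v₃ ∈ s.erase v₁ := by rw [hsv, Multiset.insert_eq_cons, Multiset.erase_cons_head]; simp
    have hv₃' : -v₃ + K24 ∈ s.erase v₁ := by rw [hsv, Multiset.insert_eq_cons, Multiset.erase_cons_head]; simp
    have hv₃s : v₃ ∈ s := Multiset.mem_of_mem_erase hv₃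
    obtain ⟨e₀, c, rfl⟩ : ∃ e₀ c, v₁ = pt h e₀ c := ⟨_, _, (pt_crt h v₁).symm⟩
    obtain ⟨f, c', rfl⟩ : ∃ f c', v₃ = pt h f c' := ⟨_, _, (pt_crt h v₃).symm⟩
    simp only [crt_pt] at hc
    have he₀ : e₀.val % 2 = 1 := by rw [← val_pt_mod_two h e₀ c]; exact hodd _ hv₁
    have hf : f.val % 2 = 1 := by rw [← val_pt_mod_two h f c']; exact hodd _ hv₃s
    have hK' : ∀ (e : ZMod 24) (b : ZMod p), -(pt h e b) + K24 = pt h (12 - e) (-b) := by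
      intro e b
      rw [twelveP_eq_pt h hp h5, neg_pt, pt_add, add_zero, show -e + 12 = 12 - e by ring]
    have hz1 : ((f, c') : ZMod 24 × ZMod p) ≠ -(e₀, c) := by
      intro hq
      apply hpf _ hv₁ _ hv₃
      have : crt h (pt h f c') = crt h (-(pt h e₀ c)) := by rw [crt_pt, _root_.map_neg, crt_pt]; exact hq
      have := (crt h).injective this
      rw [this, add_neg_cancel]
    have hz2 : ((12 - f, -c') : ZMod 24 × ZMod p) ≠ -(e₀, c) := by
      intro hq
      apply hpf _ hv₁ _ hv₃'
      have : crt h (-(pt h f c') + K24) = crt h (-(pt h e₀ c)) := by rw [hK', crt_pt, _root_.map_neg, crt_pt]; exact hq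
      have := (crt h).injective this
      rw [this, add_neg_cancel]
    refine halfpair_odd hp h17 he₀ hf hc ?_ hz1 hz2
    rw [hsv, hK', hK'] at hRel
    simp only [Multiset.insert_eq_cons, Multiset.map_cons, Multiset.map_singleton, crt_pt] at hRel
    exact hRel

/-! ### Assembly -/

/-- **Classification of the pair-free Hodge `4`-multisets of level `24p`, `p ≥ 17` prime** (multiset form of Shioda's Prop. 4 (Q′) /
Aoki–Shioda's Theorem (𝔅²ₘ) (ii) at `m = 24p`, together with the level-`24` exceptional quadruples). A pair-free Hodge
`4`-multiset over `ℤ/24p` is `{x, x + 12p, −2x, 12p}` (type `α`, `m′ = 12p`), `{x, x + 12p, 2x + 12p, −4x}` (type `β`),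
`{x, x + 8p, x + 16p, −3x}` (type `γ`, `m″ = 8p`) for some residue `x`, or `x·r` with `x = t p`, `t` a unit of `ℤ/24`, and `r` one
of the `8` exceptional quadruples of level `24` printed in Tabelle 1 — `(1, 6, 19, 22)`, `(1, 8, 17, 22)`, `(1, 8, 19, 20)`,
`(1, 11, 17, 19)`, `(1, 12, 16, 19)`, `(1, 12, 17, 18)`, `(1, 13, 16, 18)`, `(2, 9, 16, 21)` (`8` orbits of sizes
`8, 8, 4, 2, 4, 4, 4, 4`: Shioda's `Δ(24) = 38`) — or one of the doubles `(2, 8, 18, 20)`, `(2, 12, 16, 18)` of the two of level `12`.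
PROOF: the character relations `ψ = χ₃χ₋₈`, `χ₈`, `Γ(χ₋₈)`, `Γ(χ₄)`, `Γ(χ₃)` of `KoblitzOgusRelationsTwentyFourPrime` (from
`KoblitzOgus.hodge_eq_combination`) and the transfer to level `12p` (`isHodgeMultiset_transfer_twentyFourPrime` +
`classify_hodgeMultiset_twelvePrime`), by the number of odd members: `fibre_zero`, `case_all_even`, `case_two_odd`,
`case_two_odd_fibre`, `case_all_odd`.
[cite: Shioda1982PicardFermat, §4 Lemma 1 p. 728, Prop. 4 (Q′) p. 729 and table p. 727 (m = 12, 24)]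
[cite: AokiShioda1983, §2 Theorem (𝔅²ₘ) (ii) a)–c), p. 3] [cite: MeyerNeutsch1981Fermatquadrupel, Tabelle 1 p. 54 (N = 12, 24)]
[cite: Aoki1983, Prop. 2.2] [cite: Deligne1982HodgeCycles, Rem. 7.16 (a)] -/
theorem classify_hodgeMultiset_twentyFourPrime [NeZero (24 * p)] (hp : p.Prime) (h17 : 17 ≤ p)
    {s : Multiset (ZMod (24 * p))} (hs : IsHodgeMultiset s) (hcard : Multiset.card s = 4)
    (hind : ∀ a ∈ s, ∀ b ∈ s.erase a, a + b ≠ 0) :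
    ∃ x : ZMod (24 * p), s = {x, x + K24, -(2 * x), K24} ∨ s = {x, x + K24, 2 * x + K24, -(4 * x)} ∨
      s = {x, x + D24, x + 2 * D24, -(3 * x)} ∨
      ((∃ t : ℕ, (t = 1 ∨ t = 5 ∨ t = 7 ∨ t = 11 ∨ t = 13 ∨ t = 17 ∨ t = 19 ∨ t = 23) ∧ x = ((t * p : ℕ) : ZMod (24 * p))) ∧
        (s = {x, 6 * x, 19 * x, 22 * x} ∨ s = {x, 8 * x, 17 * x, 22 * x} ∨ s = {x, 8 * x, 19 * x, 20 * x} ∨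
          s = {x, 11 * x, 17 * x, 19 * x} ∨ s = {x, 12 * x, 16 * x, 19 * x} ∨ s = {x, 12 * x, 17 * x, 18 * x} ∨
          s = {x, 13 * x, 16 * x, 18 * x} ∨ s = {2 * x, 9 * x, 16 * x, 21 * x} ∨ s = {2 * x, 8 * x, 18 * x, 20 * x} ∨
          s = {2 * x, 12 * x, 16 * x, 18 * x})) := by
  classical
  have h5 : 5 ≤ p := by omega
  have h := coprime_twentyFour hp h5
  -- the fibre `0`
  by_cases hex : ∃ w ∈ s, (crt h w).2 ≠ 0
  swap
  · push Not at hex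
    exact fibre_zero h hp h17 hs hcard hind hex
  -- split by parity
  set so := s.filter fun w ↦ w.val % 2 = 1 with hso
  set se := s.filter fun w ↦ ¬ w.val % 2 = 1 with hse
  have hsplit : s = so + se := (Multiset.filter_add_not _ s).symm
  have hcs : Multiset.card so + Multiset.card se = 4 := by rw [← Multiset.card_add, ← hsplit, hcard]
  have heven : Even (Multiset.card so) := even_card_filter_odd hs.1.2
  have hso1 : ∀ v ∈ so, v.val % 2 = 1 := fun v hv ↦ (Multiset.mem_filter.mp hv).2
  have hse0 : ∀ v ∈ se, v.val % 2 = 0 := fun v hv ↦ by have := (Multiset.mem_filter.mp hv).2; omega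
  obtain ⟨k, hk⟩ := heven
  have hk2 : k ≤ 2 := by omega
  interval_cases k
  · -- no odd member
    have h0 : so = 0 := Multiset.card_eq_zero.mp (by omega)
    rw [h0, zero_add] at hsplit
    obtain ⟨x, hx⟩ := case_all_even hp h17 hs hcard hind fun v hv ↦ hse0 v (hsplit ▸ hv)
    refine ⟨x, ?_⟩
    rcases hx with hx | hx | hx | ⟨⟨t, ht, hxt⟩, hx⟩
    · exact Or.inl hx
    · exact Or.inr (Or.inl hx)
    · exact Or.inr (Or.inr (Or.inl hx))
    · refine Or.inr (Or.inr (Or.inr ⟨⟨t, by omega, hxt⟩, ?_⟩))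
      rcases hx with hx | hx
      · exact Or.inr (Or.inr (Or.inr (Or.inr (Or.inr (Or.inr (Or.inr (Or.inr (Or.inl hx))))))))
      · exact Or.inr (Or.inr (Or.inr (Or.inr (Or.inr (Or.inr (Or.inr (Or.inr (Or.inr hx))))))))
  · -- two odd members
    have h2 : Multiset.card so = 2 := by omega
    have h2' : Multiset.card se = 2 := by omega
    obtain ⟨x, y, hxy⟩ := Multiset.card_eq_two.mp h2
    obtain ⟨z, w, hzw⟩ := Multiset.card_eq_two.mp h2'
    have hx1 : x.val % 2 = 1 := hso1 x (by rw [hxy]; simp)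
    have hy1 : y.val % 2 = 1 := hso1 y (by rw [hxy]; simp)
    have hz0 : z.val % 2 = 0 := hse0 z (by rw [hzw]; simp)
    have hw0 : w.val % 2 = 0 := hse0 w (by rw [hzw]; simp)
    have hsx : s = {x, y, z, w} := by rw [hsplit, hxy, hzw, pair_add_pair]
    by_cases hxc : (crt h x).2 ≠ 0
    · rcases case_two_odd h hp h17 hs hind hsx hx1 hy1 hz0 hw0 hxc with e | e
      · exact ⟨x, Or.inl e⟩
      · exact ⟨x, Or.inr (Or.inl e)⟩
    by_cases hyc : (crt h y).2 ≠ 0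
    · have hsy : s = {y, x, z, w} := by
        rw [hsx]; simp only [Multiset.insert_eq_cons]; exact Multiset.cons_swap x y _
      rcases case_two_odd h hp h17 hs hind hsy hy1 hx1 hz0 hw0 hyc with e | e
      · exact ⟨y, Or.inl e⟩
      · exact ⟨y, Or.inr (Or.inl e)⟩
    push Not at hxc hyc
    exfalso
    by_cases hzc : (crt h z).2 ≠ 0
    · exact case_two_odd_fibre h hp h17 hs hind hsx hz0 hw0 hxc hyc hzc
    push Not at hzc
    have hwc : (crt h w).2 ≠ 0 := by
      obtain ⟨v, hv, hvc⟩ := hex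
      rw [hsx] at hv
      simp only [Multiset.insert_eq_cons, Multiset.mem_cons, Multiset.mem_singleton] at hv
      rcases hv with rfl | rfl | rfl | rfl
      · exact absurd hxc hvc
      · exact absurd hyc hvc
      · exact absurd hzc hvc
      · exact hvc
    have hsw : s = {x, y, w, z} := by rw [hsx, Multiset.pair_comm z w]
    exact case_two_odd_fibre h hp h17 hs hind hsw hw0 hz0 hxc hyc hwc
  · -- four odd members
    have h0 : se = 0 := Multiset.card_eq_zero.mp (by omega)
    rw [h0, add_zero] at hsplit
    obtain ⟨x, hx⟩ := case_all_odd h hp h17 hs hcard hind (fun v hv ↦ hso1 v (hsplit ▸ hv)) hex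
    exact ⟨x, Or.inr (Or.inr (Or.inl hx))⟩

end TwentyFourPrimeClassification

end Literature.AlgebraicGeometry.Shioda1982
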